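import Summits.CriticalPhenomena.SAWScalingLimit.Theses.SAWTotalPositivity
import Literature.Barriers.CriticalPhenomena.SupercriticalSAWSpaceFillingSteps
import Literature.Probability.RandomPlanarGeometry.SupercriticalSAWProp3Holds
import Literature.Probability.RandomPlanarGeometry.SAWPolygonOpening
import Literature.Probability.RandomPlanarGeometry.SAWSusceptibility
import Literature.Probability.RandomPlanarGeometry.BDGS2012Prop13
import Literature.Probability.RandomPlanarGeometry.SAWBubbleBound
import Literature.Probability.RandomPlanarGeometry.SelfAvoidingWalkCert
import Literature.Probability.RandomPlanarGeometry.SelfAvoidingWalkProofs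
import Literature.Probability.RandomPlanarGeometry.SAWTargetOrder
import Literature.Probability.RandomPlanarGeometry.SAWWords
import Literature.Barriers.CriticalPhenomena.LaceExpansionMeanFieldProofs
import Literature.Probability.RandomPlanarGeometry.HammersleyWelshBound
import Literature.Probability.RandomPlanarGeometry.SAWPolygonsFromBridges
import Literature.Barriers.CriticalPhenomena.SAPCanonical
import Literature.Probability.RandomPlanarGeometry.SAWRatioLimit
import Literature.Probability.RandomPlanarGeometry.HexSAWLemma2
import Literature.Probability.RandomPlanarGeometry.HexSAWLowerBound
import Summits.CriticalPhenomena.SAWScalingLimit.Theorems.CriticalBubbleBound.Negative.CriticalBubbleBoundConstantBound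
import Summits.CriticalPhenomena.SAWScalingLimit.Theorems.CriticalBubbleBound.Negative.CriticalBubbleBoundRandomWalkFalse
import Summits.CriticalPhenomena.SAWScalingLimit.Theorems.CriticalBubbleBound.Negative.CriticalBubbleBoundWordReflection
import Summits.CriticalPhenomena.SAWScalingLimit.Theorems.CriticalBubbleBound.Negative.CriticalBubbleBoundBoundaryBulkMemoryless
import Summits.CriticalPhenomena.SAWScalingLimit.Theorems.CriticalBubbleBound.Negative.CriticalBubbleBoundUnrootedPolygons

/-!
# Disproof of `CriticalBubbleBound` — standing adversary's work file
(crux item stmt-CriticalPhenomena-7117 of route SAWTotalPositivity; refuter `cdisprove`, gen 2–5;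
everything below is `lean check`ed, sorry-free unless marked NEAR-MISS)

FILE LAYOUT NOTE (gen 5): `ledger crux write` caps this file at 200 kB, so from gen 5 the BODIES of
the landed sections §8, §13, §14, §17, §21 live only in their `Theorems/CriticalBubbleBound/Negative/`
files (imported above; same theorem names under namespace `…Theorems.CriticalBubbleBound.Negative`);
their docblocks and the index entries below are kept. Later generations: when a section lands,
replace its body here by the same kind of stub.

CRUX (read-back, §0): `∃ C < ∞, ∀ Ω bounded, δ > 0, u ∼ v in ℤ², Z_Ω(u,v) := Σ_{γ:u→v SAW of Ω_δ} x_c^{|γ|} ≤ C`.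

VERDICT SO FAR: NOT REFUTED and not refutable by typing artefacts. The statement is EQUIVALENT
(§1, `criticalBubbleBound_iff_bubble_ne_top`) to the finiteness of the critical nearest-neighbour
two-point function `G_{x_c}(0,e) = Σ_n c_n(0,e) x_c^n` of `ℤ²` — Madras–Slade 1993 p. 37: "not
yet proved that G_{z_c}(0,x) is even finite for d = 2,3,4"; believed TRUE (`c_{m-1}(0,e) =
(m/2) p_m ~ μ^m m^{-3/2}`, `G_{x_c}(0,e) ≈ 0.81`). A disproof needs `Σ_m m p_m μ^{-m} = ∞`, i.e.
the polygon exponent `α ≥ 1` against the conjectured `α = 1/2` and all enumeration data.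

FINDINGS (theorem names in this namespace):
* §1 `weightAt_univ_le_latticeKernel` — HYPOTHESIS-FREE domination `Z^x_Ω(u,v) ≤ K_x(u,v)` for
  every `Ω ⊆ ℂ`, every real `δ`, every `x` (forgetful injection of SAWs of `Ω_δ` into SAWs of `ℤ²`);
  `latticeKernel_le_of_forall_unitDisk` — EXHAUSTION: the disks `𝔻_δ` alone force `K_x(u,v) ≤ C`;
  `criticalBubbleBound_iff_latticeKernel`, `criticalBubbleBound_iff_bubble_ne_top` — the crux
  ⟺ `∃ C, ∀ u ∼ v, K_{x_c}(u,v) ≤ C` ⟺ `∀ unit e, G_{x_c}(0,e) < ∞` (translation invariance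
  `latticeKernel_shift`). Domains, meshes and the largest-component convention are eliminated.
* §2 `criticalBubbleBound_iff_withoutBoundedPos` — `IsBounded Ω` and `0 < δ` are IDLE: dropping
  both gives an equivalent statement (no `_false_without_` theorem can exist for them).
* §3 `criticalBubbleBoundWithoutAdj_iff` — dropping `u ∼ v` gives `sup_x G_{x_c}(0,x) < ∞`, open
  and believed true (two-point function decays); implies the crux; not refutable. `u ∼ v` only
  selects WHICH number the constant is.
* §4 `not_criticalBubbleBoundAt_of_criticalFugacity_lt` — the FUGACITY IS LOAD-BEARING: for every
  `x > x_c` the same statement is FALSE (DKY 2014 Prop. 3 `limsup Z_m(x) = ∞`, proved in tree,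
  transported by opening the face polygons at the south cardinal edge into SAWs of `𝔻_δ`:
  `Zbox_le_mul_weightAt : Z_m(x) ≤ x · Z^x_{𝔻_δ}((m,0),(m+1,0))`). Lattice form:
  `exists_latticeKernel_eq_top_of_criticalFugacity_lt : ∃ e ∼ 0, K_x(0,e) = ∞`.
* §5 `latticeKernel_zero_eq_tsum_countAt` — `K_x(0,w) = Σ_n c_n(w) x^n`;
  `criticalBubbleBoundAt_of_lt_criticalFugacity` — the SUBCRITICAL side is TRUE in the strongest
  form (all pairs, all domains, `0 < x < x_c`): the crux sits exactly at the edge.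
* §6 `not_freeEndpointBound` — the FREE-ENDPOINT / susceptibility strengthening `Σ_v Z_Ω(u,v) ≤ C`
  is FALSE at `x_c` (`c_n x_c^n ≥ 1`): a proof must use the return to a NEIGHBOUR (polygons).
* §7 `criticalBubbleBound_iff_tsum_countAt_ne_top` (crux ⟺ `Σ_n c_n(e) x_c^n < ∞`) and the
  realistic target `criticalBubbleBound_of_closing_bound` (`c_n(e) x_c^n ≤ K (n+1)^{-1-ε}` ⇒ crux).
* §8 `const_ge_of_criticalBubbleBound` — CERTIFIED: any admissible `C ≥ 0.5405` (kernel-`decide`d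
  walk lists `c_1,c_3,c_5,c_7(e₀) ≥ 1,2,6,28` + certified `μ ≤ 2.7`; axiom-clean variant `≥ 0.4449`);
  numerics `G_{x_c}(0,e₀) ≈ 0.80` (exact `c_n(0,e₀)` to `n = 21`, kit job j006917 for `n ≤ 27`).
* §9 planner notes: the foreseen `HalfPlaneBubble → BulkFromBoundary` split is NOT glue (the
  multiplicity factor `m` = position of the root edge; and the route's Harnack constant at slit
  tips needs the SLIT-PLANE bubble, not the half-plane one; on Hex the half-plane arch function IS
  bounded by the parafermionic identity, the bulk one is not known); TP₂ is degree-0 homogeneous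
  and cannot produce the constant; `d ≥ 5` is a theorem, SRW `d = 2` is false. Typed:
  `bubble_chain : A ≤ S ≤ G` (half-plane ≤ slit-plane ≤ bulk bubbles; the route consumes `S` at
  slit tips, the foreseen layer-2 crux offers `A`), `halfPlaneBubbleFinite_of_criticalBubbleBound`,
  target shape `ClosingBound ε`.
* §10 `bubble_eq_bubble_e₀`, `criticalBubbleBound_iff_bubble_e₀_ne_top` — dihedral symmetry:
  the crux is ONE number, `G_{x_c}(0,e₀) < ∞`.
* §11 `latticeKernel_criticalFugacity_eq_iSup`, `criticalBubbleBound_iff_subcritical_bounded` —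
  left-continuity: crux ⟺ the finite subcritical kernels `K_x(u,v)`, `u ∼ v`, stay bounded as
  `x ↑ x_c` (no divergence of the energy-like quantity at `x_c⁻`, exponent `1 - α > 0`).
* §12 `countAt_e₀_eq_zero_of_even` — parity: only odd `n` contribute (`ℤ²` bipartite).
* §13 computational corollary `C ≥ 0.5405` (work file only, `ofReduceBool`).
* §14 (gen 3) `criticalBubbleBound_false_without_selfAvoidance` — SELF-AVOIDANCE IS LOAD-BEARING:
  the memoryless analogue (all nearest-neighbour words `w_n(v)` of `ℤ²` at THEIR critical fugacity
  `1/4`, same display as the normal form of §7) is FALSE: `rwKernel_quarter_e₀_eq_top`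
  (`Σ_n w_n(e₀) 4^{-n} = ∞`, Pólya recurrence, via the diagonal-coordinates injection
  `choose_sq_le_rwCountAt : C(2n+1,n+1)² ≤ w_{2n+1}(e₀)` and `sixteen_pow_le : 16ⁿ ≤ 4n·C(2n,n)²`),
  while its subcritical side is finite (`rwKernel_ne_top_of_lt_quarter`, `x < 1/4`) and it
  dominates the SAW kernel termwise (`countAt_le_rwCountAt`, `latticeKernel_zero_le_rwKernel`).
  Landed copy: `Theorems/CriticalBubbleBound/Negative/CriticalBubbleBoundRandomWalkFalse.lean`.
  Finite-memory remark (prose, §14 docstrings): every memory-`k` truncation is a finite-state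
  Markov chain × `ℤ²` with a local limit theorem, so its critical nearest-neighbour kernel also
  diverges like `Σ 1/n` — a proof must use UNBOUNDED memory (the repulsion at all scales).
* §15 (gen 3) BARRIER REDUCTION — `criticalBubbleBound_iff_twoPointENN_lt_top`: the crux is
  verbatim `∀ e ∼ 0, G_{z_c}(e) < ∞` for the catalogue's `Literature.Barriers.CriticalPhenomena.twoPointENN`;
  `criticalBubbleBound_of_bubbleCondition`: the ℓ²-strengthening `BubbleCondition 2` (`B(z_c) =
  Σ_x G² < ∞`, the lace-expansion output and the way `G_{z_c}(0,e) < ∞` is known for `d ≥ 5`)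
  implies the crux BUT IS FALSE on `ℤ²` — tree theorem `not_bubbleCondition_two`
  (`tsum_bubble_sq_eq_top : Σ_x K_{x_c}(0,x)² = ∞`; sphere bound `one_le_sum_sphere_bubble`).
  Hierarchy: ℓ¹ = ∞ (§6), ℓ² = ∞ (§15), ℓ^∞ open (§3), value at `e₀` = the crux.
  Landed copy: `Theorems/CriticalBubbleBound/Negative/CriticalBubbleBoundBubbleConditionFalse.lean`.
* §16 (gen 3) THE DISPROOF SIDE — `not_criticalBubbleBound_iff` (a refutation = `Σ_n c_n(0,e)
  x_cⁿ = ∞` for a unit `e`) and the PROVED WINDOW for the terms `t_n = c_n(0,e) x_cⁿ`: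
  `hw_term_lower_bound` (`t_{2M+1}((0,-1)) ≥ x_c e^{-2c√M}/((2M+1)⁴(M+1)⁴)`, Hammersley–Welsh +
  Madras–Slade Thm 3.2.4, tree theorems) and `hw_term_upper_bound` (`t_n ≤ e^{κ√n}`). Proved:
  stretched exponentials on both sides; conjectured `t_n ≍ n^{-3/2}`; the crux needs `Σ t_n < ∞`,
  a refutation `Σ t_n = ∞` (⇐ polynomial LOWER bounds on polygon numbers along a divergent set —
  none proved). Landed copy: `Theorems/CriticalBubbleBound/Negative/CriticalBubbleBoundProvedWindow.lean`.

* §17 (gen 4) BOUNDARY ≠ BULK IN THE MEMORYLESS MODEL — `hpKernel_quarter_e₀_ne_top`: the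
  half-plane ARCH kernel `H_{1/4}(e₀) = Σ_n h_n(e₀) 4^{-n}` (words `0 → e₀` staying in `{y ≥ 0}`) is
  FINITE (`≤ Σ_m 2/(m+2)²`; reflection principle at level `-1` — `reflectTail`, an involution on
  dipping words with `(x,y) ↦ (x,-2-y)` — plus the EXACT diagonal count `w_{2m+1}(e₀) = C(2m+1,m+1)²`
  (`rwCountAt_e₀_le_choose_sq` with §14) and `centralBinom_sq_mul_succ_le : C(2n,n)²(n+1) ≤ 16ⁿ`;
  key step `hpCountAt_bound : 2(m+2)² h_{2m+1}(e₀) ≤ 16^{m+1}`), while the BULK kernel between the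
  same two sites is infinite (§14): `boundary_finite_bulk_infinite_memoryless`,
  `not_bulkFromBoundaryMemoryless`. MESSAGE: "half-plane bubble finite ⇒ bulk bubble finite"
  (the foreseen `BulkFromBoundary`, §9a) is false for the one solvable comparison kernel by a
  full power of `n` (`n^{-2}` vs `n^{-1}` terms): for SAW it can only come from the polygon
  structure (re-rooting `γ ∪ {e₀,0}` at its lowest edge), i.e. from self-avoidance, never from a
  kernel/reflection inequality. Landed copies: `Negative/CriticalBubbleBoundWordReflection.lean`
  (p72424) and `Negative/CriticalBubbleBoundBoundaryBulkMemoryless.lean` (p73940).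

* §18 (gen 4) POLYGON NORMAL FORM — `criticalBubbleBound_iff_polygonSeries_ne_top`:
  `CriticalBubbleBound ⟺ T := Σ_N N q_N x_c^N < ∞` (`q_N = isotropicPolygonCount N`, SAPs up to
  translation), via the EXACT identity `two_mul_criticalFugacity_mul_bubble_e₀`:
  `2 x_c G_{x_c}(0,e₀) = 2 x_c² + T`, i.e. `G_{x_c}(0,e₀) = x_c + Σ_N (N/2) q_N x_c^{N-1}`
  (Madras–Slade `2N q_N = Σ_{e∼0} c_{N-1}(0,e)`: `sum_countAt_eq_mul_isotropicPolygonCount`, from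
  the tree's canonical words `rootedPolygonCount = 2N · polygonCount` and the parity/partition
  lemma `sum_rootedPolygonCount_eq`). The typed form of §9a(1) (the bulk bubble carries the
  multiplicity `N`) and the common start of all four ideator cards ("`θ > 2` summably").
  Landed copy: `Negative/CriticalBubbleBoundPolygonSeries.lean` (p73949).

* §19 (gen 4) DIMENSION LEDGER — `CriticalBubbleBoundDim d` (`∀ e ∼ 0, G_{z_c(d)}(e) < ∞` on
  `ℤ^d`): `criticalBubbleBoundDim_two_iff` (d = 2 is the crux), `criticalBubbleBoundDim_one`
  (d = 1 TRUE: SAWs of `ℤ` are monotone — the tree's `Zd.apply_eq_mul_of_mem_saws_one` — so `c_n(0,±1) = [n = 1]`),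
  `criticalBubbleBoundDim_of_bubbleCondition` / `criticalBubbleBoundDim_of_haraSlade` (d ≥ 5 TRUE
  given the vendored `HaraSlade1992_bubbleCondition`), `dimension_ledger`. Nothing soft separates
  d = 2 from d = 3, 4 (equally open): a proof valid for all `d ≤ 4` would settle three open
  problems at once; a disproof by a soft low-dimensional mechanism must fail at d = 1.
  Landed copy: `Negative/CriticalBubbleBoundDimension.lean` (p73945).

* §20 (gen 4) HEX COMPARISON — `hex_stripA_le`, `hex_stripAlim_le`: on the honeycomb lattice the
  half-plane ARCH function is BOUNDED, `A_{T,L}(x_c^{hex}) ≤ 1/cos(3π/8) ≈ 2.613` uniformly in the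
  strip (tree theorems, DCS Lemma 2 discharged) — the Hex analogue of `HalfPlaneBubble` is TRUE,
  while the Hex analogues of the bulk crux and of the slit-plane bubble are open; on `ℤ²` all
  three are open. Boundary results do not transfer to the bulk (§9a, §17).

* §21 (gen 4) UNROOTED POLYGON MASS — `unrootedPolygonSeries` (`𝒫 := Σ_N q_N x_c^N`, "`θ > 1`"):
  `unrootedPolygonSeries_le_polygonSeries` (`𝒫 ≤ T`) and `unrootedPolygonSeries_le_halfPlaneBubble`
  (`𝒫 ≤ x_c · A`: every canonical SAP word — tree's `Haruspicy.canonWords`, rooted at the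
  lowest-then-leftmost vertex, first letter `E` — read backwards minus its last edge is a
  half-plane ARCH `0 → e₀`, injectively: `archOf`, `archSigma_injective`, `canon_facts`); hence
  `unrootedPolygonSeries_ne_top_of_halfPlaneBubbleFinite` and `…_of_criticalBubbleBound`. With
  §18 this types the exponent ledger of `bubble_chain` at both ends: `HalfPlaneBubble` (the
  foreseen layer-2 crux) and the cards' `UnrootedPolygonMassFinite` sit at `θ > 1` (`𝒫`), the crux
  at `θ > 2` (`T`) — one full power of `N` apart, the same power by which boundary and bulk differ
  in the memoryless model (§17). Landed copy: `Negative/CriticalBubbleBoundUnrootedPolygons.lean` (p75741).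

* §22 (gen 4) RADIUS — `polygonSeriesAt x` (`T_x = Σ_N N q_N x^N`): `ofReal_mul_sum_latticeKernel`
  (`x Σ_{e∼0} K_x(0,e) = 4x² + 2T_x`, all `x ≥ 0`), `criticalBubbleBoundAt_iff_polygonSeriesAt_ne_top`
  (`CriticalBubbleBoundAt x ⟺ T_x < ∞`, `x > 0`), hence `polygonSeriesAt_ne_top_of_lt` (finite on
  `(0,x_c)`, §5) and `polygonSeriesAt_eq_top_of_criticalFugacity_lt` (INFINITE on `(x_c,∞)`, from
  §4/DKY — the polygon generating function's radius is exactly `x_c`, re-derived without bridges);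
  `polygonSeries_radius`: the crux is precisely "the nonnegative power series `T_x` is finite AT its
  radius of convergence" — the sign of `θ - 2`, which no soft argument decides.
  Landed copy: `Negative/CriticalBubbleBoundPolygonRadius.lean` (p75749).

* §23 (gen 5) POINTWISE FINITENESS EVERYWHERE — `latticeKernel_step`: the Simon–Lieb-type
  one-step inequality `K_x(0,b) ≤ K_x(0,a)·(x⁻¹ + K_x(a,b))` for `a ∼ b`, every `x > 0` (split a
  SAW `0 → b` at its visit of `a`, else append the edge `b → a`); `latticeKernel_le_pow` /
  `bubble_le_pow_dist`: UNCONDITIONALLY `K_x(0,b) ≤ (x⁻¹ + K_x(0,e₀))^{‖b‖₁}`; hence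
  `criticalBubbleBound_iff_forall_latticeKernel_ne_top`: the crux ⟺ `∀ x ∈ ℤ², G_{x_c}(0,x) < ∞`
  (Madras–Slade's open problem verbatim, for EVERY `x`; barrier form
  `criticalBubbleBound_iff_forall_twoPointENN_lt_top'`), and finiteness at any ONE neighbour
  site is already the crux (`criticalBubbleBound_iff_exists_unit_ne_top`). The §3 hierarchy closes
  up: `sup_x G < ∞` (open) ⟹ `∀ x, G(0,x) < ∞` ⟺ crux. Companion `latticeKernel_subharmonic`
  (last step dropped): `K_x(0,b) ≤ x Σ_{b'∼b} K_x(0,b')`, `b ≠ 0` — infinite values have infinite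
  neighbours (`exists_adj_latticeKernel_eq_top`); "`B = ∞ ⟹ G(0,b) = ∞ ∀ b ≠ 0`" would be a
  Harnack-type comparability (route item BoundaryHarnack's territory), not attempted. Landed copies:
  `Negative/CriticalBubbleBoundPointwise.lean`, `Negative/CriticalBubbleBoundSubharmonic.lean`.
* §24 (gen 5) `-- Targets` (picked line `docking-census-joining`, skeleton
  `Lines/docking-census-joining.lean`, stubs S1–S4): S4 `stub_ledgerBootstrap`'s analytic inputs
  are LOAD-BEARING — `not_ledgerBootstrap_without_kappa_nonneg` (`0 ≤ κ`),
  `not_ledgerBootstrap_without_apriori` (the Hammersley–Welsh a-priori bound; a merely exponential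
  bound would not do), `not_ledgerBootstrap_floor_lowered` (floor `-3/2` sharp), with
  `ledgerBootstrap_stub_iff` certifying the parametrised statement is the stub verbatim. S1 is true
  (drefute, exact mirror `n ≤ 15`); S2/S3 are open `∃∀`-statements with conjectural slack 3/16 on
  the true side — not refutable by finite models; their numerical test in the stubs' own
  normalisation (drefute's kit j008737, `N ≤ 2897`) was still QUEUED at this boundary. Landed copy:
  `Negative/CriticalBubbleBoundLedgerBootstrapMutations.lean`.

* §25 (gen 5) MOMENT LADDER — `momentSeries k = Σ_N N^k q_N x_c^N`: `M_0 = 𝒫` (§21), `M_1 = T`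
  (§18, the crux), monotone (`momentSeries_mono`); `criticalBubbleBound_of_momentSeries_ne_top`
  (`k ≥ 1`), `moment_ladder`. CALIBRATION: conjecturally finite iff `k ≤ 1` — the crux is the LAST
  finite moment (`M_2` = mean perimeter of the critical rooted polygon = `∞` if `θ = 5/2`), so
  `ClosingBound ε` (§9d) is conjecturally true iff `ε ≤ 1/2` while the crux needs any `ε > 0`.

* §26 (gen 5, prose) MODEL LEDGER — table of analogues (ℤ¹ true; slits `ℤ×{0..L}` true with
  exponential room since `μ_SAP(L) < μ_SAW(L)`, Soteros–Whittington 1988, read in Guttmann LNP 775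
  §2.9.2 — ladder hand count `c_n((0,0),(0,1)) = 2`; `ℤ³` slabs: `μ_SAP = μ_SAW`, boundary case again;
  memoryless false; half-plane memoryless true; hex boundary true; `d ≥ 5` true; `d = 2,3,4` open):
  on `ℤ²` the polygon and walk radii COINCIDE (§22) and the crux sits exactly at the common radius;
  strip exhaustion needs an `L`-uniform bound, soft mechanisms on either side are excluded.

NEXT (targets): when j008737 reports, record the measured S2/S3 slopes here; if the lead's HANDOFF
  lists stuck stubs they become `-- Targets`; S3 (`PinchRarity (1/2)`) is the load-bearing open stub —
  any `π > 0` for LOCAL pinches would be new mathematics (RSW-free 4-arm bound for critical SAPs).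

WHY IT RESISTS (for provers): every hypothesis except `x = x_c` is idle or cosmetic, so the
content is exactly `Σ_n c_n(0,e) μ^{-n} = x_c + Σ_m (m/2) p_m μ^{-(m-1)} < ∞`, i.e. writing
`p_n = n^{-θ_n} μ^n` (Hammond's notation): `Σ_n n^{1-θ_n} < ∞`, essentially `θ_n > 2` along all
but a negligible-MASS set of `n`. In print (read this session, arXiv:1808.09032 pp. 2–3):
`θ_n ≥ 1/2 - o(1)` for `d = 2` (Madras 1995, polygon joining), and Hammond 2018, Ann. Probab.,
Thm 1.3: for every `δ > 0` the set of even `n` with `θ_n ≥ 3/2 - δ` has limiting DENSITY ONE —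
short on two counts (exponent `3/2 < 2`, and a density-zero exceptional set where only `θ_n ≥ 1/2`
is known can still carry divergent mass `Σ n^{1/2}`). Prediction: `θ_n → 5/2`. Companion results
bound the CLOSING PROBABILITY `P_n(Γ closes) = 2(n+1) p_{n+1} / c_n` (identity read in
arXiv:1808.10500 p. 3): `≤ n^{-1/4-o(1)}` for all large `n`, any `d ≥ 2`
(Duminil-Copin–Glazman–Hammond–Manolescu 2016, doi:10.1214/14-aop993) and `≤ n^{-4/7+o(1)}` on a
positive-density set of odd `n` in `d = 2` (Hammond, EJP 2019, arXiv:1808.10500 p. 2, snake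
method); multiplied by any available bound on `c_n μ^{-n}` (`≤ e^{O(√n)}`-type, Hammersley–Welsh
and its 2018 refinement doi:10.1214/19-aop1400) these are far from summability of
`c_n(0,e) μ^{-n}`; even with the conjectured `c_n ≍ n^{11/32} μ^n` they would not reach it. A DISPROOF needs
`Σ_n n^{1-θ_n} = ∞`, e.g. `θ_n ≤ 2` infinitely often with enough mass — against `θ = 5/2` and all
enumeration data (§8). No finite computation settles either direction: partial sums give only
LOWER bounds on `C` (§8), and the tail is controlled by nothing proved.

LITERATURE RE-CHECK (gen 4, 2026-08-16, later the same day): Crossref sweeps 2024–2026 ("self-avoiding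
polygon(s) … two-point function / exponent / Hammersley–Welsh"): new items Couronné 2025 (numerical upper
bound on μ(ℤ²), J. Stat. Phys.), Liu 2025 (massive two-point upper bounds, torus plateau, d > 4),
Krachun–Panagiotis 2026, Lehner–Lindorfer–Panagiotis 2025 — none bears on θ or on finiteness of
`G_{z_c}(0,e)` in d = 2; searchd / OpenAlex / arXiv / S2 were degraded (rc 75 / HTTP 429) this session.
LITERATURE RE-CHECK (gen 3, 2026-08-16; Guttmann–Jensen, J. Phys. A 55 (2022), arXiv:2207.08433
pp. 3–4 READ; OpenAlex sweeps 2019–2026 "self-avoiding polygons … upper bound / closing probability /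
Hammersley–Welsh"): the printed state of the art is exactly the list above — from ABOVE Madras 1995
(`p_n ≤ Cμⁿ/√n`), Hammond 2018 (`n^{-3/2+o(1)}`, density one), DGHM 2016 / Hammond 2019 (closing
probability `n^{-1/4}`, `n^{-1/2+ε}`, `n^{-4/7+ε}` on positive density; `n^{-2/3+ε}` conditionally on
existence of exponents; predicted `n^{-59/32}`), DGHM 2020 (`c_n ≤ μⁿ e^{C n^{1/2-ε}}` for
infinitely many `n`); from BELOW only `μ_polygon = μ` with Hammersley–Welsh-type corrections (§16).
No finiteness result for `G_{z_c}(0,e)` in `d = 2` (nor on the hexagonal lattice for the BULK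
quantity); newer planar SAW results 2023–2026 found (Krachun–Panagiotis, quantitative
sub-ballisticity on Hex, AoP 2026; Lehner–Lindorfer–Panagiotis, ballisticity on graphs with more
than one end) do not bear on `θ`. Local full-text index (searchd) was unavailable this session;
the sweep used the remote cascade only.
-/

noncomputable section

open MeasureTheory Filter Topology Set Function
open Literature.Probability.LatticeModels Literature.Probability.Percolation
open Literature.Probability.RandomPlanarGeometry Literature.Probability.RandomPlanarGeometry.SAW
open Literature.Barriers.CriticalPhenomena.SupercriticalSAW
open scoped ENNReal NNReal BigOperators

namespace Summit.CriticalPhenomena.SAWScalingLimit.Cruxes.CriticalBubbleBound.Disproof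

open Summit.CriticalPhenomena.SAWScalingLimit.Theses.SAWTotalPositivity (CriticalBubbleBound)
open Literature.Barriers.CriticalPhenomena (twoPointENN bubbleDiagram BubbleCondition
  bubbleDiagram_two_eq_top not_bubbleCondition_two)

/-! ## §0 Read-back of the crux -/

/-- READ-BACK. The crux, unfolded: one constant `C < ∞` dominating the critical two-point
partition function `Z_Ω(u,v) = Σ_{γ : u → v SAW of Ω_δ} x_c^{|γ|}` (`SAW.weight Ω δ u v univ`)
for every bounded `Ω ⊆ ℂ`, every `δ > 0` and every pair of `ℤ²`-neighbours `u ∼ v` (adjacent in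
`zdGraph 2`, NOT required to be joined in `Ω_δ`, nor to lie in `Ω_δ`: if `u ∉ Ω_δ` the weight is
`0`). No junk: `C : ℝ≥0∞` with `C ≠ ⊤`; the weight is a genuine `[0,∞]`-valued sum. [folklore] -/
theorem criticalBubbleBound_iff :
    CriticalBubbleBound ↔
      ∃ C : ℝ≥0∞, C ≠ ⊤ ∧ ∀ (Ω : Set ℂ) (δ : ℝ) (u v : Site 2), Bornology.IsBounded Ω → 0 < δ →
        (zdGraph 2).Adj u v → SAW.weight Ω δ u v univ ≤ C :=
  Iff.rfl

/-! ## §1 The lattice kernel `K_x(u,v) = Σ_{γ : u → v SAW of ℤ²} x^{|γ|}` and domain monotonicity -/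

/-- Self-avoiding walks of the full lattice `ℤ²` from `u` to `v` (paths of `zdGraph 2`). [folklore] -/
abbrev LatticeSAW (u v : Site 2) : Type := {p : (zdGraph 2).Walk u v // p.IsPath}

/-- The fugacity-`x` two-point kernel of the FULL lattice,
`K_x(u,v) = Σ_{γ : u → v SAW of ℤ²} x^{|γ|} ∈ [0, ∞]` (an `ℝ≥0∞`-valued `tsum`, no convergence
issue). At `x = x_c` and `v = u + e` this is the "critical bubble" `G_{z_c}(0,e)` of
Madras–Slade. [cite: MadrasSlade1993, §1.4 (critical two-point function)] -/
def latticeKernel (x : ℝ) (u v : Site 2) : ℝ≥0∞ :=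
  ∑' p : LatticeSAW u v, ENNReal.ofReal (x ^ p.1.length)

/-- The fugacity-`x` weight of a measurable (= any) set of domain SAWs as a `tsum` of
`x^{|γ|}` over the set. [folklore] -/
theorem weightAt_apply (x : ℝ) {Ω : Set ℂ} {δ : ℝ} {u v : Site 2} (A : Set (DomainSAW Ω δ u v)) :
    weightAt x Ω δ u v A = ∑' γ, A.indicator (fun γ => ENNReal.ofReal (x ^ γ.length)) γ := by
  rw [weightAt, Measure.sum_apply _ MeasurableSpace.measurableSet_top]
  congr 1
  funext γ
  rw [Measure.smul_apply, Measure.dirac_apply' _ MeasurableSpace.measurableSet_top, smul_eq_mul]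
  by_cases hγ : γ ∈ A
  · simp [Set.indicator_of_mem hγ]
  · simp [Set.indicator_of_notMem hγ]

/-- The total fugacity-`x` weight `Z^x_Ω(u,v) = Σ_γ x^{|γ|}`. [folklore] -/
theorem weightAt_univ (x : ℝ) (Ω : Set ℂ) (δ : ℝ) (u v : Site 2) :
    weightAt x Ω δ u v univ = ∑' γ : DomainSAW Ω δ u v, ENNReal.ofReal (x ^ γ.length) := by
  rw [weightAt_apply]; simp

/-- The critical weight `Z_Ω(u,v) = Σ_γ x_c^{|γ|}`. [folklore] -/
theorem weight_univ (Ω : Set ℂ) (δ : ℝ) (u v : Site 2) :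
    SAW.weight Ω δ u v univ = ∑' γ : DomainSAW Ω δ u v, ENNReal.ofReal (criticalFugacity ^ γ.length) := by
  rw [← weightAt_criticalFugacity, weightAt_univ]

/-- A SAW of `Ω_δ` IS a SAW of `ℤ²` (same vertex list): the forgetful map. [folklore] -/
def toLattice {Ω : Set ℂ} {δ : ℝ} {u v : Site 2} (γ : DomainSAW Ω δ u v) : LatticeSAW u v :=
  ⟨γ.walk.mapLe (discreteDomainGraph_le_zdGraph Ω δ), γ.isPath.mapLe _⟩

/-- The forgetful map keeps the length. [folklore] -/
@[simp] theorem length_toLattice {Ω : Set ℂ} {δ : ℝ} {u v : Site 2} (γ : DomainSAW Ω δ u v) :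
    (toLattice γ).1.length = γ.length :=
  SimpleGraph.Walk.length_map _ _

/-- The forgetful map keeps the support. [folklore] -/
@[simp] theorem support_toLattice {Ω : Set ℂ} {δ : ℝ} {u v : Site 2} (γ : DomainSAW Ω δ u v) :
    (toLattice γ).1.support = γ.walk.support :=
  SimpleGraph.Walk.support_mapLe_eq_support _ _

/-- The forgetful map is injective (a walk is determined by its support). [folklore] -/
theorem toLattice_injective {Ω : Set ℂ} {δ : ℝ} {u v : Site 2} :
    Injective (toLattice : DomainSAW Ω δ u v → LatticeSAW u v) := by
  rintro ⟨p, hp⟩ ⟨q, hq⟩ h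
  have h' := congrArg (fun r : LatticeSAW u v => r.1.support) h
  simp only [support_toLattice] at h'
  have := SimpleGraph.Walk.support_injective h'
  subst this
  rfl

/-- **Domain monotonicity, hypothesis-free.** For EVERY `Ω ⊆ ℂ` (bounded or not), EVERY real
`δ` (positive or not) and every fugacity `x`, the domain partition function is dominated by the
full-lattice kernel: `Z^x_Ω(u,v) ≤ K_x(u,v)`. [folklore] -/
theorem weightAt_univ_le_latticeKernel (x : ℝ) (Ω : Set ℂ) (δ : ℝ) (u v : Site 2) :
    weightAt x Ω δ u v univ ≤ latticeKernel x u v := by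
  rw [weightAt_univ, latticeKernel]
  calc ∑' γ : DomainSAW Ω δ u v, ENNReal.ofReal (x ^ γ.length)
      = ∑' γ : DomainSAW Ω δ u v, (fun p : LatticeSAW u v => ENNReal.ofReal (x ^ p.1.length)) (toLattice γ) := by
        simp
    _ ≤ ∑' p : LatticeSAW u v, ENNReal.ofReal (x ^ p.1.length) :=
        ENNReal.tsum_comp_le_tsum_of_injective toLattice_injective _

/-- The critical case: `Z_Ω(u,v) ≤ K_{x_c}(u,v)` for every `Ω, δ`. [folklore] -/
theorem weight_univ_le_latticeKernel (Ω : Set ℂ) (δ : ℝ) (u v : Site 2) :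
    SAW.weight Ω δ u v univ ≤ latticeKernel criticalFugacity u v := by
  rw [← weightAt_criticalFugacity]; exact weightAt_univ_le_latticeKernel _ Ω δ u v

/-! ### Exhaustion: every finite family of lattice SAWs lives in a discretised disk `𝔻_δ` -/

/-- Vertices of an `n`-step walk of `ℤ²` from `u` are within sup-distance `n` of `u`. [folklore] -/
theorem abs_sub_le_length {u v : Site 2} (p : (zdGraph 2).Walk u v) :
    ∀ w ∈ p.support, ∀ i, |w i - u i| ≤ p.length := by
  induction p with
  | nil =>
    intro w hw i
    rw [SimpleGraph.Walk.support_nil, List.mem_singleton] at hw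
    subst hw; simp
  | cons hadj q ih =>
    rename_i a b c
    intro w hw i
    rw [SimpleGraph.Walk.support_cons, List.mem_cons] at hw
    rw [SimpleGraph.Walk.length_cons]
    rcases hw with rfl | hw
    · simp only [sub_self, abs_zero]; positivity
    · have h1 := ih w hw i
      have h2 := Zd.abs_sub_le_one_of_adj hadj i
      calc |w i - a i| = |(w i - b i) + (b i - a i)| := by ring_nf
        _ ≤ |w i - b i| + |b i - a i| := abs_add_le _ _
        _ ≤ (q.length : ℤ) + 1 := add_le_add h1 h2
        _ = ((q.length + 1 : ℕ) : ℤ) := by push_cast; ring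

/-- The mesh `δ_N := 1/(2(N+1))`, at which every site of sup-norm `≤ N` lies in `𝔻_δ`. [folklore] -/
def meshOf (N : ℕ) : ℝ := 1 / (2 * ((N : ℝ) + 1))

/-- `δ_N > 0`. [folklore] -/
theorem meshOf_pos (N : ℕ) : 0 < meshOf N := by
  unfold meshOf; positivity

/-- Every site of sup-norm `≤ N` is a vertex of `𝔻_{δ_N}`. [folklore] -/
theorem mem_meshDomain_unitDisk_of_abs_le {N : ℕ} {w : Site 2} (hw : ∀ i, |w i| ≤ N) :
    w ∈ meshDomain unitDisk (meshOf N) := by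
  rw [meshDomain_unitDisk, mem_meshVertices_unitDisk_iff_sq]
  have hsq : ∀ i, ((w i : ℤ) : ℝ) ^ 2 ≤ (N : ℝ) ^ 2 := fun i => by
    have h1 : |((w i : ℤ) : ℝ)| ≤ (N : ℝ) := by
      rw [← Int.cast_abs]; exact_mod_cast hw i
    have h2 : (0 : ℝ) ≤ |((w i : ℤ) : ℝ)| := abs_nonneg _
    nlinarith [sq_abs ((w i : ℤ) : ℝ)]
  have hsum : ∑ j, ((w j : ℤ) : ℝ) ^ 2 ≤ 2 * (N : ℝ) ^ 2 := by
    rw [Fin.sum_univ_two]; linarith [hsq 0, hsq 1]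
  have hN : (0 : ℝ) ≤ N := Nat.cast_nonneg N
  unfold meshOf
  rw [div_pow, one_pow, mul_pow]
  have hpos : (0 : ℝ) < 2 ^ 2 * ((N : ℝ) + 1) ^ 2 := by positivity
  rw [div_mul_eq_mul_div, one_mul, div_lt_one hpos]
  nlinarith

/-- The edges of a lattice walk whose vertices lie in `𝔻_δ` are edges of the graph `𝔻_δ`
(two neighbours of the disk are always joined: the closed disk is convex). [folklore] -/
theorem edges_mem_edgeSet_unitDisk {δ : ℝ} {u v : Site 2} (p : (zdGraph 2).Walk u v)
    (h : ∀ w ∈ p.support, w ∈ meshDomain unitDisk δ) :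
    ∀ e ∈ p.edges, e ∈ (discreteDomainGraph unitDisk δ).edgeSet := by
  intro e he
  induction e using Sym2.ind with
  | h a b =>
    rw [SimpleGraph.mem_edgeSet]
    exact discreteDomainGraph_unitDisk_adj.2 ⟨p.adj_of_mem_edges he,
      h a (p.fst_mem_support_of_mem_edges he), h b (p.snd_mem_support_of_mem_edges he)⟩

/-- Transfer of a lattice SAW with vertices in `𝔻_δ` to a SAW of `𝔻_δ`. [folklore] -/
def toDisk (δ : ℝ) {u v : Site 2} (p : LatticeSAW u v)
    (h : ∀ w ∈ p.1.support, w ∈ meshDomain unitDisk δ) : DomainSAW unitDisk δ u v :=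
  ⟨p.1.transfer _ (edges_mem_edgeSet_unitDisk p.1 h), p.2.transfer _⟩

/-- The transfer keeps the length. [folklore] -/
@[simp] theorem length_toDisk (δ : ℝ) {u v : Site 2} (p : LatticeSAW u v)
    (h : ∀ w ∈ p.1.support, w ∈ meshDomain unitDisk δ) : (toDisk δ p h).length = p.1.length :=
  SimpleGraph.Walk.length_transfer _ _

/-- The transfer keeps the support, hence is injective. [folklore] -/
theorem toDisk_inj (δ : ℝ) {u v : Site 2} {p q : LatticeSAW u v}
    (hp : ∀ w ∈ p.1.support, w ∈ meshDomain unitDisk δ)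
    (hq : ∀ w ∈ q.1.support, w ∈ meshDomain unitDisk δ) (h : toDisk δ p hp = toDisk δ q hq) :
    p = q := by
  have h' := congrArg (fun γ : DomainSAW unitDisk δ u v => γ.walk.support) h
  simp only [toDisk, SimpleGraph.Walk.support_transfer] at h'
  exact Subtype.ext (SimpleGraph.Walk.support_injective h')

/-- **Exhaustion.** A bound on the fugacity-`x` partition functions of the discretised unit
disks `𝔻_δ`, `δ > 0`, between two fixed sites bounds the full-lattice kernel between them:
every finite family of lattice SAWs `u → v` lies in `𝔻_δ` for `δ` small. [folklore] -/
theorem latticeKernel_le_of_forall_unitDisk (x : ℝ) {u v : Site 2} {C : ℝ≥0∞}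
    (hC : ∀ δ : ℝ, 0 < δ → weightAt x unitDisk δ u v univ ≤ C) : latticeKernel x u v ≤ C := by
  classical
  rw [latticeKernel, ENNReal.tsum_eq_iSup_sum]
  refine iSup_le fun s => ?_
  -- a common bound on the coordinates of all vertices of all walks of `s`
  set N : ℕ := s.sup (fun p => p.1.length) + (u 0).natAbs + (u 1).natAbs with hN
  set δ : ℝ := meshOf N
  have hmem : ∀ p ∈ s, ∀ w ∈ p.1.support, w ∈ meshDomain unitDisk δ := by
    intro p hp w hw
    apply mem_meshDomain_unitDisk_of_abs_le
    intro i
    have h1 := abs_sub_le_length p.1 w hw i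
    have h2 : p.1.length ≤ s.sup (fun p => p.1.length) := Finset.le_sup (f := fun p => p.1.length) hp
    have h3 : |u i| ≤ ((u 0).natAbs : ℤ) + (u 1).natAbs := by
      fin_cases i <;> simp
    calc |w i| = |(w i - u i) + u i| := by ring_nf
      _ ≤ |w i - u i| + |u i| := abs_add_le _ _
      _ ≤ (p.1.length : ℤ) + (((u 0).natAbs : ℤ) + (u 1).natAbs) := add_le_add h1 h3
      _ ≤ (N : ℤ) := by rw [hN]; push_cast; linarith [(Nat.cast_le (α := ℤ)).2 h2]
  let T : {p // p ∈ s} → DomainSAW unitDisk δ u v := fun q => toDisk δ q.1 (hmem q.1 q.2)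
  have hT : ∀ a ∈ s.attach, ∀ b ∈ s.attach, T a = T b → a = b :=
    fun a _ b _ hab => Subtype.ext (toDisk_inj δ _ _ hab)
  calc ∑ p ∈ s, ENNReal.ofReal (x ^ p.1.length)
      = ∑ q ∈ s.attach, ENNReal.ofReal (x ^ (T q).length) := by
        rw [← Finset.sum_attach]; simp [T]
    _ = ∑ γ ∈ s.attach.image T, ENNReal.ofReal (x ^ γ.length) :=
        (Finset.sum_image (f := fun γ : DomainSAW unitDisk δ u v => ENNReal.ofReal (x ^ γ.length)) hT).symm
    _ ≤ ∑' γ : DomainSAW unitDisk δ u v, ENNReal.ofReal (x ^ γ.length) := ENNReal.sum_le_tsum _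
    _ = weightAt x unitDisk δ u v univ := (weightAt_univ x unitDisk δ u v).symm
    _ ≤ C := hC δ (meshOf_pos N)

/-- The unit disk is bounded. [folklore] -/
theorem isBounded_unitDisk : Bornology.IsBounded unitDisk := Metric.isBounded_ball

/-- **MAIN EQUIVALENCE (domains eliminated).** The crux holds iff the critical lattice kernel
between neighbours is uniformly bounded: `CriticalBubbleBound ⟺ ∃ C < ∞, ∀ u ∼ v, K_{x_c}(u,v) ≤ C`.
Neither `Ω`, nor `δ`, nor the "largest component" convention of `Ω_δ` play any role: the crux
is a statement about `ℤ²` alone (finiteness of the critical nearest-neighbour two-point function,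
Madras–Slade 1993 p. 37: open in `d = 2, 3, 4`). [cite: MadrasSlade1993, §1.4] -/
theorem criticalBubbleBound_iff_latticeKernel :
    CriticalBubbleBound ↔
      ∃ C : ℝ≥0∞, C ≠ ⊤ ∧ ∀ u v : Site 2, (zdGraph 2).Adj u v → latticeKernel criticalFugacity u v ≤ C := by
  constructor
  · rintro ⟨C, hC, h⟩
    refine ⟨C, hC, fun u v huv => latticeKernel_le_of_forall_unitDisk _ fun δ hδ => ?_⟩
    rw [weightAt_criticalFugacity]
    exact h unitDisk δ u v isBounded_unitDisk hδ huv
  · rintro ⟨C, hC, h⟩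
    exact ⟨C, hC, fun Ω δ u v _ _ huv => (weight_univ_le_latticeKernel Ω δ u v).trans (h u v huv)⟩

/-! ### Translation invariance and the one-number normal form -/

/-- Translation by `c`, an automorphism of `ℤ²`. [folklore] -/
def shiftIso (c : Site 2) : zdGraph 2 ≃g zdGraph 2 where
  toEquiv := Equiv.addRight c
  map_rel_iff' := zdGraph_adj_shift_iff c _ _

/-- The kernel does not decrease under translating both endpoints (hence is invariant). [folklore] -/
theorem latticeKernel_le_shift (x : ℝ) (u v c : Site 2) :
    latticeKernel x u v ≤ latticeKernel x (u + c) (v + c) := by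
  let F : LatticeSAW u v → LatticeSAW (u + c) (v + c) := fun p =>
    ⟨p.1.map (shiftIso c).toHom, p.2.map (shiftIso c).injective⟩
  have hF : Injective F := by
    rintro ⟨p, hp⟩ ⟨q, hq⟩ h
    have h' := congrArg Subtype.val h
    exact Subtype.ext (SimpleGraph.Walk.map_injective_of_injective (shiftIso c).injective u v h')
  have key : (fun p : LatticeSAW u v => ENNReal.ofReal (x ^ p.1.length)) =
      fun p => (fun q : LatticeSAW (u + c) (v + c) => ENNReal.ofReal (x ^ q.1.length)) (F p) := by
    funext p
    exact congrArg (fun n : ℕ => ENNReal.ofReal (x ^ n)) (SimpleGraph.Walk.length_map _ _).symm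
  calc latticeKernel x u v
      = ∑' p : LatticeSAW u v, (fun q : LatticeSAW (u + c) (v + c) => ENNReal.ofReal (x ^ q.1.length)) (F p) := by
        rw [latticeKernel, key]
    _ ≤ latticeKernel x (u + c) (v + c) := ENNReal.tsum_comp_le_tsum_of_injective hF _

/-- **Translation invariance** of the lattice kernel. [folklore] -/
theorem latticeKernel_shift (x : ℝ) (u v c : Site 2) :
    latticeKernel x (u + c) (v + c) = latticeKernel x u v := by
  refine le_antisymm ?_ (latticeKernel_le_shift x u v c)
  have h := latticeKernel_le_shift x (u + c) (v + c) (-c)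
  simpa using h

/-- The kernel depends on the displacement only: `K_x(u,v) = K_x(0, v - u)`. [folklore] -/
theorem latticeKernel_eq_zero_sub (x : ℝ) (u v : Site 2) :
    latticeKernel x u v = latticeKernel x 0 (v - u) := by
  have h := latticeKernel_shift x u v (-u)
  simp only [add_neg_cancel] at h
  rw [← h, sub_eq_add_neg]

/-- The **critical bubble at the unit vector `e`**: `G_{x_c}(0,e) = K_{x_c}(0,e) ∈ [0,∞]`. [cite: MadrasSlade1993, §1.4] -/
def bubble (e : Site 2) : ℝ≥0∞ := latticeKernel criticalFugacity 0 e

/-- **ONE-NUMBER NORMAL FORM.** The crux is equivalent to the finiteness of the (at most four)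
numbers `G_{x_c}(0,e)`, `e` a unit vector of `ℤ²`:
`CriticalBubbleBound ⟺ ∀ e ∼ 0, G_{x_c}(0,e) < ∞`. (By the dihedral symmetry of `ℤ²` the four
numbers coincide; numerically `G_{x_c}(0,e) ≈ 0.81`, see §8.) [cite: MadrasSlade1993, §1.4] -/
theorem criticalBubbleBound_iff_bubble_ne_top :
    CriticalBubbleBound ↔ ∀ e : Site 2, (zdGraph 2).Adj 0 e → bubble e ≠ ⊤ := by
  rw [criticalBubbleBound_iff_latticeKernel]
  constructor
  · rintro ⟨C, hC, h⟩ e he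
    exact ne_top_of_le_ne_top hC (h 0 e he)
  · intro h
    classical
    -- the four unit vectors
    let U : Finset (Site 2) := {Pi.single 0 1, -Pi.single 0 1, Pi.single 1 1, -Pi.single 1 1}
    have hU : ∀ e : Site 2, (zdGraph 2).Adj 0 e → e ∈ U := by
      intro e he
      obtain ⟨i, hi | hi⟩ := (zdGraph_adj_iff _ _).1 he
      · rw [zero_add] at hi; subst hi
        fin_cases i <;> simp [U]
      · have : e = -Pi.single i 1 := eq_neg_of_add_eq_zero_left hi.symm
        subst this
        fin_cases i <;> simp [U]
    refine ⟨∑ e ∈ U, (if (zdGraph 2).Adj 0 e then bubble e else 0), ?_, fun u v huv => ?_⟩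
    · rw [ENNReal.sum_ne_top]
      intro e _
      split_ifs with he
      · exact h e he
      · exact ENNReal.zero_ne_top
    · have hadj : (zdGraph 2).Adj 0 (v - u) := by
        have := (Zd.zdGraph_adj_sub_right u v u).2 huv
        rwa [sub_self] at this
      rw [latticeKernel_eq_zero_sub]
      calc latticeKernel criticalFugacity 0 (v - u) = (if (zdGraph 2).Adj 0 (v - u) then bubble (v - u) else 0) := by
            rw [if_pos hadj]; rfl
        _ ≤ ∑ e ∈ U, (if (zdGraph 2).Adj 0 e then bubble e else 0) :=
            Finset.single_le_sum (f := fun e => if (zdGraph 2).Adj 0 e then bubble e else 0)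
              (fun _ _ => zero_le) (hU _ hadj)

/-- The unit vector `e₀ = (1, 0)`. [folklore] -/
def e₀ : Site 2 := ![1, 0]

/-- `0 ∼ e₀`. [folklore] -/
theorem adj_zero_e₀ : (zdGraph 2).Adj 0 e₀ := by unfold e₀; decide

/-! ## §2 Load-bearing analysis: `IsBounded Ω` and `0 < δ` are idle -/

/-- The crux with BOTH side conditions on the domain dropped: all `Ω ⊆ ℂ`, all real `δ`. -/
def CriticalBubbleBoundWithoutBoundedPos : Prop :=
  ∃ C : ℝ≥0∞, C ≠ ⊤ ∧ ∀ (Ω : Set ℂ) (δ : ℝ) (u v : Site 2), (zdGraph 2).Adj u v →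
    SAW.weight Ω δ u v univ ≤ C

/-- **`IsBounded Ω` and `0 < δ` are NOT load-bearing**: dropping both gives an EQUIVALENT
statement (so no proof can use them in an essential way, and no disproof can exploit unbounded
domains, `δ ≤ 0`, or the junk conventions of `meshDomain` for infinite components — every
domain kernel is dominated by the lattice kernel, which the bounded disks already exhaust).
Consequently `_false_without_IsBounded` / `_false_without_pos` theorems are IMPOSSIBLE unless the
crux itself is false. [folklore] -/
theorem criticalBubbleBound_iff_withoutBoundedPos :
    CriticalBubbleBound ↔ CriticalBubbleBoundWithoutBoundedPos := by
  rw [criticalBubbleBound_iff_latticeKernel]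
  constructor
  · rintro ⟨C, hC, h⟩
    exact ⟨C, hC, fun Ω δ u v huv => (weight_univ_le_latticeKernel Ω δ u v).trans (h u v huv)⟩
  · rintro ⟨C, hC, h⟩
    refine ⟨C, hC, fun u v huv => latticeKernel_le_of_forall_unitDisk _ fun δ _ => ?_⟩
    rw [weightAt_criticalFugacity]; exact h unitDisk δ u v huv

/-! ## §3 Load-bearing analysis: dropping `u ∼ v` -/

/-- The crux with the adjacency hypothesis dropped: a uniform bound over ALL pairs of sites. -/
def CriticalBubbleBoundWithoutAdj : Prop :=
  ∃ C : ℝ≥0∞, C ≠ ⊤ ∧ ∀ (Ω : Set ℂ) (δ : ℝ) (u v : Site 2), Bornology.IsBounded Ω → 0 < δ →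
    SAW.weight Ω δ u v univ ≤ C

/-- Dropping `u ∼ v` gives `sup_x G_{x_c}(0,x) < ∞` — uniform boundedness of the whole critical
two-point function of `ℤ²`. [folklore] -/
theorem criticalBubbleBoundWithoutAdj_iff :
    CriticalBubbleBoundWithoutAdj ↔
      ∃ C : ℝ≥0∞, C ≠ ⊤ ∧ ∀ x : Site 2, latticeKernel criticalFugacity 0 x ≤ C := by
  constructor
  · rintro ⟨C, hC, h⟩
    refine ⟨C, hC, fun x => latticeKernel_le_of_forall_unitDisk _ fun δ hδ => ?_⟩
    rw [weightAt_criticalFugacity]; exact h unitDisk δ 0 x isBounded_unitDisk hδ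
  · rintro ⟨C, hC, h⟩
    refine ⟨C, hC, fun Ω δ u v _ _ => (weight_univ_le_latticeKernel Ω δ u v).trans ?_⟩
    rw [latticeKernel_eq_zero_sub]; exact h _

/-- The free strengthening implies the crux (trivially). STATUS: `CriticalBubbleBoundWithoutAdj`
is believed TRUE (the critical two-point function is expected to DECAY, `G_{x_c}(0,x) ≍
|x|^{-5/24}`, so its supremum is attained near the origin) and is open exactly like the crux; it
is NOT refutable by any finite computation, and `u ∼ v` is therefore not load-bearing either —
it only fixes WHICH finite number the constant is. The diagonal value `K_{x_c}(u,u) = 1` (only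
the trivial walk) shows the bound cannot be below `1` once `u = v` is allowed. [folklore] -/
theorem criticalBubbleBound_of_withoutAdj (h : CriticalBubbleBoundWithoutAdj) : CriticalBubbleBound := by
  obtain ⟨C, hC, h⟩ := h
  exact ⟨C, hC, fun Ω δ u v hΩ hδ _ => h Ω δ u v hΩ hδ⟩

/-! ## §4 Load-bearing analysis: the fugacity `x_c` cannot be raised — FALSE for every `x > x_c` -/

/-- The crux at a general fugacity `x` (weights `x^{|γ|}`, the barrier catalogue's `weightAt x`;
`CriticalBubbleBoundAt x_c` is the crux by `rfl`). -/
def CriticalBubbleBoundAt (x : ℝ) : Prop :=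
  ∃ C : ℝ≥0∞, C ≠ ⊤ ∧ ∀ (Ω : Set ℂ) (δ : ℝ) (u v : Site 2), Bornology.IsBounded Ω → 0 < δ →
    (zdGraph 2).Adj u v → weightAt x Ω δ u v univ ≤ C

/-- At `x = x_c` the parametrised statement is the crux. [folklore] -/
theorem criticalBubbleBoundAt_criticalFugacity :
    CriticalBubbleBoundAt criticalFugacity ↔ CriticalBubbleBound := Iff.rfl

/-- Domains eliminated at every fugacity: `CriticalBubbleBoundAt x ⟺ ∃ C < ∞, ∀ u ∼ v, K_x(u,v) ≤ C`.
[folklore] -/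
theorem criticalBubbleBoundAt_iff_latticeKernel (x : ℝ) :
    CriticalBubbleBoundAt x ↔
      ∃ C : ℝ≥0∞, C ≠ ⊤ ∧ ∀ u v : Site 2, (zdGraph 2).Adj u v → latticeKernel x u v ≤ C := by
  constructor
  · rintro ⟨C, hC, h⟩
    exact ⟨C, hC, fun u v huv => latticeKernel_le_of_forall_unitDisk _ fun δ hδ =>
      h unitDisk δ u v isBounded_unitDisk hδ huv⟩
  · rintro ⟨C, hC, h⟩
    exact ⟨C, hC, fun Ω δ u v _ _ huv => (weightAt_univ_le_latticeKernel x Ω δ u v).trans (h u v huv)⟩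

/-! ### Opening the face polygons of Duminil-Copin–Kozma–Yadin at the south cardinal edge -/

/-- Left endpoint `(m, 0)` of the south cardinal edge of `[0, 2m+1]²`. [cite: DuminilCopinKozmaYadin2014, §2 (definition of P_m)] -/
def southA (m : ℕ) : Site 2 := ![(m : ℤ), 0]

/-- Right endpoint `(m+1, 0)` of the south cardinal edge. [cite: DuminilCopinKozmaYadin2014, §2 (definition of P_m)] -/
def southB (m : ℕ) : Site 2 := ![(m : ℤ) + 1, 0]

/-- The south cardinal edge is a cardinal edge. [cite: DuminilCopinKozmaYadin2014, §2 (definition of P_m)] -/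
theorem south_mem_cardinalEdges (m : ℕ) : s(southA m, southB m) ∈ cardinalEdges m := by
  unfold cardinalEdges southA southB; exact Finset.mem_insert_self _ _

/-- Its endpoints are lattice neighbours. [folklore] -/
theorem southA_adj_southB (m : ℕ) : (zdGraph 2).Adj (southA m) (southB m) := by
  rw [zdGraph_adj_iff]
  refine ⟨0, Or.inl ?_⟩
  funext i; fin_cases i <;> simp [southA, southB]

section Opening

variable {m : ℕ} {E : Finset (Sym2 (Site 2))}

/-- The vertex list of a face polygon opened at the south cardinal edge. [cite: DuminilCopinKozmaYadin2014, §3 (proof of Proposition 7)] -/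
def openedList (m : ℕ) (E : Finset (Sym2 (Site 2))) : List (Site 2) :=
  openList (zdGraph 2) E (southA m) (southB m)

/-- Specification of the opened list of a face polygon. [cite: DuminilCopinKozmaYadin2014, §3 (proof of Proposition 7)] -/
theorem openedList_spec (hE : E ∈ facePolygons m) :
    (openedList m E).IsChain (zdGraph 2).Adj ∧ (openedList m E).Nodup ∧
      (openedList m E).head? = some (southA m) ∧ (openedList m E).getLast? = some (southB m) ∧
      (openedList m E).length = E.card := by
  obtain ⟨-, hpoly, hcard⟩ := mem_facePolygons_iff.1 hE
  have h := openList_spec hpoly (hcard (south_mem_cardinalEdges m))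
  exact ⟨h.1, h.2.1, h.2.2.1, h.2.2.2.1, h.2.2.2.2.1⟩

/-- The opened list is non-empty. [folklore] -/
theorem openedList_ne_nil (hE : E ∈ facePolygons m) : openedList m E ≠ [] := by
  intro h
  have := (openedList_spec hE).2.2.1
  rw [h] at this; simp at this

/-- Every vertex of the opened list lies in the square `[0, 2m+1]²`. [folklore] -/
theorem mem_squareBox_of_mem_openedList (hE : E ∈ facePolygons m) {w : Site 2}
    (hw : w ∈ openedList m E) : w ∈ squareBox m := by
  obtain ⟨hsub, hpoly, hcard⟩ := mem_facePolygons_iff.1 hE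
  obtain ⟨e, he, hwe⟩ := exists_mem_of_mem_openList hpoly (hcard (south_mem_cardinalEdges m)) hw
  exact (mem_edgesIn_iff.1 (hsub he)).2 w hwe

/-- The opened face polygon as a self-avoiding walk of `ℤ²` from `(m,0)` to `(m+1,0)` of length
`#E - 1`. [cite: DuminilCopinKozmaYadin2014, §3 (proof of Proposition 7)] -/
def openedSAW (hE : E ∈ facePolygons m) : LatticeSAW (southA m) (southB m) :=
  ⟨(SimpleGraph.Walk.ofSupport (openedList m E) (openedList_ne_nil hE) (openedList_spec hE).1).copy
      (by
        have h := (openedList_spec hE).2.2.1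
        rw [List.head?_eq_some_head (openedList_ne_nil hE)] at h
        exact Option.some_injective _ h)
      (by
        have h := (openedList_spec hE).2.2.2.1
        rw [List.getLast?_eq_some_getLast (openedList_ne_nil hE)] at h
        exact Option.some_injective _ h),
    by
      rw [SimpleGraph.Walk.isPath_copy, SimpleGraph.Walk.isPath_def, SimpleGraph.Walk.support_ofSupport]
      exact (openedList_spec hE).2.1⟩

/-- The support of the opened SAW is the opened list. [folklore] -/
@[simp] theorem support_openedSAW (hE : E ∈ facePolygons m) :
    (openedSAW hE).1.support = openedList m E := by
  simp [openedSAW]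

/-- The opened SAW has `#E - 1` steps. [folklore] -/
@[simp] theorem length_openedSAW (hE : E ∈ facePolygons m) :
    (openedSAW hE).1.length = E.card - 1 := by
  simp only [openedSAW, SimpleGraph.Walk.length_copy, SimpleGraph.Walk.length_ofSupport]
  rw [(openedList_spec hE).2.2.2.2]

/-- Every vertex of the opened SAW lies in the disk `𝔻_δ`, `δ = δ_{2m+1}`. [folklore] -/
theorem support_openedSAW_mem (hE : E ∈ facePolygons m) :
    ∀ w ∈ (openedSAW hE).1.support, w ∈ meshDomain unitDisk (meshOf (2 * m + 1)) := by
  intro w hw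
  rw [support_openedSAW] at hw
  have hbox := mem_squareBox_iff.1 (mem_squareBox_of_mem_openedList hE hw)
  apply mem_meshDomain_unitDisk_of_abs_le
  intro i
  obtain ⟨h0, h1⟩ := hbox i
  rw [abs_of_nonneg h0]; push_cast; exact h1

/-- The opened face polygon as a SAW of the discretised disk `𝔻_δ`, `δ = δ_{2m+1}`, from `(m,0)`
to `(m+1,0)`. [cite: DuminilCopinKozmaYadin2014, §3 (proof of Proposition 7)] -/
def openedDomainSAW (hE : E ∈ facePolygons m) :
    DomainSAW unitDisk (meshOf (2 * m + 1)) (southA m) (southB m) :=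
  toDisk _ (openedSAW hE) (support_openedSAW_mem hE)

/-- Length bookkeeping: `|γ_E| = #E - 1`. [folklore] -/
@[simp] theorem length_openedDomainSAW (hE : E ∈ facePolygons m) :
    (openedDomainSAW hE).length = E.card - 1 := by
  simp [openedDomainSAW]

/-- Opening is injective on face polygons (the polygon is its opening plus the south edge). [folklore] -/
theorem openedDomainSAW_inj {E E' : Finset (Sym2 (Site 2))} (hE : E ∈ facePolygons m)
    (hE' : E' ∈ facePolygons m) (h : openedDomainSAW hE = openedDomainSAW hE') : E = E' := by
  have h1 : openedSAW hE = openedSAW hE' := toDisk_inj _ _ _ h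
  have h2 := congrArg (fun p : LatticeSAW (southA m) (southB m) => p.1.support) h1
  simp only [support_openedSAW, openedList] at h2
  obtain ⟨-, hpoly, hcard⟩ := mem_facePolygons_iff.1 hE
  obtain ⟨-, hpoly', hcard'⟩ := mem_facePolygons_iff.1 hE'
  exact eq_of_openList_eq hpoly hpoly' (hcard (south_mem_cardinalEdges m))
    (hcard' (south_mem_cardinalEdges m)) h2

end Opening

/-- **Polygon lower bound.** The DKY box partition function is dominated by the disk partition
function between the endpoints of the south cardinal edge: `Z_m(x) ≤ x · Z^x_{𝔻_δ}((m,0),(m+1,0))`,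
`δ = δ_{2m+1}` (open each polygon at the south edge). [cite: DuminilCopinKozmaYadin2014, Proposition 3] -/
theorem Zbox_le_mul_weightAt (m : ℕ) {x : ℝ} (hx : 0 < x)
    (hfin : weightAt x unitDisk (meshOf (2 * m + 1)) (southA m) (southB m) univ ≠ ⊤) :
    Zbox m x ≤ x * (weightAt x unitDisk (meshOf (2 * m + 1)) (southA m) (southB m) univ).toReal := by
  classical
  set δ := meshOf (2 * m + 1)
  -- the opened polygons inject into the SAWs of the disk
  let T : {E // E ∈ facePolygons m} → DomainSAW unitDisk δ (southA m) (southB m) :=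
    fun q => openedDomainSAW q.2
  have hT : ∀ a ∈ (facePolygons m).attach, ∀ b ∈ (facePolygons m).attach, T a = T b → a = b :=
    fun a _ b _ hab => Subtype.ext (openedDomainSAW_inj a.2 b.2 hab)
  have hsum : ∑ E ∈ facePolygons m, ENNReal.ofReal (x ^ (E.card - 1)) ≤
      weightAt x unitDisk δ (southA m) (southB m) univ := by
    calc ∑ E ∈ facePolygons m, ENNReal.ofReal (x ^ (E.card - 1))
        = ∑ q ∈ (facePolygons m).attach, ENNReal.ofReal (x ^ (T q).length) := by
          rw [← Finset.sum_attach]; simp [T]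
      _ = ∑ γ ∈ (facePolygons m).attach.image T, ENNReal.ofReal (x ^ γ.length) :=
          (Finset.sum_image (f := fun γ : DomainSAW unitDisk δ (southA m) (southB m) =>
            ENNReal.ofReal (x ^ γ.length)) hT).symm
      _ ≤ ∑' γ : DomainSAW unitDisk δ (southA m) (southB m), ENNReal.ofReal (x ^ γ.length) :=
          ENNReal.sum_le_tsum _
      _ = weightAt x unitDisk δ (southA m) (southB m) univ := (weightAt_univ x unitDisk δ _ _).symm
  have hreal : ∑ E ∈ facePolygons m, x ^ (E.card - 1) ≤
      (weightAt x unitDisk δ (southA m) (southB m) univ).toReal := by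
    rw [← ENNReal.ofReal_le_iff_le_toReal hfin, ENNReal.ofReal_sum_of_nonneg (fun _ _ => pow_nonneg hx.le _)]
    exact hsum
  have hZ : Zbox m x = x * ∑ E ∈ facePolygons m, x ^ (E.card - 1) := by
    rw [Zbox, Finset.mul_sum]
    refine Finset.sum_congr rfl fun E hE => ?_
    obtain ⟨-, hpoly, hcard⟩ := mem_facePolygons_iff.1 hE
    have h3 := (openList_spec hpoly (hcard (south_mem_cardinalEdges m))).2.2.2.2.2.1
    obtain ⟨k, hk⟩ : ∃ k, E.card = k + 1 := ⟨E.card - 1, by omega⟩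
    rw [hk, pow_succ, Nat.add_sub_cancel]; ring
  rw [hZ]
  exact mul_le_mul_of_nonneg_left hreal hx.le

/-- **THE FUGACITY IS LOAD-BEARING (supercritical side).** For every `x > x_c` the statement
`CriticalBubbleBoundAt x` is FALSE: the disk partition functions between two neighbours are
unbounded (`limsup_m Z_m(x) = ∞`, Duminil-Copin–Kozma–Yadin 2014, Proposition 3, PROVED in the
tree as `DKY2014_prop3_holds`, transported by polygon opening). So any proof of the crux must use
`x = x_c` sharply from above: no argument that is an open condition in the fugacity can work, and
the constant `C(x)` of the subcritical statement (§5) blows up as `x ↑ x_c` is NOT excluded by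
this theorem — the crux asserts exactly that it does not. [cite: DuminilCopinKozmaYadin2014, Proposition 3] -/
theorem not_criticalBubbleBoundAt_of_criticalFugacity_lt {x : ℝ} (hx : criticalFugacity < x) :
    ¬ CriticalBubbleBoundAt x := by
  rintro ⟨C, hC, h⟩
  have hx0 : 0 < x := criticalFugacity_pos_lt_one'.1.trans hx
  obtain ⟨m, hm⟩ := (DKY2014_prop3_holds x hx (x * (C.toReal + 1))).exists
  have hw := h unitDisk (meshOf (2 * m + 1)) (southA m) (southB m) isBounded_unitDisk (meshOf_pos _)
    (southA_adj_southB m)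
  have key := Zbox_le_mul_weightAt m hx0 (ne_top_of_le_ne_top hC hw)
  have hle : (weightAt x unitDisk (meshOf (2 * m + 1)) (southA m) (southB m) univ).toReal ≤ C.toReal :=
    ENNReal.toReal_mono hC hw
  nlinarith

/-- The same in lattice-kernel form: for `x > x_c` the fugacity-`x` nearest-neighbour two-point
function of `ℤ²` is infinite in some direction (`G_x(0,e) = ∞`). [cite: DuminilCopinKozmaYadin2014, Proposition 3] -/
theorem exists_latticeKernel_eq_top_of_criticalFugacity_lt {x : ℝ} (hx : criticalFugacity < x) :
    ∃ e : Site 2, (zdGraph 2).Adj 0 e ∧ latticeKernel x 0 e = ⊤ := by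
  by_contra hcon
  push Not at hcon
  apply not_criticalBubbleBoundAt_of_criticalFugacity_lt hx
  rw [criticalBubbleBoundAt_iff_latticeKernel]
  classical
  let U : Finset (Site 2) := {Pi.single 0 1, -Pi.single 0 1, Pi.single 1 1, -Pi.single 1 1}
  have hU : ∀ e : Site 2, (zdGraph 2).Adj 0 e → e ∈ U := by
    intro e he
    obtain ⟨i, hi | hi⟩ := (zdGraph_adj_iff _ _).1 he
    · rw [zero_add] at hi; subst hi
      fin_cases i <;> simp [U]
    · have : e = -Pi.single i 1 := eq_neg_of_add_eq_zero_left hi.symm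
      subst this
      fin_cases i <;> simp [U]
  refine ⟨∑ e ∈ U, (if (zdGraph 2).Adj 0 e then latticeKernel x 0 e else 0), ?_, fun u v huv => ?_⟩
  · rw [ENNReal.sum_ne_top]
    intro e _
    split_ifs with he
    · exact hcon e he
    · exact ENNReal.zero_ne_top
  · have hadj : (zdGraph 2).Adj 0 (v - u) := by
      have := (Zd.zdGraph_adj_sub_right u v u).2 huv
      rwa [sub_self] at this
    rw [latticeKernel_eq_zero_sub]
    calc latticeKernel x 0 (v - u) = (if (zdGraph 2).Adj 0 (v - u) then latticeKernel x 0 (v - u) else 0) := by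
          rw [if_pos hadj]
      _ ≤ ∑ e ∈ U, (if (zdGraph 2).Adj 0 e then latticeKernel x 0 e else 0) :=
          Finset.single_le_sum (f := fun e => if (zdGraph 2).Adj 0 e then latticeKernel x 0 e else 0)
            (fun _ _ => zero_le) (hU _ hadj)

/-! ## §5 The length decomposition `K_x(0,w) = Σ_n c_n(w) x^n`; the subcritical side is TRUE -/

/-- The `n`-step SAWs `0 → w`, as a subtype of `LatticeSAW 0 w`, are the tree's finite set
`Zd.sawWalksAt 2 n w` (whose cardinality is `c_n(w) = Zd.countAt 2 n w`). [folklore] -/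
def fiberEquiv (n : ℕ) (w : Site 2) :
    {p : LatticeSAW 0 w // p.1.length = n} ≃ ↥(Zd.sawWalksAt 2 n w) where
  toFun p := ⟨p.1.1, Zd.mem_sawWalksAt.2 ⟨p.1.2, p.2⟩⟩
  invFun q := ⟨⟨q.1, (Zd.mem_sawWalksAt.1 q.2).1⟩, (Zd.mem_sawWalksAt.1 q.2).2⟩
  left_inv _ := rfl
  right_inv _ := rfl

/-- **Length decomposition of the lattice kernel**: `K_x(0,w) = Σ_n c_n(w) · x^n` in `[0, ∞]`
(any real `x`; `c_n(w)` = number of `n`-step SAWs of `ℤ²` from `0` to `w`). With §1 this makes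
the crux LITERALLY `Σ_n c_n(0,e) x_c^n < ∞` for the unit vectors `e`. [cite: MadrasSlade1993, §1.4] -/
theorem latticeKernel_zero_eq_tsum_countAt (x : ℝ) (w : Site 2) :
    latticeKernel x 0 w = ∑' n : ℕ, (Zd.countAt 2 n w : ℝ≥0∞) * ENNReal.ofReal (x ^ n) := by
  rw [latticeKernel, ← (Equiv.sigmaFiberEquiv fun p : LatticeSAW 0 w => p.1.length).tsum_eq,
    ENNReal.tsum_sigma']
  refine tsum_congr fun n => ?_
  calc ∑' p : {p : LatticeSAW 0 w // p.1.length = n},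
        ENNReal.ofReal (x ^ ((Equiv.sigmaFiberEquiv fun p : LatticeSAW 0 w => p.1.length) ⟨n, p⟩).1.length)
      = ∑' p : {p : LatticeSAW 0 w // p.1.length = n}, ENNReal.ofReal (x ^ n) := by
        refine tsum_congr fun p => ?_
        simp only [Equiv.sigmaFiberEquiv_apply]
        rw [p.2]
    _ = ∑' q : ↥(Zd.sawWalksAt 2 n w), ENNReal.ofReal (x ^ n) :=
        ((fiberEquiv n w).symm.tsum_eq (fun _ => ENNReal.ofReal (x ^ n)))
          |>.symm
    _ = (Zd.countAt 2 n w : ℝ≥0∞) * ENNReal.ofReal (x ^ n) := by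
        rw [tsum_fintype, Finset.sum_const, Finset.card_univ, Fintype.card_coe, Zd.card_sawWalksAt,
          nsmul_eq_mul]

/-- Below `x_c` the susceptibility series is finite in `[0,∞]`: `Σ_n c_n x^n < ∞` for
`0 < x < x_c` (geometric domination, from the tree's `Zd.exists_bound_count_mul_pow` at the
midpoint `(x + x_c)/2`). [cite: BDGS2012, §1.5.3] -/
theorem tsum_count_mul_pow_ne_top {x : ℝ} (hx0 : 0 < x) (hx : x < criticalFugacity) :
    ∑' n : ℕ, (Zd.count 2 n : ℝ≥0∞) * ENNReal.ofReal (x ^ n) ≠ ⊤ := by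
  set z : ℝ := (x + criticalFugacity) / 2 with hz
  have hz0 : 0 < z := by rw [hz]; linarith
  have hxz : x < z := by rw [hz]; linarith
  have hzc : z < Zd.criticalPoint 2 := by rw [Zd.criticalPoint_two, hz]; linarith
  obtain ⟨K, hK⟩ := Zd.exists_bound_count_mul_pow hz0 hzc
  have hK0 : 0 ≤ K := le_trans (by positivity) (hK 0)
  set r : ℝ := x / z with hr
  have hr0 : 0 ≤ r := div_nonneg hx0.le hz0.le
  have hr1 : r < 1 := (div_lt_one hz0).2 hxz
  have hterm : ∀ n, (Zd.count 2 n : ℝ≥0∞) * ENNReal.ofReal (x ^ n) ≤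
      ENNReal.ofReal K * ENNReal.ofReal r ^ n := by
    intro n
    have h1 : (Zd.count 2 n : ℝ) * x ^ n ≤ K * r ^ n := by
      have hxn : x ^ n = z ^ n * r ^ n := by
        rw [← mul_pow]; congr 1; rw [hr]; field_simp
      rw [hxn, ← mul_assoc]
      exact mul_le_mul_of_nonneg_right (hK n) (pow_nonneg hr0 n)
    calc (Zd.count 2 n : ℝ≥0∞) * ENNReal.ofReal (x ^ n)
        = ENNReal.ofReal ((Zd.count 2 n : ℝ) * x ^ n) := by
          rw [ENNReal.ofReal_mul (Nat.cast_nonneg _), ENNReal.ofReal_natCast]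
      _ ≤ ENNReal.ofReal (K * r ^ n) := ENNReal.ofReal_le_ofReal h1
      _ = ENNReal.ofReal K * ENNReal.ofReal r ^ n := by
          rw [ENNReal.ofReal_mul hK0, ENNReal.ofReal_pow hr0]
  refine ne_top_of_le_ne_top ?_ (ENNReal.tsum_le_tsum hterm)
  rw [ENNReal.tsum_mul_left, ENNReal.tsum_geometric]
  refine ENNReal.mul_ne_top ENNReal.ofReal_ne_top (ENNReal.inv_ne_top.2 ?_)
  exact (tsub_pos_iff_lt.2 ((ENNReal.ofReal_lt_one).2 hr1)).ne'

/-- Uniform subcritical bound on the WHOLE lattice two-point function: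
`K_x(u,v) ≤ Σ_n c_n x^n < ∞` for `0 < x < x_c`, all `u, v`. [cite: BDGS2012, §1.5.3] -/
theorem latticeKernel_le_tsum_count (x : ℝ) (u v : Site 2) :
    latticeKernel x u v ≤ ∑' n : ℕ, (Zd.count 2 n : ℝ≥0∞) * ENNReal.ofReal (x ^ n) := by
  rw [latticeKernel_eq_zero_sub, latticeKernel_zero_eq_tsum_countAt]
  refine ENNReal.tsum_le_tsum fun n => mul_le_mul_of_nonneg_right ?_ zero_le
  exact_mod_cast Zd.countAt_le_count n (v - u)

/-- **THE SUBCRITICAL SIDE IS TRUE, even without `u ∼ v`**: for `0 < x < x_c` the fugacity-`x`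
two-point partition functions of all domains between ALL pairs of sites are bounded by the
finite susceptibility `χ(x) = Σ_n c_n x^n`. Hence the crux sits exactly at the edge: TRUE in
the strongest form for `x < x_c` (this theorem), FALSE for `x > x_c` (§4); at `x = x_c` the
susceptibility bound is useless (`χ(x_c) = ∞`, §6) and only the ADJACENCY of `u, v` (closing
into polygons, an extra factor `n^{-(α_sing - ...)}`) can save finiteness. [cite: BDGS2012, §1.5.3] -/
theorem criticalBubbleBoundAt_of_lt_criticalFugacity {x : ℝ} (hx0 : 0 < x) (hx : x < criticalFugacity) :
    ∃ C : ℝ≥0∞, C ≠ ⊤ ∧ ∀ (Ω : Set ℂ) (δ : ℝ) (u v : Site 2), weightAt x Ω δ u v univ ≤ C :=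
  ⟨_, tsum_count_mul_pow_ne_top hx0 hx, fun Ω δ u v =>
    (weightAt_univ_le_latticeKernel x Ω δ u v).trans (latticeKernel_le_tsum_count x u v)⟩

/-- In particular `CriticalBubbleBoundAt x` holds for `0 < x < x_c`. [cite: BDGS2012, §1.5.3] -/
theorem criticalBubbleBoundAt_of_lt {x : ℝ} (hx0 : 0 < x) (hx : x < criticalFugacity) :
    CriticalBubbleBoundAt x := by
  obtain ⟨C, hC, h⟩ := criticalBubbleBoundAt_of_lt_criticalFugacity hx0 hx
  exact ⟨C, hC, fun Ω δ u v _ _ _ => h Ω δ u v⟩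

/-! ## §6 Natural strengthening FALSE at `x_c`: free endpoint / susceptibility bound -/

/-- The FREE-ENDPOINT strengthening of the crux: a uniform bound on the critical partition
function of SAWs from `u` to ANYWHERE, `Σ_v Z_Ω(u,v)`. -/
def FreeEndpointBound : Prop :=
  ∃ C : ℝ≥0∞, C ≠ ⊤ ∧ ∀ (Ω : Set ℂ) (δ : ℝ) (u : Site 2), Bornology.IsBounded Ω → 0 < δ →
    ∑' v : Site 2, SAW.weight Ω δ u v univ ≤ C

/-- `c_n x_c^n ≥ 1` for every `n` (`μ^n ≤ c_n`, definition of `μ` as an infimum). [cite: BDGS2012, §1.3, eq. (1.12)] -/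
theorem one_le_count_mul_criticalFugacity_pow (n : ℕ) :
    (1 : ℝ) ≤ (Zd.count 2 n : ℝ) * criticalFugacity ^ n := by
  have hμ : 0 < connectiveConstant := by linarith [two_le_connectiveConstant]
  have h := Zd.pow_connectiveConstant_le_count 2 n
  rw [Zd.connectiveConstant_two] at h
  calc (1 : ℝ) = connectiveConstant ^ n * criticalFugacity ^ n := by
        rw [← mul_pow, criticalFugacity, mul_inv_cancel₀ hμ.ne', one_pow]
    _ ≤ (Zd.count 2 n : ℝ) * criticalFugacity ^ n :=
        mul_le_mul_of_nonneg_right h (pow_nonneg criticalFugacity_pos_lt_one'.1.le n)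

/-- The disk `𝔻_{δ_N}` carries all SAWs from `0` of length `≤ N`: their total critical weight,
summed over the free endpoint, is at least `Σ_{n ≤ N} c_n x_c^n ≥ N + 1`. [folklore] -/
theorem succ_le_tsum_weight_unitDisk (N : ℕ) :
    ((N : ℝ≥0∞) + 1) ≤ ∑' v : Site 2, SAW.weight unitDisk (meshOf N) 0 v univ := by
  classical
  set δ := meshOf N
  -- all SAWs from `0` of length `≤ N`, as triples `⟨n, v, p⟩`
  let A : Finset (Σ n : ℕ, Σ v : Site 2, (zdGraph 2).Walk (0 : Site 2) v) :=
    (Finset.range (N + 1)).sigma fun n => Zd.sawWalks 2 n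
  have hA : ∀ a ∈ A, a.2.2.IsPath ∧ a.2.2.length = a.1 ∧ a.1 ≤ N := by
    rintro ⟨n, v, p⟩ ha
    rw [Finset.mem_sigma, Finset.mem_range, Zd.mem_sawWalks] at ha
    exact ⟨ha.2.1, ha.2.2, Nat.lt_succ_iff.1 ha.1⟩
  have hsupp : ∀ a ∈ A, ∀ w ∈ a.2.2.support, w ∈ meshDomain unitDisk δ := by
    intro a ha w hw
    apply mem_meshDomain_unitDisk_of_abs_le
    intro i
    have h1 := abs_sub_le_length a.2.2 w hw i
    simp only [Pi.zero_apply, sub_zero] at h1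
    have h2 := (hA a ha).2
    calc |w i| ≤ (a.2.2.length : ℤ) := h1
      _ ≤ N := by rw [h2.1]; exact_mod_cast h2.2
  let T : {a // a ∈ A} → Σ v : Site 2, DomainSAW unitDisk δ 0 v := fun a =>
    ⟨a.1.2.1, toDisk δ ⟨a.1.2.2, (hA a.1 a.2).1⟩ (hsupp a.1 a.2)⟩
  have hT : ∀ a ∈ A.attach, ∀ b ∈ A.attach, T a = T b → a = b := by
    rintro ⟨⟨n, v, p⟩, ha⟩ _ ⟨⟨n', v', p'⟩, hb⟩ _ h
    simp only [T] at h
    obtain ⟨rfl, h2⟩ := Sigma.mk.inj_iff.1 h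
    have h3 := toDisk_inj δ _ _ (eq_of_heq h2)
    have h4 : p = p' := congrArg Subtype.val h3
    subst h4
    have e1 : p.length = n := (hA _ ha).2.1
    have e2 : p.length = n' := (hA _ hb).2.1
    have h5 : n = n' := e1.symm.trans e2
    subst h5
    rfl
  let f : (Σ v : Site 2, DomainSAW unitDisk δ 0 v) → ℝ≥0∞ := fun s =>
    ENNReal.ofReal (criticalFugacity ^ s.2.length)
  calc ((N : ℝ≥0∞) + 1) = ∑ n ∈ Finset.range (N + 1), (1 : ℝ≥0∞) := by simp
    _ ≤ ∑ n ∈ Finset.range (N + 1), (Zd.count 2 n : ℝ≥0∞) * ENNReal.ofReal (criticalFugacity ^ n) := by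
        refine Finset.sum_le_sum fun n _ => ?_
        have h := one_le_count_mul_criticalFugacity_pow n
        calc (1 : ℝ≥0∞) = ENNReal.ofReal 1 := ENNReal.ofReal_one.symm
          _ ≤ ENNReal.ofReal ((Zd.count 2 n : ℝ) * criticalFugacity ^ n) := ENNReal.ofReal_le_ofReal h
          _ = (Zd.count 2 n : ℝ≥0∞) * ENNReal.ofReal (criticalFugacity ^ n) := by
              rw [ENNReal.ofReal_mul (Nat.cast_nonneg _), ENNReal.ofReal_natCast]
    _ = ∑ a ∈ A, ENNReal.ofReal (criticalFugacity ^ a.1) := by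
        rw [Finset.sum_sigma]
        refine Finset.sum_congr rfl fun n _ => ?_
        dsimp only
        rw [Finset.sum_const, Zd.card_sawWalks, nsmul_eq_mul]
    _ = ∑ a ∈ A.attach, f (T a) := by
        rw [← Finset.sum_attach]
        refine Finset.sum_congr rfl fun a _ => ?_
        simp only [f, T, length_toDisk]
        rw [(hA a.1 a.2).2.1]
    _ = ∑ s ∈ A.attach.image T, f s := (Finset.sum_image hT).symm
    _ ≤ ∑' s : (Σ v : Site 2, DomainSAW unitDisk δ 0 v), f s := ENNReal.sum_le_tsum _
    _ = ∑' v : Site 2, ∑' γ : DomainSAW unitDisk δ 0 v, ENNReal.ofReal (criticalFugacity ^ γ.length) :=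
        ENNReal.tsum_sigma' _
    _ = ∑' v : Site 2, SAW.weight unitDisk δ 0 v univ := by
        refine tsum_congr fun v => ?_; rw [weight_univ]

/-- **THE FREE-ENDPOINT STRENGTHENING IS FALSE**: `Σ_v Z_Ω(u,v)` is NOT uniformly bounded at
`x_c` (it exceeds `N + 1` in the disk `𝔻_{δ_N}`: `χ(x_c) = Σ_n c_n x_c^n ≥ Σ_n 1 = ∞`). So any
proof of the crux must use that the SAW RETURNS next to its starting point (the polygon
structure `c_{m-1}(0,e) = (m/2) p_m`); no bound via the susceptibility / no `ℓ¹` bound on the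
critical two-point function can work, and the "bubble diagram" `B(x_c) = Σ_x G_{x_c}(0,x)²` of
Madras–Slade (expected infinite in `d = 2`) is NOT what the crux asserts. [cite: MadrasSlade1993, §1.4–§1.5] -/
theorem not_freeEndpointBound : ¬ FreeEndpointBound := by
  rintro ⟨C, hC, h⟩
  have key : ∀ N : ℕ, ((N : ℝ≥0∞) + 1) ≤ C := fun N =>
    (succ_le_tsum_weight_unitDisk N).trans (h unitDisk (meshOf N) 0 isBounded_unitDisk (meshOf_pos N))
  apply hC
  refine ENNReal.eq_top_of_forall_nnreal_le fun r => ?_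
  obtain ⟨N, hN⟩ := exists_nat_gt r
  calc (r : ℝ≥0∞) ≤ (N : ℝ≥0∞) := by exact_mod_cast hN.le
    _ ≤ (N : ℝ≥0∞) + 1 := le_self_add
    _ ≤ C := key N

/-! ## §7 Prover-facing SUFFICIENT conditions (what a proof has to deliver) -/

/-- Reduction to counting: the crux follows from the finiteness of the four series
`Σ_n c_n(e) x_c^n`, `e` a unit vector. (Also necessary, by §1 + §5.) [cite: MadrasSlade1993, §1.4] -/
theorem criticalBubbleBound_of_tsum_countAt_ne_top
    (h : ∀ e : Site 2, (zdGraph 2).Adj 0 e →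
      ∑' n : ℕ, (Zd.countAt 2 n e : ℝ≥0∞) * ENNReal.ofReal (criticalFugacity ^ n) ≠ ⊤) :
    CriticalBubbleBound := by
  rw [criticalBubbleBound_iff_bubble_ne_top]
  intro e he
  rw [bubble, latticeKernel_zero_eq_tsum_countAt]
  exact h e he

/-- The crux IS the finiteness of the four counting series (necessary and sufficient). [cite: MadrasSlade1993, §1.4] -/
theorem criticalBubbleBound_iff_tsum_countAt_ne_top :
    CriticalBubbleBound ↔ ∀ e : Site 2, (zdGraph 2).Adj 0 e →
      ∑' n : ℕ, (Zd.countAt 2 n e : ℝ≥0∞) * ENNReal.ofReal (criticalFugacity ^ n) ≠ ⊤ := by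
  refine ⟨fun h e he => ?_, criticalBubbleBound_of_tsum_countAt_ne_top⟩
  rw [← latticeKernel_zero_eq_tsum_countAt]
  exact (criticalBubbleBound_iff_bubble_ne_top.1 h) e he

/-- **Closing-probability form** (the realistic target): a polynomial gain `c_n(e) x_c^n ≤
K (n+1)^{-(1+ε)}` for the unit vectors `e` — i.e. `c_n(0,e) ≤ K n^{-1-ε} μ^n`, equivalently a
polygon bound `p_m ≤ K' m^{-2-ε} μ^m` — implies the crux (`p`-series). The conjectured truth is
`ε = 1/2` (`p_m ~ B μ^m m^{-5/2}`); in print: Madras 1995 gives only `m^{-1/2}`, Hammond 2018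
`m^{-3/2+o(1)}` on a density-one set — both insufficient. [cite: MadrasSlade1993, §1.4] -/
theorem criticalBubbleBound_of_closing_bound {K ε : ℝ} (hε : 0 < ε)
    (h : ∀ e : Site 2, (zdGraph 2).Adj 0 e → ∀ n : ℕ,
      (Zd.countAt 2 n e : ℝ) * criticalFugacity ^ n ≤ K * ((n : ℝ) + 1) ^ (-(1 + ε))) :
    CriticalBubbleBound := by
  apply criticalBubbleBound_of_tsum_countAt_ne_top
  intro e he
  have hK : ∀ n : ℕ, (Zd.countAt 2 n e : ℝ≥0∞) * ENNReal.ofReal (criticalFugacity ^ n) ≤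
      ENNReal.ofReal (K * ((n : ℝ) + 1) ^ (-(1 + ε))) := fun n => by
    rw [← ENNReal.ofReal_natCast, ← ENNReal.ofReal_mul (Nat.cast_nonneg _)]
    exact ENNReal.ofReal_le_ofReal (h e he n)
  refine ne_top_of_le_ne_top ?_ (ENNReal.tsum_le_tsum hK)
  have hs : Summable fun n : ℕ => K * ((n : ℝ) + 1) ^ (-(1 + ε)) := by
    refine Summable.mul_left K ?_
    have h1 : Summable fun n : ℕ => ((n : ℝ)) ^ (-(1 + ε)) :=
      Real.summable_nat_rpow.2 (by linarith)
    simpa using (summable_nat_add_iff 1).2 h1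
  rw [← ENNReal.ofReal_tsum_of_nonneg (fun n => ?_) hs]
  · exact ENNReal.ofReal_ne_top
  · exact le_trans (mul_nonneg (Nat.cast_nonneg _) (pow_nonneg criticalFugacity_pos_lt_one'.1.le n))
      (h e he n)

/-! ## §8 Tightness from below: a certified lower bound on ANY admissible constant; numerics -/

/- BODY MOVED OUT OF THE WORK FILE (gen 5: `crux write` caps the file at 200 kB). Landed verbatim as
   `Theorems/CriticalBubbleBound/Negative/CriticalBubbleBoundConstantBound.lean` (gen 2);
   declarations (same names, namespace `Summit.CriticalPhenomena.SAWScalingLimit.Theorems.CriticalBubbleBound.Negative`,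
   module imported above): `lists1`, `lists3`, `lists5`, `lists7`, `IsShortCert`, `mem_pathsAt_of_isShortCert`, `lists_cert`, `lists_nodup`, `le_countAt_of_lists`, `countAt_lower_bounds`, `poly_le_bubble`, `const_ge_of_criticalBubbleBound`, `const_ge_of_criticalBubbleBound'`. -/

/-! ## §9 Notes for planners and provers (typed where cheap)

### 9a. The foreseen split `CriticalBubbleBound ⇐ HalfPlaneBubble → BulkFromBoundary`

The route text foresees `HalfPlaneBubble` (arch generating function between adjacent boundary
points of a half-plane finite) `→ BulkFromBoundary → CriticalBubbleBound`. Two warnings.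

(1) `BulkFromBoundary` is NOT glue. With `q_m := c_{m-1}(0,e)` = number of `m`-gons (edge sets)
through a fixed edge, `q_m = (m/2) p_m` (each of the `p_m` polygon classes has `m` edges, half of
them parallel to `e` on average by the quarter-turn symmetry of the COUNT), so
`G_{x_c}(0,e) = x_c + Σ_{m ≥ 4} (m/2) p_m x_c^{m-1}`, whereas the half-plane arch function between
the two adjacent boundary sites only sees the polygons rooted at an edge of their LOWEST row:
`A(x_c) = Σ_m r_m x_c^{m-1}` with `p_m ≤ r_m ≤ (m/2) p_m` (`r_m` = Σ over classes of the number of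
bottom-row edges). Finiteness of `A` gives `Σ p_m x_c^m < ∞` at best, which does NOT give
`Σ m p_m x_c^m < ∞`: the multiplicity factor `m` (where along the polygon the root edge sits) is
exactly the difference between boundary and bulk rooting. Any `BulkFromBoundary` needs an extra
mechanism controlling the height of the root edge above the lowest row (a renewal / "unfolding
with polynomial loss" statement), i.e. it is a crux of the same depth as the bubble itself.

(2) What the route CONSUMES is not the half-plane quantity anyway. `TPToHarnack`/`BoundaryHarnack`
need `Z_Ω(b,c) ≤ C` for DOMAIN-adjacent consecutive boundary sites over ALL bounded simply
connected `Ω` — including the two sides `b, c` of the tip of a deep thin cut, whose SAWs `b → c`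
exhaust, as the domain grows, all SAWs of `ℤ²` from `b` to `c` avoiding a half-line issuing from
the edge `bc`: the SLIT-PLANE bubble `S`, with `A ≤ S ≤ G`. So even a proof of `HalfPlaneBubble`
plus TP₂ leaves the route's Harnack constant uncontrolled at slit tips; the honest intermediate
target is `S < ∞` (or the full `G < ∞`, the crux), not `A < ∞`.

(3) Lattice remark: on the HEXAGONAL lattice the half-plane arch function IS bounded at `x_c`
(Duminil-Copin–Smirnov 2012, strip identity `1 = c_α A_T + B_T + c_ε E_T`, so `A_T ≤ 1/cos(3π/8)`
uniformly in the strip width) — the parafermionic observable delivers exactly the boundary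
quantity `A`, and still not the bulk/slit quantities `G`, `S`. On `ℤ²` even `A < ∞` is open.

### 9b. Why TP₂ cannot supply the constant
`BoundaryTP2` is homogeneous of degree zero under rescaling all partition functions: every
instance `Z(p₁,p₃)Z(p₂,p₄) ≤ Z(p₁,p₂)Z(p₃,p₄)` bounds a product by a product. An ADJACENT pair
`u ∼ v` can sit on the small side only as `(p₁,p₃) = (u,v)` with a boundary point `p₂` between
them in the cyclic order, i.e. only across the mouth of a cut separating `u` from `v` along the
boundary; the resulting bound `Z(u,v) ≤ Z(u,p₂)Z(v,p₄)/Z(p₂,p₄)` has another adjacent-type or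
long-range factor on the right and a long-range factor in the denominator — no absolute constant
ever appears. Consistent with the planner's "(the one absolute constant TP cannot supply)".

### 9c. Other dimensions / models (scope of the difficulty)
The same typed statement over `zdGraph d`, `d ≥ 5`, is a THEOREM (Hara–Slade: the bubble diagram
`B(z_c) = Σ_x G_{z_c}(0,x)² < ∞`, hence `G_{z_c}(0,e)² ≤ B(z_c) < ∞`; cf. the tree's
`Literature/Barriers/CriticalPhenomena/LaceExpansionBubbleFiveDim*.lean`). For simple random walk
the analogue is FALSE in `d = 2` (recurrence: the critical Green function is infinite) — Madras–Slade
p. 37 stress this contrast; finiteness for SAW in `d = 2` rests on `α_sing < 1`, for which no soft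
argument is known. Nothing in the typed crux lets a prover import the `d ≥ 5` or the Gaussian case.
-/

/-- SAWs of `ℤ²` from `0` to `e₀` staying in the closed upper half-plane `{y ≥ 0}` ("arches"
between two adjacent boundary sites of the half-plane). [cite: MadrasSlade1993, §1.2 (half-space walks)] -/
def HalfPlaneSAW : Type := {p : LatticeSAW 0 e₀ // ∀ w ∈ p.1.support, 0 ≤ w 1}

/-- The critical HALF-PLANE bubble `A = Σ_{arches 0 → e₀} x_c^{|γ|} ∈ [0,∞]`. -/
def halfPlaneBubble : ℝ≥0∞ :=
  ∑' p : HalfPlaneSAW, ENNReal.ofReal (criticalFugacity ^ p.1.1.length)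

/-- The planner's foreseen layer-2 crux `HalfPlaneBubble`, typed intrinsically on `ℤ²`. -/
def HalfPlaneBubbleFinite : Prop := halfPlaneBubble ≠ ⊤

/-- `A ≤ G`: the half-plane bubble is dominated by the bulk bubble. [folklore] -/
theorem halfPlaneBubble_le_bubble : halfPlaneBubble ≤ bubble e₀ := by
  rw [halfPlaneBubble, bubble, latticeKernel]
  exact ENNReal.tsum_comp_le_tsum_of_injective Subtype.val_injective
    (fun p : LatticeSAW 0 e₀ => ENNReal.ofReal (criticalFugacity ^ p.1.length))

/-- The crux implies the planner's `HalfPlaneBubble` (trivially); the CONVERSE ("BulkFromBoundary")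
is where the multiplicity factor `m` lives (§9a) and is not glue. [folklore] -/
theorem halfPlaneBubbleFinite_of_criticalBubbleBound (h : CriticalBubbleBound) : HalfPlaneBubbleFinite :=
  ne_top_of_le_ne_top ((criticalBubbleBound_iff_bubble_ne_top.1 h) e₀ adj_zero_e₀) halfPlaneBubble_le_bubble

/-- A lattice SAW `0 → e₀` AVOIDS THE CUT below the edge `{0, e₀}` if it never steps between the
sites `(0, y)` and `(1, y)` for any `y ≤ -1` (the cut `{1/2} × (-∞, -1/2]`, whose end is the
midpoint region just below the root edge; the root edge itself is not cut). These are the SAWs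
seen, in the limit of large domains, between the two boundary sites at the TIP of a deep thin cut
— the configuration in which the route's `BoundaryHarnack`/`TPToHarnack` consume the constant. -/
def AvoidsCut (p : LatticeSAW 0 e₀) : Prop :=
  ∀ y : ℤ, y ≤ -1 → s((![0, y] : Site 2), ![1, y]) ∉ p.1.edges

/-- The critical SLIT-PLANE bubble `S = Σ_{γ : 0 → e₀ avoiding the cut} x_c^{|γ|}`. -/
def slitPlaneBubble : ℝ≥0∞ :=
  ∑' p : {p : LatticeSAW 0 e₀ // AvoidsCut p}, ENNReal.ofReal (criticalFugacity ^ p.1.1.length)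

/-- Half-plane arches avoid the cut (they never visit a site with negative ordinate). [folklore] -/
theorem avoidsCut_of_halfPlane (p : HalfPlaneSAW) : AvoidsCut p.1 := by
  intro y hy hmem
  have h0 : (![0, y] : Site 2) ∈ p.1.1.support := p.1.1.fst_mem_support_of_mem_edges hmem
  have := p.2 _ h0
  simp at this
  omega

/-- `A ≤ S`: the half-plane bubble is dominated by the slit-plane bubble. [folklore] -/
theorem halfPlaneBubble_le_slitPlaneBubble : halfPlaneBubble ≤ slitPlaneBubble := by
  rw [halfPlaneBubble, slitPlaneBubble]
  let F : HalfPlaneSAW → {p : LatticeSAW 0 e₀ // AvoidsCut p} := fun p => ⟨p.1, avoidsCut_of_halfPlane p⟩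
  have hF : Injective F := fun p q h => Subtype.ext (congrArg (fun r : {p : LatticeSAW 0 e₀ // AvoidsCut p} => r.1) h)
  exact ENNReal.tsum_comp_le_tsum_of_injective hF
    (fun q : {p : LatticeSAW 0 e₀ // AvoidsCut p} => ENNReal.ofReal (criticalFugacity ^ q.1.1.length))

/-- `S ≤ G`: the slit-plane bubble is dominated by the bulk bubble. [folklore] -/
theorem slitPlaneBubble_le_bubble : slitPlaneBubble ≤ bubble e₀ := by
  rw [slitPlaneBubble, bubble, latticeKernel]
  exact ENNReal.tsum_comp_le_tsum_of_injective Subtype.val_injective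
    (fun p : LatticeSAW 0 e₀ => ENNReal.ofReal (criticalFugacity ^ p.1.length))

/-- The three-level chain `A ≤ S ≤ G` (half-plane ≤ slit-plane ≤ bulk). What the route needs at
slit tips is `S < ∞`; what the foreseen layer-2 crux offers is `A < ∞`; what the crux states is
`G < ∞`. Only `G < ∞ ⇒ S < ∞ ⇒ A < ∞` are free.

EXPONENT LEDGER (heuristic, `p_m = m^{-θ} μ^m`, `ν = 3/4`; exact combinatorics, conjectural
exponents): in polygon language the three series count the `m`-gons with a multiplicity —
`G`: `(m/2) p_m` (root edge anywhere: finite iff `θ > 2`); `S`: `Σ_P width(P) ≍ m^ν p_m` (the root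
edge must be the LOWEST edge of the polygon in its column strip — one per occupied strip — since
the cut below the root must stay in the exterior: finite iff `θ > 1 + ν = 7/4`); `A`:
`Σ_P #{edges of P on its lowest row} ≍ p_m` up to `m^{o(1)}` (finite iff `θ > 1`, morally). With the
predicted `θ = 5/2` all three converge; with the best proved `θ_n ≥ 3/2 - δ` (density one, Hammond
2018) none is settled. So restating the crux "for boundary pairs only" does NOT buy the half-plane
threshold: slit tips keep it at `7/4`, interior pairs at `2`. [folklore] -/
theorem bubble_chain : halfPlaneBubble ≤ slitPlaneBubble ∧ slitPlaneBubble ≤ bubble e₀ :=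
  ⟨halfPlaneBubble_le_slitPlaneBubble, slitPlaneBubble_le_bubble⟩

/-! ### 9d. Realistic intermediate TARGETS (near-misses we cannot close; no `sorry` kept)

* `ClosingBound ε` below with ANY `ε > 0` closes the crux (`criticalBubbleBound_of_closing_bound`);
  in print `ε` would have to beat Hammond's density-one `n^{-3/2+o(1)}` polygon bound by making it
  hold for ALL `n` with an extra factor `n^{-1/2-ε}` — open.
* Equivalently a polygon bound `p_m ≤ K m^{-2-ε} μ^m` for all even `m`.
* NOT sufficient (do not file): `p_m ≤ μ^m` (Kesten/Hammersley, gives `Σ m · 1`), Madras's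
  `p_m ≤ C m^{-1/2} μ^m`, any bound on `c_n` alone, any susceptibility / `ℓ¹` bound (§6), any
  statement open in the fugacity (§4), TP₂ alone (§9b). -/

/-- TARGET SHAPE for provers: a polynomial closing bound with exponent `1 + ε`. At `ε = 1/2` this
is the conjectured truth `c_n(0,e) ≍ n^{-3/2} μ^n`. [cite: MadrasSlade1993, §1.4] -/
def ClosingBound (ε : ℝ) : Prop :=
  ∃ K : ℝ, ∀ e : Site 2, (zdGraph 2).Adj 0 e → ∀ n : ℕ,
    (Zd.countAt 2 n e : ℝ) * criticalFugacity ^ n ≤ K * ((n : ℝ) + 1) ^ (-(1 + ε))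

/-- Any positive `ε` in `ClosingBound ε` proves the crux. [cite: MadrasSlade1993, §1.4] -/
theorem criticalBubbleBound_of_closingBound {ε : ℝ} (hε : 0 < ε) (h : ClosingBound ε) :
    CriticalBubbleBound := by
  obtain ⟨K, hK⟩ := h
  exact criticalBubbleBound_of_closing_bound hε hK

/-! ## §10 Dihedral symmetry: the crux is about ONE number `G_{x_c}(0,e₀)` -/

/-- The kernel does not decrease under a graph automorphism applied to both endpoints. [folklore] -/
theorem latticeKernel_le_map (x : ℝ) (φ : zdGraph 2 ≃g zdGraph 2) (u v : Site 2) :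
    latticeKernel x u v ≤ latticeKernel x (φ u) (φ v) := by
  let F : LatticeSAW u v → LatticeSAW (φ u) (φ v) := fun p =>
    ⟨p.1.map φ.toHom, p.2.map φ.injective⟩
  have hF : Injective F := by
    rintro ⟨p, hp⟩ ⟨q, hq⟩ h
    have h' := congrArg Subtype.val h
    exact Subtype.ext (SimpleGraph.Walk.map_injective_of_injective φ.injective u v h')
  have key : (fun p : LatticeSAW u v => ENNReal.ofReal (x ^ p.1.length)) =
      fun p => (fun q : LatticeSAW (φ u) (φ v) => ENNReal.ofReal (x ^ q.1.length)) (F p) := by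
    funext p
    exact congrArg (fun n : ℕ => ENNReal.ofReal (x ^ n)) (SimpleGraph.Walk.length_map _ _).symm
  calc latticeKernel x u v
      = ∑' p : LatticeSAW u v, (fun q : LatticeSAW (φ u) (φ v) => ENNReal.ofReal (x ^ q.1.length)) (F p) := by
        rw [latticeKernel, key]
    _ ≤ latticeKernel x (φ u) (φ v) := ENNReal.tsum_comp_le_tsum_of_injective hF _

/-- **Invariance** of the kernel under the automorphisms of `ℤ²`. [folklore] -/
theorem latticeKernel_map (x : ℝ) (φ : zdGraph 2 ≃g zdGraph 2) (u v : Site 2) :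
    latticeKernel x (φ u) (φ v) = latticeKernel x u v := by
  refine le_antisymm ?_ (latticeKernel_le_map x φ u v)
  simpa using latticeKernel_le_map x φ.symm (φ u) (φ v)

/-- Central symmetry `x ↦ -x` of `ℤ²`. [folklore] -/
def negIso : zdGraph 2 ≃g zdGraph 2 where
  toEquiv := Equiv.neg (Site 2)
  map_rel_iff' := Zd.zdGraph_adj_neg _ _

/-- The coordinate swap `(a, b) ↦ (b, a)`. [folklore] -/
def swapSite (x : Site 2) : Site 2 := ![x 1, x 0]

/-- The swap is an involution. [folklore] -/
@[simp] theorem swapSite_swapSite (x : Site 2) : swapSite (swapSite x) = x := by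
  funext i; fin_cases i <;> rfl

/-- The swap preserves adjacency. [folklore] -/
theorem zdGraph_adj_swapSite {x y : Site 2} (h : (zdGraph 2).Adj x y) :
    (zdGraph 2).Adj (swapSite x) (swapSite y) := by
  rw [zdGraph_adj_iff] at h ⊢
  obtain ⟨i, h | h⟩ := h
  · subst h
    fin_cases i
    · exact ⟨1, Or.inl (by funext j; fin_cases j <;> simp [swapSite])⟩
    · exact ⟨0, Or.inl (by funext j; fin_cases j <;> simp [swapSite])⟩
  · subst h
    fin_cases i
    · exact ⟨1, Or.inr (by funext j; fin_cases j <;> simp [swapSite])⟩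
    · exact ⟨0, Or.inr (by funext j; fin_cases j <;> simp [swapSite])⟩

/-- The coordinate swap as an automorphism of `ℤ²`. [folklore] -/
def swapIso : zdGraph 2 ≃g zdGraph 2 where
  toEquiv := ⟨swapSite, swapSite, swapSite_swapSite, swapSite_swapSite⟩
  map_rel_iff' := by
    intro a b
    refine ⟨fun h => ?_, zdGraph_adj_swapSite⟩
    simpa using zdGraph_adj_swapSite h

/-- **All four critical bubbles coincide**: `G_{x_c}(0,e) = G_{x_c}(0,e₀)` for every unit vector `e`
(dihedral symmetry of `ℤ²`). [folklore] -/
theorem bubble_eq_bubble_e₀ {e : Site 2} (he : (zdGraph 2).Adj 0 e) : bubble e = bubble e₀ := by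
  have hneg : ∀ w : Site 2, bubble (-w) = bubble w := fun w => by
    have h := latticeKernel_map criticalFugacity negIso 0 w
    simp only [negIso] at h
    exact h
  have hswap : ∀ w : Site 2, bubble (swapSite w) = bubble w := fun w => by
    have h := latticeKernel_map criticalFugacity swapIso 0 w
    have h0 : swapIso 0 = 0 := by funext j; fin_cases j <;> rfl
    rw [h0] at h
    exact h
  have he₁ : swapSite e₀ = Pi.single 1 1 := by
    funext j; fin_cases j <;> simp [swapSite, e₀]
  have he₀ : (Pi.single 0 1 : Site 2) = e₀ := by
    funext j; fin_cases j <;> simp [e₀]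
  obtain ⟨i, hi | hi⟩ := (zdGraph_adj_iff _ _).1 he
  · rw [zero_add] at hi; subst hi
    fin_cases i
    · simp [he₀]
    · rw [Fin.mk_one, ← he₁, hswap]
  · have : e = -Pi.single i 1 := eq_neg_of_add_eq_zero_left hi.symm
    subst this
    rw [hneg]
    fin_cases i
    · simp [he₀]
    · rw [Fin.mk_one, ← he₁, hswap]

/-- **SINGLE-NUMBER NORMAL FORM.** `CriticalBubbleBound ⟺ G_{x_c}(0,e₀) < ∞`, with
`G_{x_c}(0,e₀) = Σ_n c_n(0,e₀) x_c^n = x_c + Σ_{m≥4} (m/2) p_m x_c^{m-1}`. [cite: MadrasSlade1993, §1.4] -/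
theorem criticalBubbleBound_iff_bubble_e₀_ne_top : CriticalBubbleBound ↔ bubble e₀ ≠ ⊤ := by
  rw [criticalBubbleBound_iff_bubble_ne_top]
  exact ⟨fun h => h e₀ adj_zero_e₀, fun h e he => by rwa [bubble_eq_bubble_e₀ he]⟩

/-! ## §11 Approach to criticality: the crux ⟺ no blow-up of the subcritical nearest-neighbour
two-point function as `x ↑ x_c` (left-continuity of a power series with nonnegative coefficients) -/

/-- Monotonicity of the kernel in the fugacity (on `x ≥ 0`). [folklore] -/
theorem latticeKernel_mono {x y : ℝ} (hx : 0 ≤ x) (hxy : x ≤ y) (u v : Site 2) :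
    latticeKernel x u v ≤ latticeKernel y u v :=
  ENNReal.tsum_le_tsum fun _ => ENNReal.ofReal_le_ofReal (pow_le_pow_left₀ hx hxy _)

/-- **Left-continuity at `x_c`**: `K_{x_c}(u,v) = sup_{0 ≤ x < x_c} K_x(u,v)` (monotone convergence
for a power series with nonnegative coefficients, valid whether or not the value is finite). [folklore] -/
theorem latticeKernel_criticalFugacity_eq_iSup (u v : Site 2) :
    latticeKernel criticalFugacity u v =
      ⨆ x : Set.Ico (0 : ℝ) criticalFugacity, latticeKernel x.1 u v := by
  have hxc := criticalFugacity_pos_lt_one'.1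
  refine le_antisymm ?_ (iSup_le fun x => latticeKernel_mono x.2.1 x.2.2.le u v)
  rw [latticeKernel, ENNReal.tsum_eq_iSup_sum]
  refine iSup_le fun s => ?_
  -- the finite sum is continuous in the fugacity, hence its value at `x_c` is a limit from the left
  set g : ℝ → ℝ≥0∞ := fun x => ∑ p ∈ s, ENNReal.ofReal (x ^ p.1.length) with hg
  have hcont : Continuous g := by
    refine continuous_finsetSum _ fun p _ => ?_
    exact ENNReal.continuous_ofReal.comp (continuous_pow _)
  have htend : Tendsto g (𝓝[<] criticalFugacity) (𝓝 (g criticalFugacity)) :=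
    (hcont.tendsto _).mono_left nhdsWithin_le_nhds
  have hev : ∀ᶠ x in 𝓝[<] criticalFugacity,
      g x ≤ ⨆ x : Set.Ico (0 : ℝ) criticalFugacity, latticeKernel x.1 u v := by
    have hmem : Set.Ioo (0 : ℝ) criticalFugacity ∈ 𝓝[<] criticalFugacity :=
      Ioo_mem_nhdsLT hxc
    filter_upwards [hmem] with x hx
    calc g x ≤ latticeKernel x u v := by rw [hg, latticeKernel]; exact ENNReal.sum_le_tsum _
      _ ≤ ⨆ x : Set.Ico (0 : ℝ) criticalFugacity, latticeKernel x.1 u v :=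
          le_iSup (fun x : Set.Ico (0 : ℝ) criticalFugacity => latticeKernel x.1 u v) ⟨x, hx.1.le, hx.2⟩
  exact le_of_tendsto htend hev

/-- **THE CRUX AS A STATEMENT ABOUT THE APPROACH TO CRITICALITY.** `CriticalBubbleBound` holds iff
the (finite, §5) subcritical nearest-neighbour kernels stay bounded as `x ↑ x_c`:
`∃ C < ∞, ∀ x ∈ (0, x_c), ∀ u ∼ v, K_x(u,v) ≤ C`. In exponent language: the susceptibility
`χ(x) ↑ ∞` (γ = 43/32) while `G_x(0,e) = x + Σ (m/2) p_m x^{m-1}` should converge to a finite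
limit (`1 - α = 1/2 > 0`); the crux is precisely the absence of a divergence of the ENERGY-like
quantity `G_x(0,e)` at `x_c⁻`. [cite: MadrasSlade1993, §1.4] -/
theorem criticalBubbleBound_iff_subcritical_bounded :
    CriticalBubbleBound ↔ ∃ C : ℝ≥0∞, C ≠ ⊤ ∧ ∀ x : ℝ, 0 < x → x < criticalFugacity →
      ∀ u v : Site 2, (zdGraph 2).Adj u v → latticeKernel x u v ≤ C := by
  rw [criticalBubbleBound_iff_latticeKernel]
  constructor
  · rintro ⟨C, hC, h⟩
    exact ⟨C, hC, fun x hx0 hx u v huv => (latticeKernel_mono hx0.le hx.le u v).trans (h u v huv)⟩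
  · rintro ⟨C, hC, h⟩
    refine ⟨C, hC, fun u v huv => ?_⟩
    rw [latticeKernel_criticalFugacity_eq_iSup]
    refine iSup_le fun x => ?_
    rcases x.2.1.eq_or_lt with h0 | h0
    · -- `x = 0`: only the trivial walk could weigh, and `u ≠ v`
      calc latticeKernel x.1 u v ≤ latticeKernel (criticalFugacity / 2) u v :=
            latticeKernel_mono x.2.1 (by rw [← h0]; linarith [criticalFugacity_pos_lt_one'.1]) u v
        _ ≤ C := h _ (by linarith [criticalFugacity_pos_lt_one'.1])
            (by linarith [criticalFugacity_pos_lt_one'.1]) u v huv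
    · exact h x.1 h0 x.2.2 u v huv

/-! ## §12 Parity bookkeeping: only odd lengths contribute to the bubble (`ℤ²` is bipartite) -/

/-- Coordinate-sum parity along a lattice walk: `Σ_i v_i - Σ_i u_i ≡ |p| (mod 2)`. [folklore] -/
theorem walk_parity {u v : Site 2} (p : (zdGraph 2).Walk u v) :
    Even ((v 0 + v 1) - (u 0 + u 1) - (p.length : ℤ)) := by
  induction p with
  | nil => simp
  | cons hadj q ih =>
    rename_i a b c
    rw [SimpleGraph.Walk.length_cons]
    obtain ⟨i, h | h⟩ := (zdGraph_adj_iff _ _).1 hadj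
    · have hb : b 0 + b 1 = a 0 + a 1 + 1 := by
        subst h; fin_cases i <;> simp <;> ring
      have : (c 0 + c 1) - (a 0 + a 1) - ((q.length + 1 : ℕ) : ℤ) =
          ((c 0 + c 1) - (b 0 + b 1) - (q.length : ℤ)) := by push_cast; rw [hb]; ring
      rw [this]; exact ih
    · have ha : a 0 + a 1 = b 0 + b 1 + 1 := by
        subst h; fin_cases i <;> simp <;> ring
      have : (c 0 + c 1) - (a 0 + a 1) - ((q.length + 1 : ℕ) : ℤ) =
          ((c 0 + c 1) - (b 0 + b 1) - (q.length : ℤ)) - 2 := by push_cast; rw [ha]; ring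
      rw [this]; exact ih.sub (by decide)

/-- SAWs `0 → e₀` have ODD length; hence `c_n(0,e₀) = 0` for even `n` and
`G_x(0,e₀) = Σ_{n odd} c_n(0,e₀) x^n` (`= x + 2x³ + 6x⁵ + 28x⁷ + 140x⁹ + …`). [folklore] -/
theorem countAt_e₀_eq_zero_of_even {n : ℕ} (hn : Even n) : Zd.countAt 2 n e₀ = 0 := by
  classical
  rw [← Zd.card_sawWalksAt, Finset.card_eq_zero, Finset.eq_empty_iff_forall_notMem]
  intro p hp
  have hlen : p.length = n := (Zd.mem_sawWalksAt.1 hp).2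
  have hpar : Even ((e₀ 0 + e₀ 1) - ((0 : Site 2) 0 + (0 : Site 2) 1) - (p.length : ℤ)) := walk_parity p
  have h1 : (e₀ 0 + e₀ 1 : ℤ) = 1 := by simp [e₀]
  have h0 : ((0 : Site 2) 0 + (0 : Site 2) 1 : ℤ) = 0 := by simp
  rw [h1, h0, hlen] at hpar
  obtain ⟨k, hk⟩ := hn
  obtain ⟨j, hj⟩ := hpar
  omega

/-! ## §13 Computational corollary (work file only: inherits `Lean.ofReduceBool` from the
certified `μ ≤ 2.7`, hence not landed under `Theorems/`) -/

/- BODY MOVED OUT OF THE WORK FILE (gen 5: `crux write` caps the file at 200 kB). Landed verbatim as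
   (work-file-only corollary of §8; dropped with it);
   declarations (same names, namespace `Summit.CriticalPhenomena.SAWScalingLimit.Theorems.CriticalBubbleBound.Negative`,
   module imported above): `const_ge_of_criticalBubbleBound_cert`. -/

/-! ## §14 Load-bearing analysis: SELF-AVOIDANCE. Dropping `IsPath` (and moving the fugacity to
the memoryless critical value `1/4 = 1/lim (4ⁿ)^{1/n}`) makes the statement FALSE in `d = 2` -/

/- BODY MOVED OUT OF THE WORK FILE (gen 5: `crux write` caps the file at 200 kB). Landed verbatim as
   `Theorems/CriticalBubbleBound/Negative/CriticalBubbleBoundRandomWalkFalse.lean` (gen 3);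
   declarations (same names, namespace `Summit.CriticalPhenomena.SAWScalingLimit.Theorems.CriticalBubbleBound.Negative`,
   module imported above): `rwCountAt`, `rwCountAt_le_four_pow`, `countAt_le_rwCountAt`, `rwKernel`, `latticeKernel_zero_le_rwKernel`, `rwKernel_ne_top_of_lt_quarter`, `letter`, `two_mul_dx_letter`, `two_mul_dy_letter`, `letter_inj`, `pairWord`, `length_pairWord`, `pairWord_inj`, `sum_sign`, `wEnd_ofFn`, `wEnd_pairWord`, `choose_sq_le_rwCountAt`, `sixteen_pow_le`, `sixteen_pow_le_rwCountAt`, `term_lower_bound`, `tsum_inv_sixteen_succ_eq_top`, `rwKernel_quarter_e₀_eq_top`, `CriticalBubbleBoundWithoutSelfAvoidance`, `criticalBubbleBound_false_without_selfAvoidance`. -/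

/-! ## §15 Barrier reduction: the crux in the catalogue's vocabulary; the ℓ²-strengthening
(bubble CONDITION) is FALSE on `ℤ²` -/

/-- The catalogue's `G_z(x) = Σ_n c_n(x) zⁿ ∈ [0,∞]` IS the lattice kernel `K_z(0,x)` (`z ≥ 0`).
[cite: Slade2006LaceExpansion, §2.1, eq. (2.18)] -/
theorem twoPointENN_two_eq_latticeKernel {z : ℝ} (hz : 0 ≤ z) (x : Site 2) :
    twoPointENN 2 z x = latticeKernel z 0 x := by
  rw [latticeKernel_zero_eq_tsum_countAt, twoPointENN]
  exact tsum_congr fun n => by rw [ENNReal.ofReal_pow hz]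

/-- The critical bubble at `e` is the catalogue's `G_{z_c}(e)` (`criticalPoint 2 = criticalFugacity`
definitionally). [cite: MadrasSlade1993, §1.4] -/
theorem bubble_eq_twoPointENN (e : Site 2) : bubble e = twoPointENN 2 (Zd.criticalPoint 2) e := by
  rw [bubble, Zd.criticalPoint_two, twoPointENN_two_eq_latticeKernel criticalFugacity_pos_lt_one'.1.le]

/-- **CATALOGUE FORM OF THE CRUX**: `CriticalBubbleBound ⟺ ∀ e ∼ 0, G_{z_c}(e) < ∞` with
`G = Literature.Barriers.CriticalPhenomena.twoPointENN 2 (criticalPoint 2)` — verbatim the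
quantity of which Madras–Slade (p. 18/37) say "it has not yet been proved rigorously that
`G_{z_c}(0,x)` is even finite for `d = 2, 3` or `4`", and of which the catalogue's docstring says
"finiteness of `G_{z_c}(x)` is open for `d ≤ 4`". [cite: MadrasSlade1993, §1.4] -/
theorem criticalBubbleBound_iff_twoPointENN_lt_top :
    CriticalBubbleBound ↔
      ∀ e : Site 2, (zdGraph 2).Adj 0 e → twoPointENN 2 (Zd.criticalPoint 2) e < ⊤ := by
  rw [criticalBubbleBound_iff_bubble_ne_top]
  refine forall₂_congr fun e _ => ?_
  rw [bubble_eq_twoPointENN, lt_top_iff_ne_top]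

/-- Dropping `u ∼ v` (§3) in catalogue form: `sup_x G_{z_c}(x) < ∞`. [cite: MadrasSlade1993, §1.4] -/
theorem criticalBubbleBoundWithoutAdj_iff_twoPointENN :
    CriticalBubbleBoundWithoutAdj ↔
      ∃ C : ℝ≥0∞, C ≠ ⊤ ∧ ∀ x : Site 2, twoPointENN 2 (Zd.criticalPoint 2) x ≤ C := by
  rw [criticalBubbleBoundWithoutAdj_iff]
  simp only [Zd.criticalPoint_two, twoPointENN_two_eq_latticeKernel criticalFugacity_pos_lt_one'.1.le]

/-- `G_{z_c}(e)² ≤ B(z_c) = Σ_x G_{z_c}(x)²`. [cite: Slade2006LaceExpansion, §2.2, eq. (2.30)] -/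
theorem bubble_sq_le_bubbleDiagram (e : Site 2) : bubble e ^ 2 ≤ bubbleDiagram 2 (Zd.criticalPoint 2) := by
  rw [bubble_eq_twoPointENN, bubbleDiagram]
  exact ENNReal.le_tsum e

/-- **THE ℓ²-STRENGTHENING IMPLIES THE CRUX …** The bubble CONDITION `B(z_c) < ∞` — the
hypothesis under which the lace expansion / Theorem 2.3 of Slade 2006 deliver mean-field behaviour,
and a THEOREM for `d ≥ 5` (Hara–Slade), where it is how `G_{z_c}(0,e) < ∞` is known — gives
`CriticalBubbleBound` at once (`G(e)² ≤ B`) **… AND IS FALSE ON `ℤ²`**: the tree theorem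
`Literature.Barriers.CriticalPhenomena.not_bubbleCondition_two` (from the Lieb–Simon critical
sphere bound `Σ_{‖y‖∞ = R} G_{z_c}(y) ≥ 1`, Cauchy–Schwarz on the `8R` sites of the sphere and
`Σ 1/R = ∞`). So this implication is void in the plane: the bubble-condition / small-bubble
lace-expansion route — the only one that has ever proved finiteness of a critical BULK two-point
function of a SAW model (`d ≥ 5`; on the hexagonal lattice the parafermionic observable bounds only
boundary/half-plane quantities, §9a(3)) — CANNOT reach this crux; a proof needs an input bounding
the single number `G_{z_c}(e₀)` without square-summability. [cite: MadrasSlade1993, Definition 1.5.1 and §1.5 p. 22] -/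
theorem criticalBubbleBound_of_bubbleCondition (h : BubbleCondition 2) : CriticalBubbleBound := by
  rw [criticalBubbleBound_iff_bubble_ne_top]
  intro e _ htop
  have h2 : bubble e ^ 2 ≠ ⊤ := ne_top_of_le_ne_top h.ne (bubble_sq_le_bubbleDiagram e)
  rw [htop, ENNReal.top_pow two_ne_zero] at h2
  exact h2 rfl

/-- **ℓ² = ∞ in the crux's own vocabulary**: `Σ_{x ∈ ℤ²} K_{x_c}(0,x)² = ∞`. With §6
(`Σ_x K_{x_c}(0,x) ≥ χ(x_c) = ∞`, ℓ¹) and §3 (`sup_x K_{x_c}(0,x) < ∞`, ℓ^∞, open, believed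
true) the crux `K_{x_c}(0,e₀) < ∞` is the WEAKEST statement of the chain
`ℓ¹ ⊂ ℓ² ⊂ ℓ^∞ ⊂ {value at e₀}`, and the first two are false. [cite: MadrasSlade1993, §1.5 p. 22 and Lemma A.1] -/
theorem tsum_bubble_sq_eq_top : ∑' x : Site 2, bubble x ^ 2 = ⊤ := by
  have h := bubbleDiagram_two_eq_top
  rw [bubbleDiagram] at h
  simpa only [bubble_eq_twoPointENN] using h

/-- The critical sphere bound in the crux's vocabulary: `Σ_{‖y‖∞ = R} K_{x_c}(0,y) ≥ 1` for every
`R ≥ 1` — the critical two-point function is not summably small on spheres (whence `χ(x_c) = ∞`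
and `B(x_c) = ∞`), while nothing follows for the bounded quantities `sup_x K` and `K(0,e₀)`.
[cite: MadrasSlade1993, Lemma A.1 and eq. (6.5.8)] -/
theorem one_le_sum_sphere_bubble {R : ℕ} (hR : 1 ≤ R) :
    (1 : ℝ≥0∞) ≤ ∑ y ∈ Literature.Probability.LatticeModels.sphere 2 R, bubble y := by
  simpa only [bubble_eq_twoPointENN] using
    Literature.Barriers.CriticalPhenomena.one_le_sphereSum_twoPointENN 2 hR


/-! ## §16 The DISPROOF side: what `¬ CriticalBubbleBound` needs, and the proved window for the terms -/

/-- **WHAT A REFUTATION IS**: `¬ CriticalBubbleBound ⟺` some unit vector `e` has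
`Σ_n c_n(0,e) x_cⁿ = ∞` (by §10 then every unit vector does). [cite: MadrasSlade1993, §1.4] -/
theorem not_criticalBubbleBound_iff :
    ¬ CriticalBubbleBound ↔ ∃ e : Site 2, (zdGraph 2).Adj 0 e ∧
      ∑' n : ℕ, (Zd.countAt 2 n e : ℝ≥0∞) * ENNReal.ofReal (criticalFugacity ^ n) = ⊤ := by
  rw [criticalBubbleBound_iff_tsum_countAt_ne_top]
  push Not
  rfl

/-- **PROVED LOWER BOUND ON THE TERMS** (the only one in the tree and, to this refuter's reading,
in print): for `e = (0,-1)` and every `M ≥ 1`,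
`c_{2M+1}(0,e) · x_c^{2M+1} ≥ x_c · e^{-2c√M} / ((2M+1)⁴ (M+1)⁴)` — two bridges of length `M`
glued across a separating line make a `(2M+1)`-step SAW `0 → e` (Madras–Slade Theorem 3.2.4,
tree `Zd.sq_bridgeCount_le_card_targetWalks`), and `b_M ≥ e^{-c√M} μ^M` (Hammersley–Welsh,
Corollary 3.1.6, tree `Zd.exp_mul_pow_le_bridgeCount`, `c = c₁ + 8`). The minorant is
STRETCHED-EXPONENTIALLY small, hence summable: the proved lower bounds are consistent with the
crux. A refutation needs `c_n(0,e) x_cⁿ ≥ n^{-1-o(1)}` along a set of `n` with divergent sum —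
in particular POLYNOMIAL lower bounds `p_m ≥ μ^m m^{-K}` on polygon numbers, of which none is
proved (the stretched exponential `e^{-C√m}` of Hammersley–Welsh is the state of the art from
below, exactly as `e^{+C√n}` is from above). [cite: MadrasSlade1993, Theorem 3.2.4 and Corollary 3.1.6] -/
theorem hw_term_lower_bound : ∃ c : ℝ, ∀ M : ℕ, 1 ≤ M →
    criticalFugacity * Real.exp (-(2 * c * Real.sqrt M)) / ((2 * (M : ℝ) + 1) ^ 4 * ((M : ℝ) + 1) ^ 4) ≤
      (Zd.countAt 2 (2 * M + 1) Zd.eDown : ℝ) * criticalFugacity ^ (2 * M + 1) := by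
  obtain ⟨c, hc⟩ := Zd.exp_mul_pow_le_bridgeCount (d := 2)
  refine ⟨c, fun M hM => ?_⟩
  obtain ⟨m, -, hm⟩ := Zd.sq_bridgeCount_le_card_targetWalks hM
  have h1 : (Zd.targetWalks M m).card ≤ Zd.countAt 2 (2 * M + 1) Zd.eDown := by
    rw [← Zd.card_sawFun]
    exact Finset.card_filter_le _ _
  set μ : ℝ := Zd.connectiveConstant 2 with hμdef
  have hμ : 0 < μ := Zd.connectiveConstant_pos 2
  have hxc : criticalFugacity = μ⁻¹ := rfl
  have hb : Real.exp (-(c * Real.sqrt M)) * μ ^ M ≤ Zd.bridgeCount 2 M := hc M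
  have hb2 : (Real.exp (-(c * Real.sqrt M)) * μ ^ M) ^ 2 ≤ (Zd.bridgeCount 2 M : ℝ) ^ 2 :=
    pow_le_pow_left₀ (by positivity) hb 2
  have hP : (Zd.bridgeCount 2 M : ℝ) ^ 2 ≤
      ((2 * (M : ℝ) + 1) ^ 4 * ((M : ℝ) + 1) ^ 4) * Zd.countAt 2 (2 * M + 1) Zd.eDown := by
    have := hm.trans (Nat.mul_le_mul_left _ h1)
    exact_mod_cast this
  have he : Real.exp (-(2 * c * Real.sqrt M)) = Real.exp (-(c * Real.sqrt M)) ^ 2 := by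
    rw [← Real.exp_nat_mul]
    congr 1
    push_cast
    ring
  have hμ0 : μ ≠ 0 := hμ.ne'
  have h0 : 0 ≤ criticalFugacity ^ (2 * M + 1) := pow_nonneg criticalFugacity_pos_lt_one'.1.le _
  rw [div_le_iff₀ (by positivity)]
  calc criticalFugacity * Real.exp (-(2 * c * Real.sqrt M))
      = (Real.exp (-(c * Real.sqrt M)) * μ ^ M) ^ 2 * criticalFugacity ^ (2 * M + 1) := by
        rw [he, hxc, inv_pow]
        field_simp
        ring
    _ ≤ (Zd.bridgeCount 2 M : ℝ) ^ 2 * criticalFugacity ^ (2 * M + 1) :=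
        mul_le_mul_of_nonneg_right hb2 h0
    _ ≤ ((2 * (M : ℝ) + 1) ^ 4 * ((M : ℝ) + 1) ^ 4) * Zd.countAt 2 (2 * M + 1) Zd.eDown *
          criticalFugacity ^ (2 * M + 1) :=
        mul_le_mul_of_nonneg_right hP h0
    _ = (Zd.countAt 2 (2 * M + 1) Zd.eDown : ℝ) * criticalFugacity ^ (2 * M + 1) *
          ((2 * (M : ℝ) + 1) ^ 4 * ((M : ℝ) + 1) ^ 4) := by ring

/-- `(0,-1)` is a neighbour of the origin, so the lower bound concerns a term of the crux's own
series (all four unit vectors give the same series, §10). [folklore] -/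
theorem adj_zero_eDown : (zdGraph 2).Adj 0 Zd.eDown := Zd.adj_zero_eDown

/-- **PROVED UPPER BOUND ON THE TERMS**: `c_n(0,e) x_cⁿ ≤ c_n x_cⁿ ≤ e^{κ√n}` for every `e`
(Hammersley–Welsh, tree `Zd.BDGS2012_HammersleyWelsh_holds`). Useless for the crux (not even
bounded), recorded to frame the window: proved `e^{-2c√n}/poly ≤ t_n ≤ e^{κ√n}`, conjectured
`t_n ≍ n^{-3/2}`, crux ⟺ `Σ t_n < ∞`. [cite: BDGS2012, §1.5.1, eq. (1.25)] -/
theorem hw_term_upper_bound : ∃ κ : ℝ, ∀ (e : Site 2) (n : ℕ),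
    (Zd.countAt 2 n e : ℝ) * criticalFugacity ^ n ≤ Real.exp (κ * Real.sqrt n) := by
  obtain ⟨κ, hκ⟩ := Zd.BDGS2012_HammersleyWelsh_holds 2 le_rfl
  refine ⟨κ, fun e n => ?_⟩
  set μ : ℝ := Zd.connectiveConstant 2 with hμdef
  have hμ : 0 < μ := Zd.connectiveConstant_pos 2
  have hxc : criticalFugacity = μ⁻¹ := rfl
  have h1 : (Zd.countAt 2 n e : ℝ) ≤ Zd.count 2 n := by exact_mod_cast Zd.countAt_le_count n e
  have h2 : (Zd.count 2 n : ℝ) ≤ μ ^ n * Real.exp (κ * Real.sqrt n) := hκ n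
  have hx0 : 0 ≤ criticalFugacity ^ n := pow_nonneg criticalFugacity_pos_lt_one'.1.le _
  calc (Zd.countAt 2 n e : ℝ) * criticalFugacity ^ n
      ≤ (μ ^ n * Real.exp (κ * Real.sqrt n)) * criticalFugacity ^ n :=
        mul_le_mul_of_nonneg_right (h1.trans h2) hx0
    _ = Real.exp (κ * Real.sqrt n) := by
        rw [hxc, inv_pow]
        field_simp


/-! ## §17 (gen 4) BOUNDARY ≠ BULK in the memoryless model: the half-plane kernel is FINITE at
`1/4` while the bulk kernel is infinite (§14) — the foreseen glue `BulkFromBoundary` (§9a) has no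
kernel-level reason; landed copies `Theorems/CriticalBubbleBound/Negative/CriticalBubbleBoundWordReflection.lean`
(part 1) and `…/CriticalBubbleBoundBoundaryBulkMemoryless.lean` (part 2)

### The diagonal-coordinates bijection: exact endpoint bookkeeping for ALL words -/

/- BODY MOVED OUT OF THE WORK FILE (gen 5: `crux write` caps the file at 200 kB). Landed verbatim as
   `Theorems/CriticalBubbleBound/Negative/CriticalBubbleBoundWordReflection.lean` (p72424) and `…/CriticalBubbleBoundBoundaryBulkMemoryless.lean` (p73940) (gen 4);
   declarations (same names, namespace `Summit.CriticalPhenomena.SAWScalingLimit.Theorems.CriticalBubbleBound.Negative`,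
   module imported above): `abit`, `bbit`, `letter_abit_bbit`, `wEnd_pairWord_eq`, `exists_pairWord_eq`, `exists_pairWord_eq_of_wEnd`, `rwCountAt_le_choose_mul_choose`, `choose_mul_choose_le_rwCountAt`, `rwCountAt_e₀_le_choose_sq`, `v₂`, `choose_mul_choose_le_rwCountAt_v₂`, `rwCountAt_e₀_eq_zero_of_even`, `flipUD`, `dx_flipUD`, `dy_flipUD`, `flipUD_flipUD`, `wEnd_map_flipUD_zero`, `wEnd_map_flipUD_one`, `map_flipUD_map_flipUD`, `traj_succ_one_ge`, `Dips`, `dipTime`, `dipTime_spec`, `dipTime_le_length`, `traj_nonneg_of_lt_dipTime`, `dipTime_pos`, `traj_dipTime_eq`, `reflectTail`, `length_reflectTail`, `length_take_dipTime`, `traj_reflectTail_of_le`, `traj_add_eq`, `traj_reflectTail_add`, `dipTime_reflectTail`, `reflectTail_reflectTail`, `wEnd_reflectTail`, `StaysUp`, `hpCountAt`, `hpCountAt_le_rwCountAt`, `dips_of_wEnd_eq_v₂`, `hpCountAt_add_rwCountAt_v₂_le`, `centralBinom_sq_mul_succ_le`, `hpCountAt_bound`, `hpKernel`, `hpKernel_le_rwKernel`,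 `hp_term_bound`, `summable_two_div_sq`, `hpKernel_quarter_e₀_ne_top`, `boundary_finite_bulk_infinite_memoryless`, `BulkFromBoundaryMemoryless`, `not_bulkFromBoundaryMemoryless`. -/

/-! ## §18 (gen 4) The POLYGON normal form: `G_{x_c}(0,e₀) = x_c + Σ_N (N/2) q_N x_c^{N-1}` and
`CriticalBubbleBound ⟺ Σ_N N q_N x_c^N < ∞`; landed copy
`Theorems/CriticalBubbleBound/Negative/CriticalBubbleBoundPolygonSeries.lean` -/

section PolygonSeries

open Literature.Barriers.CriticalPhenomena (horizontalSteps rootedPolygonCount polygonCount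
  isotropicPolygonCount)
open Literature.Barriers.CriticalPhenomena.Haruspicy (rootedPolygonCount_eq_card_sapWords
  card_sapWords_eq polygonCount_eq_card_canonWords)


/-- **Exact re-rooting count** `2N · p_{m,n} = rootedPolygonCount m n` (`N = 2(m+n)`): the
tree's `polygonCount` (defined by integer division) loses nothing — every polygon class has
exactly `2N` rooted oriented representatives (Madras–Slade (3.2.1), via the canonical words of
`SAPCanonical`). [cite: MadrasSlade1993, Definition 3.2.2, eq. (3.2.1)] -/
theorem rootedPolygonCount_eq_mul_polygonCount (m n : ℕ) :
    rootedPolygonCount m n = 2 * (2 * (m + n)) * polygonCount m n := by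
  rw [rootedPolygonCount_eq_card_sapWords, card_sapWords_eq, polygonCount_eq_card_canonWords]

/-- Parity of the horizontal step count of a lattice walk: `#horizontal steps ≡ v₀ - u₀ (mod 2)`
(each horizontal step changes the abscissa by `±1`, each vertical step by `0`). [folklore] -/
theorem horizontalSteps_parity {u v : Site 2} (p : (zdGraph 2).Walk u v) :
    Even ((horizontalSteps p : ℤ) - (v 0 - u 0)) := by
  induction p with
  | nil => simp [horizontalSteps]
  | cons hadj q ih =>
    rename_i a b c
    have hq : horizontalSteps q = q.darts.countP fun e => e.fst 1 = e.snd 1 := rfl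
    have hcons : horizontalSteps (SimpleGraph.Walk.cons hadj q) =
        horizontalSteps q + (if a 1 = b 1 then 1 else 0) := by
      rw [horizontalSteps, SimpleGraph.Walk.darts_cons, List.countP_cons, ← hq]
      congr 1
      by_cases hab : a 1 = b 1 <;> simp [hab]
    rw [hcons]
    obtain ⟨i, h | h⟩ := (zdGraph_adj_iff _ _).1 hadj
    · fin_cases i
      · have hb0 : b 0 = a 0 + 1 := by subst h; simp
        have hb1 : b 1 = a 1 := by subst h; simp
        rw [if_pos hb1.symm]
        have : ((horizontalSteps q + 1 : ℕ) : ℤ) - (c 0 - a 0) =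
            ((horizontalSteps q : ℤ) - (c 0 - b 0)) := by push_cast; rw [hb0]; ring
        rw [this]; exact ih
      · have hb0 : b 0 = a 0 := by subst h; simp
        have hb1 : b 1 = a 1 + 1 := by subst h; simp
        rw [if_neg (by rw [hb1]; omega)]
        have : ((horizontalSteps q + 0 : ℕ) : ℤ) - (c 0 - a 0) =
            ((horizontalSteps q : ℤ) - (c 0 - b 0)) := by push_cast; rw [hb0]; ring
        rw [this]; exact ih
    · fin_cases i
      · have hb0 : a 0 = b 0 + 1 := by subst h; simp
        have hb1 : a 1 = b 1 := by subst h; simp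
        rw [if_pos hb1]
        have : ((horizontalSteps q + 1 : ℕ) : ℤ) - (c 0 - a 0) =
            ((horizontalSteps q : ℤ) - (c 0 - b 0)) + 2 := by push_cast; rw [hb0]; ring
        rw [this]; exact ih.add (by decide)
      · have hb0 : a 0 = b 0 := by subst h; simp
        have hb1 : a 1 = b 1 + 1 := by subst h; simp
        rw [if_neg (by rw [hb1]; omega)]
        have : ((horizontalSteps q + 0 : ℕ) : ℤ) - (c 0 - a 0) =
            ((horizontalSteps q : ℤ) - (c 0 - b 0)) := by push_cast; rw [hb0]; ring
        rw [this]; exact ih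

/-- `#horizontal steps ≤ |p|`. [folklore] -/
theorem horizontalSteps_le_length {u v : Site 2} (p : (zdGraph 2).Walk u v) :
    horizontalSteps p ≤ p.length := by
  rw [horizontalSteps, ← SimpleGraph.Walk.length_darts]
  exact List.countP_le_length

/-- For a neighbour `e` of `0`: the closing-bond indicator `[e₁ = 0]` has the parity of `e₀`. [folklore] -/
theorem ind_parity_of_adj_zero {e : Site 2} (he : (zdGraph 2).Adj 0 e) :
    Even ((if e 1 = 0 then 1 else 0 : ℕ) - (e 0 : ℤ)) := by
  obtain ⟨i, h | h⟩ := (zdGraph_adj_iff _ _).1 he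
  · rw [zero_add] at h
    subst h
    fin_cases i <;> simp
  · have : e = -Pi.single i 1 := eq_neg_of_add_eq_zero_left h.symm
    subst this
    fin_cases i <;> simp

/-- **Every closed-up SAW is counted once**: for `K ≥ 2`,
`Σ_{m ≤ K} rootedPolygonCount m (K-m) = Σ_{e ∼ 0} c_{2K-1}(0,e)` — the horizontal-bond classes
partition the `(2K-1)`-step SAWs from `0` to the neighbours of `0` (the bond count of the closed
polygon is even and at most `2K`). [cite: MadrasSlade1993, §3.2, eq. (3.2.1)] -/
theorem sum_rootedPolygonCount_eq (K : ℕ) (hK : 2 ≤ K) :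
    ∑ m ∈ Finset.range (K + 1), rootedPolygonCount m (K - m) =
      ∑ e ∈ (zdGraph 2).neighborFinset 0, Zd.countAt 2 (2 * K - 1) e := by
  classical
  have h1 : ∀ m ∈ Finset.range (K + 1), rootedPolygonCount m (K - m) =
      ∑ e ∈ (zdGraph 2).neighborFinset 0,
        (((zdGraph 2).finsetWalkLength (2 * K - 1) (0 : Site 2) e).filter
          fun p => p.IsPath ∧ horizontalSteps p + (if e 1 = 0 then 1 else 0) = 2 * m).card := by
    intro m hm
    rw [Finset.mem_range] at hm
    have hmK : m + (K - m) = K := by omega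
    rw [rootedPolygonCount, hmK, if_neg (by omega)]
  rw [Finset.sum_congr rfl h1, Finset.sum_comm]
  refine Finset.sum_congr rfl fun e he => ?_
  rw [SimpleGraph.mem_neighborFinset] at he
  set c : ℕ := if e 1 = 0 then 1 else 0 with hc
  set S := (zdGraph 2).finsetWalkLength (2 * K - 1) (0 : Site 2) e with hS
  have hct : Zd.countAt 2 (2 * K - 1) e = (S.filter fun p => p.IsPath).card := by
    rw [Zd.countAt]
  rw [hct, Finset.card_eq_sum_card_fiberwise (f := fun p => (horizontalSteps p + c) / 2)
    (t := Finset.range (K + 1)) ?_]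
  · refine Finset.sum_congr rfl fun m _ => ?_
    rw [Finset.filter_filter]
    congr 1
    apply Finset.filter_congr
    intro p hp
    rw [hS, SimpleGraph.mem_finsetWalkLength_iff] at hp
    have hev : Even ((horizontalSteps p : ℤ) + c) := by
      have h1 := horizontalSteps_parity p
      have h2 := ind_parity_of_adj_zero he
      simp only [Pi.zero_apply, sub_zero] at h1
      have := (h1.add h2).add (even_two_mul (e 0))
      rw [hc]
      have key : (horizontalSteps p : ℤ) + ((if e 1 = 0 then 1 else 0 : ℕ) : ℕ) =
          (horizontalSteps p : ℤ) - e 0 + (((if e 1 = 0 then 1 else 0 : ℕ) : ℕ) - e 0) + 2 * e 0 := by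
        ring
      rw [key]
      exact this
    obtain ⟨k, hk⟩ := hev
    constructor
    · rintro ⟨hpath, hm⟩
      exact ⟨hpath, by omega⟩
    · rintro ⟨hpath, hm⟩
      exact ⟨hpath, by omega⟩
  · intro p hp
    rw [Finset.mem_coe, Finset.mem_filter, hS, SimpleGraph.mem_finsetWalkLength_iff] at hp
    show (horizontalSteps p + c) / 2 ∈ (↑(Finset.range (K + 1)) : Set ℕ)
    rw [Finset.mem_coe, Finset.mem_range]
    have h1 := horizontalSteps_le_length p
    have h2 : c ≤ 1 := by rw [hc]; split_ifs <;> omega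
    omega

/-- **Rooted loops are `2N` times the polygons**: for `K ≥ 2`,
`Σ_{e ∼ 0} c_{2K-1}(0,e) = 2 · (2K) · q_{2K}` (`q_N = isotropicPolygonCount N`, the number of
`N`-step self-avoiding polygons up to translation). [cite: MadrasSlade1993, §3.2, eq. (3.2.1)] -/
theorem sum_countAt_eq_mul_isotropicPolygonCount (K : ℕ) (hK : 2 ≤ K) :
    ∑ e ∈ (zdGraph 2).neighborFinset 0, Zd.countAt 2 (2 * K - 1) e =
      2 * (2 * K) * isotropicPolygonCount (2 * K) := by
  rw [← sum_rootedPolygonCount_eq K hK, isotropicPolygonCount, if_pos (even_two_mul K),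
    show 2 * K / 2 = K by omega, Finset.mul_sum]
  refine Finset.sum_congr rfl fun m hm => ?_
  rw [Finset.mem_range] at hm
  rw [rootedPolygonCount_eq_mul_polygonCount, show m + (K - m) = K by omega]

/-- SAWs from `0` to a NEIGHBOUR of `0` have odd length: `c_n(0,e) = 0` for even `n`. [folklore] -/
theorem countAt_eq_zero_of_even_of_adj {n : ℕ} (hn : Even n) {e : Site 2}
    (he : (zdGraph 2).Adj 0 e) : Zd.countAt 2 n e = 0 := by
  classical
  rw [← Zd.card_sawWalksAt, Finset.card_eq_zero, Finset.eq_empty_iff_forall_notMem]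
  intro p hp
  have hlen : p.length = n := (Zd.mem_sawWalksAt.1 hp).2
  have hpar : Even ((e 0 + e 1) - ((0 : Site 2) 0 + (0 : Site 2) 1) - (p.length : ℤ)) := walk_parity p
  have h1 : Even ((e 0 + e 1 : ℤ) - 1) := by
    obtain ⟨i, h | h⟩ := (zdGraph_adj_iff _ _).1 he
    · rw [zero_add] at h
      subst h
      fin_cases i <;> simp
    · have : e = -Pi.single i 1 := eq_neg_of_add_eq_zero_left h.symm
      subst this
      fin_cases i <;> simp
  have h0 : ((0 : Site 2) 0 + (0 : Site 2) 1 : ℤ) = 0 := by simp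
  rw [h0, hlen] at hpar
  obtain ⟨k, hk⟩ := hn
  obtain ⟨j, hj⟩ := hpar
  obtain ⟨l, hl⟩ := h1
  omega

/-- The one-step walk: `c_1(0,e) = 1` for `e ∼ 0`. [folklore] -/
theorem countAt_one_of_adj {e : Site 2} (he : (zdGraph 2).Adj 0 e) : Zd.countAt 2 1 e = 1 := by
  classical
  rw [Zd.countAt, Finset.card_eq_one]
  refine ⟨SimpleGraph.Walk.cons he SimpleGraph.Walk.nil, ?_⟩
  ext p
  rw [Finset.mem_filter, SimpleGraph.mem_finsetWalkLength_iff, Finset.mem_singleton]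
  constructor
  · rintro ⟨hl, -⟩
    cases p with
    | nil => simp at hl
    | cons h q =>
      rename_i b
      rw [SimpleGraph.Walk.length_cons] at hl
      have hq : q.length = 0 := by omega
      have hb : b = e := SimpleGraph.Walk.eq_of_length_eq_zero hq
      subst hb
      rw [SimpleGraph.Walk.length_eq_zero_iff] at hq
      cases hq
      rfl
  · rintro rfl
    exact ⟨rfl, by simp [SimpleGraph.Walk.cons_isPath_iff, he.ne]⟩

/-- The origin of `ℤ²` has `4` neighbours, so `Σ_{e ∼ 0} c_1(0,e) = 4`. [folklore] -/
theorem sum_countAt_one : ∑ e ∈ (zdGraph 2).neighborFinset 0, Zd.countAt 2 1 e = 4 := by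
  rw [Finset.sum_congr rfl fun e he => countAt_one_of_adj ((SimpleGraph.mem_neighborFinset _ _ _).1 he),
    Finset.sum_const, smul_eq_mul, mul_one]
  exact card_neighborFinset_zdGraph_holds (d := 2) 0

/-! ### The series identity `x_c · Σ_{e∼0} G_{x_c}(0,e) = 4 x_c² + 2 Σ_N N q_N x_c^N` -/

/-- **`T := Σ_N N · q_N · x_c^N ∈ [0,∞]`** — the critical polygon mass rooted at a VERTEX
(`q_N = isotropicPolygonCount N` = `N`-step self-avoiding polygons of `ℤ²` up to translation;
with `q_N = N^{-θ_N} μ^N` this is `Σ_N N^{1-θ_N}`). The common normal form of the ideators'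
cards ("`Σ_N N p_N μ^{-N} < ∞`", "`θ > 2` with a summable margin"). [cite: MadrasSlade1993, §1.4 and eq. (3.2.1)] -/
def polygonSeries : ℝ≥0∞ :=
  ∑' N : ℕ, ((N * isotropicPolygonCount N : ℕ) : ℝ≥0∞) * ENNReal.ofReal (criticalFugacity ^ N)

/-- The sum of the four critical bubbles as ONE length series with the rooted-loop counts
`a_n := Σ_{e ∼ 0} c_n(0,e)`. [folklore] -/
theorem sum_bubble_eq_tsum :
    ∑ e ∈ (zdGraph 2).neighborFinset 0, bubble e =
      ∑' n : ℕ, ((∑ e ∈ (zdGraph 2).neighborFinset 0, Zd.countAt 2 n e : ℕ) : ℝ≥0∞) *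
        ENNReal.ofReal (criticalFugacity ^ n) := by
  simp_rw [bubble, latticeKernel_zero_eq_tsum_countAt]
  rw [← Summable.tsum_finsetSum (fun _ _ => ENNReal.summable)]
  refine tsum_congr fun n => ?_
  rw [Nat.cast_sum, Finset.sum_mul]

/-- Even lengths carry no loops: `a_{2K} = 0`. [folklore] -/
theorem loopCount_even (K : ℕ) : ∑ e ∈ (zdGraph 2).neighborFinset 0, Zd.countAt 2 (2 * K) e = 0 :=
  Finset.sum_eq_zero fun _ he => countAt_eq_zero_of_even_of_adj (even_two_mul K)
    ((SimpleGraph.mem_neighborFinset _ _ _).1 he)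

/-- Odd lengths `≥ 3`: `a_{2K+3} = 2 (2K+4) q_{2K+4}`. [cite: MadrasSlade1993, §3.2, eq. (3.2.1)] -/
theorem loopCount_odd (K : ℕ) : ∑ e ∈ (zdGraph 2).neighborFinset 0, Zd.countAt 2 (2 * K + 3) e =
    2 * (2 * K + 4) * isotropicPolygonCount (2 * K + 4) := by
  have h := sum_countAt_eq_mul_isotropicPolygonCount (K + 2) (by omega)
  rw [show 2 * (K + 2) - 1 = 2 * K + 3 by omega, show 2 * (K + 2) = 2 * K + 4 by ring] at h
  exact h

/-- `q_2 = 0` (no polygon has two bonds). [folklore] -/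
theorem isotropicPolygonCount_two : isotropicPolygonCount 2 = 0 := by
  rw [isotropicPolygonCount, if_pos (by decide), show 2 / 2 = 1 from rfl, Finset.sum_eq_zero]
  intro m hm
  rw [Finset.mem_range] at hm
  rw [polygonCount, rootedPolygonCount, if_pos (by omega), Nat.zero_div]

/-- `q_N = 0` for odd `N`. [folklore] -/
theorem isotropicPolygonCount_odd (K : ℕ) : isotropicPolygonCount (2 * K + 1) = 0 := by
  rw [isotropicPolygonCount, if_neg]
  rw [Nat.not_even_iff_odd]
  exact odd_two_mul_add_one K

/-- **THE LOOP/POLYGON IDENTITY**: `x_c · Σ_{e ∼ 0} G_{x_c}(0,e) = 4 x_c² + 2 T`, i.e. (§10, all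
four bubbles equal) `G_{x_c}(0,e₀) = x_c + Σ_N (N/2) q_N x_c^{N-1}`: the one-step walk, plus
the polygons through the root edge counted with multiplicity `N/2` = (number of edges of the
polygon parallel to `e₀`, on average over the quarter turn). This is the typed form of §9a(1):
the difference between the BULK bubble and any boundary bubble is exactly the factor `N`
(where along the polygon the root edge sits). [cite: MadrasSlade1993, §3.2, eq. (3.2.1)] -/
theorem criticalFugacity_mul_sum_bubble :
    ENNReal.ofReal criticalFugacity * ∑ e ∈ (zdGraph 2).neighborFinset 0, bubble e =
      4 * ENNReal.ofReal (criticalFugacity ^ 2) + 2 * polygonSeries := by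
  set x := criticalFugacity with hx
  have hx0 : 0 ≤ x := criticalFugacity_pos_lt_one'.1.le
  set X : ℕ → ℝ≥0∞ := fun n => ENNReal.ofReal (x ^ n) with hX
  have hXmul : ∀ n, ENNReal.ofReal x * X n = X (n + 1) := fun n => by
    simp only [hX]
    rw [← ENNReal.ofReal_mul hx0, pow_succ, mul_comm]
  set a : ℕ → ℕ := fun n => ∑ e ∈ (zdGraph 2).neighborFinset 0, Zd.countAt 2 n e with ha
  have hS : ∑ e ∈ (zdGraph 2).neighborFinset 0, bubble e = ∑' n, (a n : ℝ≥0∞) * X n :=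
    sum_bubble_eq_tsum
  have hS2 : ∑' n, (a n : ℝ≥0∞) * X n = 4 * X 1 + ∑' K, (a (2 * K + 3) : ℝ≥0∞) * X (2 * K + 3) := by
    rw [← tsum_even_add_odd (f := fun n => (a n : ℝ≥0∞) * X n) ENNReal.summable ENNReal.summable]
    have heven : ∀ K, (a (2 * K) : ℝ≥0∞) * X (2 * K) = 0 := fun K => by
      rw [show a (2 * K) = 0 from loopCount_even K]
      simp
    simp only [heven, tsum_zero, zero_add]
    rw [tsum_eq_zero_add' ENNReal.summable]
    congr 1
    rw [show a (2 * 0 + 1) = 4 from sum_countAt_one]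
    simp
  have hP : polygonSeries =
      ∑' K, (((2 * K + 4) * isotropicPolygonCount (2 * K + 4) : ℕ) : ℝ≥0∞) * X (2 * K + 4) := by
    rw [polygonSeries]
    change ∑' N, ((N * isotropicPolygonCount N : ℕ) : ℝ≥0∞) * X N = _
    rw [← tsum_even_add_odd (f := fun N => ((N * isotropicPolygonCount N : ℕ) : ℝ≥0∞) * X N)
      ENNReal.summable ENNReal.summable]
    have hodd : ∀ K, (((2 * K + 1) * isotropicPolygonCount (2 * K + 1) : ℕ) : ℝ≥0∞) * X (2 * K + 1) = 0 :=
      fun K => by rw [isotropicPolygonCount_odd]; simp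
    simp only [hodd, tsum_zero, add_zero]
    rw [tsum_eq_zero_add' ENNReal.summable, tsum_eq_zero_add' ENNReal.summable]
    have h0 : (((2 * 0) * isotropicPolygonCount (2 * 0) : ℕ) : ℝ≥0∞) * X (2 * 0) = 0 := by simp
    have h1 : (((2 * (0 + 1)) * isotropicPolygonCount (2 * (0 + 1)) : ℕ) : ℝ≥0∞) * X (2 * (0 + 1)) = 0 := by
      rw [show 2 * (0 + 1) = 2 by rfl, isotropicPolygonCount_two]
      simp
    rw [h0, h1, zero_add, zero_add]
    refine tsum_congr fun K => ?_
    rw [show 2 * (K + 1 + 1) = 2 * K + 4 by ring]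
  -- assemble
  rw [hS, hS2, mul_add, ← ENNReal.tsum_mul_left, hP, ← ENNReal.tsum_mul_left]
  congr 1
  · rw [← mul_assoc, mul_comm (ENNReal.ofReal x) 4, mul_assoc, hXmul 1]
  · refine tsum_congr fun K => ?_
    rw [← mul_assoc, mul_comm (ENNReal.ofReal x), mul_assoc, hXmul,
      show a (2 * K + 3) = 2 * (2 * K + 4) * isotropicPolygonCount (2 * K + 4) from loopCount_odd K,
      show 2 * K + 3 + 1 = 2 * K + 4 by ring]
    push_cast
    ring

/-- **POLYGON NORMAL FORM OF THE CRUX**: `CriticalBubbleBound ⟺ Σ_N N q_N x_c^N < ∞` —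
finiteness of the critical polygon mass rooted at a vertex, i.e. "`θ > 2` summably" for
`q_N = N^{-θ_N} μ^N` (truth `θ = 5/2`; proved: `θ_N ≥ 3/2 - δ` on a density-one set, Hammond
2018). Every ideator card for this crux starts here. [cite: MadrasSlade1993, §1.4, eq. (1.4.13) and eq. (3.2.1)] -/
theorem criticalBubbleBound_iff_polygonSeries_ne_top : CriticalBubbleBound ↔ polygonSeries ≠ ⊤ := by
  rw [criticalBubbleBound_iff_bubble_ne_top]
  have hid := criticalFugacity_mul_sum_bubble
  have hx0 : ENNReal.ofReal criticalFugacity ≠ 0 :=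
    (ENNReal.ofReal_pos.2 criticalFugacity_pos_lt_one'.1).ne'
  constructor
  · intro h hP
    have hS : ∑ e ∈ (zdGraph 2).neighborFinset 0, bubble e ≠ ⊤ :=
      ENNReal.sum_ne_top.2 fun e he => h e ((SimpleGraph.mem_neighborFinset _ _ _).1 he)
    have hfin : ENNReal.ofReal criticalFugacity * ∑ e ∈ (zdGraph 2).neighborFinset 0, bubble e ≠ ⊤ :=
      ENNReal.mul_ne_top ENNReal.ofReal_ne_top hS
    rw [hid, hP, ENNReal.mul_top two_ne_zero] at hfin
    exact hfin (by simp)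
  · intro hP e he
    have hfin : 4 * ENNReal.ofReal (criticalFugacity ^ 2) + 2 * polygonSeries ≠ ⊤ :=
      ENNReal.add_ne_top.2 ⟨ENNReal.mul_ne_top (by simp) ENNReal.ofReal_ne_top,
        ENNReal.mul_ne_top (by simp) hP⟩
    rw [← hid] at hfin
    have hS : ∑ e ∈ (zdGraph 2).neighborFinset 0, bubble e ≠ ⊤ := by
      intro htop
      rw [htop, ENNReal.mul_top hx0] at hfin
      exact hfin rfl
    exact ne_top_of_le_ne_top hS (Finset.single_le_sum (f := bubble) (fun _ _ => zero_le)
      ((SimpleGraph.mem_neighborFinset _ _ _).2 he))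

/-- **THE BUBBLE AS A POLYGON SERIES**: `2 x_c · G_{x_c}(0,e₀) = 2 x_c² + Σ_N N q_N x_c^N`, i.e.
`G_{x_c}(0,e₀) = x_c + Σ_N (N/2) q_N x_c^{N-1}` (numerically `≈ 0.379 + 0.43 ≈ 0.81`, §8).
[cite: MadrasSlade1993, §3.2, eq. (3.2.1)] -/
theorem two_mul_criticalFugacity_mul_bubble_e₀ :
    2 * (ENNReal.ofReal criticalFugacity * bubble e₀) =
      2 * ENNReal.ofReal (criticalFugacity ^ 2) + polygonSeries := by
  have hid := criticalFugacity_mul_sum_bubble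
  have hsum : ∑ e ∈ (zdGraph 2).neighborFinset 0, bubble e = 4 * bubble e₀ := by
    rw [Finset.sum_congr rfl fun e he => bubble_eq_bubble_e₀ ((SimpleGraph.mem_neighborFinset _ _ _).1 he),
      Finset.sum_const, card_neighborFinset_zdGraph_holds (d := 2) 0, nsmul_eq_mul]
    norm_num
  rw [hsum] at hid
  have h4 : ENNReal.ofReal criticalFugacity * (4 * bubble e₀) = 2 * (2 * (ENNReal.ofReal criticalFugacity * bubble e₀)) := by
    ring
  have h4' : 4 * ENNReal.ofReal (criticalFugacity ^ 2) + 2 * polygonSeries =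
      2 * (2 * ENNReal.ofReal (criticalFugacity ^ 2) + polygonSeries) := by ring
  rw [h4, h4'] at hid
  exact (ENNReal.mul_right_inj two_ne_zero ENNReal.ofNat_ne_top).1 hid

end PolygonSeries

/-! ## §19 (gen 4) The DIMENSION ledger: the same statement on `ℤ^d` — `d = 1` trivial, `d ≥ 5` a
(vendored) theorem, `d = 2` the crux, `d = 3, 4` equally open; landed copy
`Theorems/CriticalBubbleBound/Negative/CriticalBubbleBoundDimension.lean` -/

section Dimension

open Literature.Barriers.CriticalPhenomena (HaraSlade1992_bubbleCondition)


/-- The crux in dimension `d`, in the catalogue's vocabulary (§15): the critical nearest-neighbour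
two-point function of `ℤ^d` is finite, `∀ e ∼ 0, G_{z_c(d)}(e) < ∞`. -/
def CriticalBubbleBoundDim (d : ℕ) : Prop :=
  ∀ e : Site d, (zdGraph d).Adj 0 e → twoPointENN d (Zd.criticalPoint d) e < ⊤

/-- `d = 2` IS the crux (§15). [cite: MadrasSlade1993, §1.4] -/
theorem criticalBubbleBoundDim_two_iff : CriticalBubbleBoundDim 2 ↔ CriticalBubbleBound :=
  criticalBubbleBound_iff_twoPointENN_lt_top.symm

/-- `G_z(e)² ≤ B(z)` in every dimension. [cite: Slade2006LaceExpansion, §2.2, eq. (2.30)] -/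
theorem twoPointENN_sq_le_bubbleDiagram (d : ℕ) (z : ℝ) (e : Site d) :
    twoPointENN d z e ^ 2 ≤ bubbleDiagram d z := by
  rw [bubbleDiagram]
  exact ENNReal.le_tsum e

/-- The bubble CONDITION implies the statement in any dimension (how it is known for `d ≥ 5`;
void for `d = 2` by `not_bubbleCondition_two`, §15). [cite: MadrasSlade1993, Definition 1.5.1 and §1.5 p. 22] -/
theorem criticalBubbleBoundDim_of_bubbleCondition {d : ℕ} (h : BubbleCondition d) :
    CriticalBubbleBoundDim d := by
  intro e _
  have h2 : twoPointENN d (Zd.criticalPoint d) e ^ 2 < ⊤ :=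
    lt_of_le_of_lt (twoPointENN_sq_le_bubbleDiagram d _ e) h
  by_contra htop
  rw [not_lt, top_le_iff] at htop
  rw [htop, ENNReal.top_pow two_ne_zero] at h2
  exact lt_irrefl _ h2

/-- **`d ≥ 5`: a THEOREM in print** (Hara–Slade 1992, the tree's named fact
`HaraSlade1992_bubbleCondition`, vendored; its discharge chain lives in
`Literature/Barriers/CriticalPhenomena/LaceExpansionBubbleFiveDim*.lean`). [cite: MadrasSlade1993, Theorem 6.1.6 and Corollary 6.1.7] -/
theorem criticalBubbleBoundDim_of_haraSlade (h : HaraSlade1992_bubbleCondition) {d : ℕ} (hd : 5 ≤ d) :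
    CriticalBubbleBoundDim d :=
  criticalBubbleBoundDim_of_bubbleCondition (h d hd)

/-! ### `d = 1`: self-avoiding walks of `ℤ` are monotone -/

/-- On `ℤ¹` a SAW from `0` to a NEIGHBOUR has length exactly `1`: `c_n(0,e) = 0` for `n ≠ 1`
(the tree's `Zd.apply_eq_mul_of_mem_saws_one`: a SAW of `ℤ` is `i ↦ s·i`, `s = ±1`). [folklore] -/
theorem countAt_dim_one_eq_zero {n : ℕ} (hn : n ≠ 1) {e : Site 1} (he : (zdGraph 1).Adj 0 e) :
    Zd.countAt 1 n e = 0 := by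
  classical
  rw [← Zd.card_sawFun, Finset.card_eq_zero, Finset.eq_empty_iff_forall_notMem]
  intro ω hω
  rw [Zd.mem_sawFun_iff_mem_saws] at hω
  obtain ⟨hω, hωn⟩ := hω
  rcases Nat.eq_zero_or_pos n with rfl | hpos
  · have h0 : ω 0 = 0 := (Zd.mem_saws.1 hω).1
    rw [h0] at hωn
    exact he.ne hωn
  · obtain ⟨hs, hlin⟩ := Zd.apply_eq_mul_of_mem_saws_one hω hpos
    have h := hlin n le_rfl
    rw [hωn] at h
    have he' := Zd.apply_zero_of_adj_one he
    simp only [Pi.zero_apply, zero_add, zero_sub] at he'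
    rcases hs with hs | hs <;> rw [hs] at h <;> rcases he' with he' | he' <;> rw [he'] at h <;> omega

/-- **`d = 1`: TRIVIALLY TRUE** — `G_z(0,±1) = z` for every fugacity (the only SAW of `ℤ` from
`0` to `±1` is the single step), in particular at `z_c(1)`. The difficulty of the crux is
specific to `2 ≤ d ≤ 4`. [folklore] -/
theorem criticalBubbleBoundDim_one : CriticalBubbleBoundDim 1 := by
  intro e he
  rw [twoPointENN, tsum_eq_single 1]
  · exact ENNReal.mul_lt_top (ENNReal.natCast_lt_top _) (ENNReal.pow_lt_top ENNReal.ofReal_lt_top)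
  · intro n hn
    rw [countAt_dim_one_eq_zero hn he]
    simp

/-- **DIMENSION LEDGER** (summary): `d = 1` true (above); `d ≥ 5` true given the vendored
Hara–Slade fact; `d = 2` is `CriticalBubbleBound` (§15); nothing here separates `d = 2` from
`d = 3, 4`, where the statement is equally open (Madras–Slade p. 37) — so no proof of the crux
can be a soft argument valid in all dimensions `≤ 4` unless it also settles `d = 3, 4`, and no
disproof can be a soft low-dimensional argument unless it fails for `d = 1`. [cite: MadrasSlade1993, §1.4] -/
theorem dimension_ledger (h : HaraSlade1992_bubbleCondition) :
    CriticalBubbleBoundDim 1 ∧ (∀ d, 5 ≤ d → CriticalBubbleBoundDim d) ∧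
      (CriticalBubbleBoundDim 2 ↔ CriticalBubbleBound) :=
  ⟨criticalBubbleBoundDim_one, fun _ hd => criticalBubbleBoundDim_of_haraSlade h hd,
    criticalBubbleBoundDim_two_iff⟩

end Dimension

/-! ## §20 (gen 4) HEX COMPARISON: on the honeycomb lattice the half-plane ARCH function is a
THEOREM (tree, unconditional), the bulk statement is open there too -/

section Hex

open Literature.Probability.RandomPlanarGeometry.SAW.HV (stripA stripAlim)

/-- **The hexagonal half-plane arch function is bounded, with an explicit constant.** For every
strip domain `S_{T,L}` of the honeycomb lattice (`T ≥ 1` strips of hexagons, cut at height `L`):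
`A_{T,L}(x_c^{hex}) = Σ_{γ ⊂ S_{T,L} : a → α∖{a}} (x_c^{hex})^{ℓ(γ)} ≤ 1/cos(3π/8) ≈ 2.613`,
UNCONDITIONALLY in the tree (Duminil-Copin–Smirnov's Lemma 2 is discharged:
`DuminilCopinSmirnov2012_lemma2_holds`; `x_c^{hex} = 1/√(2+√2)`). The arches from the boundary
mid-edge `a` to the ADJACENT boundary mid-edges are among the walks counted by `A`, and every
half-plane arch lives in some `S_{T,L}`: the honeycomb analogue of the planner's `HalfPlaneBubble`
(§9, `HalfPlaneBubbleFinite`) is TRUE, uniformly in the domain. By contrast the honeycomb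
analogues of the BULK crux `G_{x_c}(0,e) < ∞` and of the slit-plane bubble `S` (what the route
consumes at slit tips, §9a(2)) are OPEN: the parafermionic observable is summed against boundary
mid-edges only, and at the vertex next to `a` its pair terms are exactly the rooted-loop masses
(§9a(3)). On `ℤ²` even the arch function is open. So "boundary bubble" results do not transfer
to the crux on either lattice (§17: not even for the memoryless kernel). [cite: DuminilCopinSmirnov2012, Lemma 2 and §3] -/
theorem hex_stripA_le {T : ℕ} (hT : 1 ≤ T) (L : ℕ) :
    stripA T L hexCriticalFugacity ≤ (Real.cos (3 * Real.pi / 8))⁻¹ :=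
  stripA_le_of_lemma2 DuminilCopinSmirnov2012_lemma2_holds hT L

/-- The infinite-strip arch function `A_T(x_c^{hex}) = sup_L A_{T,L} ≤ 1/cos(3π/8)` for every
width `T ≥ 1` — the honeycomb `HalfPlaneBubble`, bounded uniformly in `T`. [cite: DuminilCopinSmirnov2012, §3 (A_T)] -/
theorem hex_stripAlim_le {T : ℕ} (hT : 1 ≤ T) : stripAlim T ≤ (Real.cos (3 * Real.pi / 8))⁻¹ :=
  ciSup_le fun L => hex_stripA_le hT L

end Hex

/-! ## §21 (gen 4) The UNROOTED polygon mass `𝒫 = Σ_N q_N x_c^N` sits below the half-plane bubble: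
`𝒫 ≤ x_c · A` (canonical words are half-plane arches) and `𝒫 ≤ T`; landed copy
`Theorems/CriticalBubbleBound/Negative/CriticalBubbleBoundUnrootedPolygons.lean` -/

/- BODY MOVED OUT OF THE WORK FILE (gen 5: `crux write` caps the file at 200 kB). Landed verbatim as
   `Theorems/CriticalBubbleBound/Negative/CriticalBubbleBoundUnrootedPolygons.lean` (p75741) (gen 4);
   declarations (same names, namespace `Summit.CriticalPhenomena.SAWScalingLimit.Theorems.CriticalBubbleBound.Negative`,
   module imported above): `unrootedPolygonSeries`, `isotropicPolygonCount_zero`, `unrootedPolygonSeries_le_polygonSeries`, `stepVec_injective'`, `eq_of_vtx_eq`, `canon_facts`, `archOf`, `length_archOf`, `getVert_archOf`, `archOf_inj`, `canonSet`, `mem_canonSet`, `isotropicPolygonCount_le_card_canonSet`, `CanonSigma`, `archSigma`, `archSigma_injective`, `unrootedPolygonSeries_le_halfPlaneBubble`, `unrootedPolygonSeries_ne_top_of_halfPlaneBubbleFinite`, `unrootedPolygonSeries_ne_top_of_criticalBubbleBound`. -/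

/-! ## §22 (gen 4) The polygon mass function `T_x := Σ_N N q_N x^N` has radius of convergence
EXACTLY `x_c`; the crux is its finiteness AT the radius; landed copy
`Theorems/CriticalBubbleBound/Negative/CriticalBubbleBoundPolygonRadius.lean` -/

section Radius

open Literature.Barriers.CriticalPhenomena (isotropicPolygonCount)


/-- `T_x := Σ_N N q_N x^N ∈ [0,∞]`, the vertex-rooted polygon mass at fugacity `x`
(`T_{x_c} = T` of §18). [cite: MadrasSlade1993, §3.2, eq. (3.2.1)] -/
def polygonSeriesAt (x : ℝ) : ℝ≥0∞ :=
  ∑' N : ℕ, ((N * isotropicPolygonCount N : ℕ) : ℝ≥0∞) * ENNReal.ofReal (x ^ N)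

/-- At `x_c` this is the series of §18. [folklore] -/
theorem polygonSeriesAt_criticalFugacity : polygonSeriesAt criticalFugacity = polygonSeries := rfl

/-- The four nearest-neighbour kernels as one length series, any fugacity. [folklore] -/
theorem sum_latticeKernel_eq_tsum (x : ℝ) :
    ∑ e ∈ (zdGraph 2).neighborFinset 0, latticeKernel x 0 e =
      ∑' n : ℕ, ((∑ e ∈ (zdGraph 2).neighborFinset 0, Zd.countAt 2 n e : ℕ) : ℝ≥0∞) *
        ENNReal.ofReal (x ^ n) := by
  simp_rw [latticeKernel_zero_eq_tsum_countAt]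
  rw [← Summable.tsum_finsetSum (fun _ _ => ENNReal.summable)]
  refine tsum_congr fun n => ?_
  rw [Nat.cast_sum, Finset.sum_mul]

/-- **THE LOOP/POLYGON IDENTITY AT EVERY FUGACITY `x ≥ 0`**:
`x · Σ_{e ∼ 0} K_x(0,e) = 4x² + 2 T_x` (the combinatorics `Σ_{e∼0} c_{N-1}(0,e) = 2N q_N` is
fugacity-free). [cite: MadrasSlade1993, §3.2, eq. (3.2.1)] -/
theorem ofReal_mul_sum_latticeKernel {x : ℝ} (hx0 : 0 ≤ x) :
    ENNReal.ofReal x * ∑ e ∈ (zdGraph 2).neighborFinset 0, latticeKernel x 0 e =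
      4 * ENNReal.ofReal (x ^ 2) + 2 * polygonSeriesAt x := by
  set X : ℕ → ℝ≥0∞ := fun n => ENNReal.ofReal (x ^ n) with hX
  have hXmul : ∀ n, ENNReal.ofReal x * X n = X (n + 1) := fun n => by
    simp only [hX]
    rw [← ENNReal.ofReal_mul hx0, pow_succ, mul_comm]
  set a : ℕ → ℕ := fun n => ∑ e ∈ (zdGraph 2).neighborFinset 0, Zd.countAt 2 n e with ha
  have hS : ∑ e ∈ (zdGraph 2).neighborFinset 0, latticeKernel x 0 e = ∑' n, (a n : ℝ≥0∞) * X n :=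
    sum_latticeKernel_eq_tsum x
  have hS2 : ∑' n, (a n : ℝ≥0∞) * X n = 4 * X 1 + ∑' K, (a (2 * K + 3) : ℝ≥0∞) * X (2 * K + 3) := by
    rw [← tsum_even_add_odd (f := fun n => (a n : ℝ≥0∞) * X n) ENNReal.summable ENNReal.summable]
    have heven : ∀ K, (a (2 * K) : ℝ≥0∞) * X (2 * K) = 0 := fun K => by
      rw [show a (2 * K) = 0 from loopCount_even K]
      simp
    simp only [heven, tsum_zero, zero_add]
    rw [tsum_eq_zero_add' ENNReal.summable]
    congr 1
    rw [show a (2 * 0 + 1) = 4 from sum_countAt_one]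
    simp
  have hP : polygonSeriesAt x =
      ∑' K, (((2 * K + 4) * isotropicPolygonCount (2 * K + 4) : ℕ) : ℝ≥0∞) * X (2 * K + 4) := by
    rw [polygonSeriesAt]
    change ∑' N, ((N * isotropicPolygonCount N : ℕ) : ℝ≥0∞) * X N = _
    rw [← tsum_even_add_odd (f := fun N => ((N * isotropicPolygonCount N : ℕ) : ℝ≥0∞) * X N)
      ENNReal.summable ENNReal.summable]
    have hodd : ∀ K, (((2 * K + 1) * isotropicPolygonCount (2 * K + 1) : ℕ) : ℝ≥0∞) * X (2 * K + 1) = 0 :=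
      fun K => by rw [isotropicPolygonCount_odd]; simp
    simp only [hodd, tsum_zero, add_zero]
    rw [tsum_eq_zero_add' ENNReal.summable, tsum_eq_zero_add' ENNReal.summable]
    have h0 : (((2 * 0) * isotropicPolygonCount (2 * 0) : ℕ) : ℝ≥0∞) * X (2 * 0) = 0 := by simp
    have h1 : (((2 * (0 + 1)) * isotropicPolygonCount (2 * (0 + 1)) : ℕ) : ℝ≥0∞) * X (2 * (0 + 1)) = 0 := by
      rw [show 2 * (0 + 1) = 2 by rfl, isotropicPolygonCount_two]
      simp
    rw [h0, h1, zero_add, zero_add]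
    refine tsum_congr fun K => ?_
    rw [show 2 * (K + 1 + 1) = 2 * K + 4 by ring]
  rw [hS, hS2, mul_add, ← ENNReal.tsum_mul_left, hP, ← ENNReal.tsum_mul_left]
  congr 1
  · rw [← mul_assoc, mul_comm (ENNReal.ofReal x) 4, mul_assoc, hXmul 1]
  · refine tsum_congr fun K => ?_
    rw [← mul_assoc, mul_comm (ENNReal.ofReal x), mul_assoc, hXmul,
      show a (2 * K + 3) = 2 * (2 * K + 4) * isotropicPolygonCount (2 * K + 4) from loopCount_odd K,
      show 2 * K + 3 + 1 = 2 * K + 4 by ring]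
    push_cast
    ring

/-- `CriticalBubbleBoundAt x` in one-number form: all four `K_x(0,e)`, `e ∼ 0`, finite. [folklore] -/
theorem criticalBubbleBoundAt_iff_forall (x : ℝ) :
    CriticalBubbleBoundAt x ↔ ∀ e : Site 2, (zdGraph 2).Adj 0 e → latticeKernel x 0 e ≠ ⊤ := by
  rw [criticalBubbleBoundAt_iff_latticeKernel]
  constructor
  · rintro ⟨C, hC, h⟩ e he
    exact ne_top_of_le_ne_top hC (h 0 e he)
  · intro h
    refine ⟨∑ e ∈ (zdGraph 2).neighborFinset 0, latticeKernel x 0 e, ?_, fun u v huv => ?_⟩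
    · exact ENNReal.sum_ne_top.2 fun e he => h e ((SimpleGraph.mem_neighborFinset _ _ _).1 he)
    · rw [latticeKernel_eq_zero_sub]
      have hadj : (zdGraph 2).Adj 0 (v - u) := by
        have := (Zd.zdGraph_adj_sub_right u v u).2 huv
        rwa [sub_self] at this
      exact Finset.single_le_sum (f := fun e => latticeKernel x 0 e) (fun _ _ => zero_le)
        ((SimpleGraph.mem_neighborFinset _ _ _).2 hadj)

/-- **`CriticalBubbleBoundAt x ⟺ T_x < ∞`** for every `x > 0`. [cite: MadrasSlade1993, §3.2, eq. (3.2.1)] -/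
theorem criticalBubbleBoundAt_iff_polygonSeriesAt_ne_top {x : ℝ} (hx : 0 < x) :
    CriticalBubbleBoundAt x ↔ polygonSeriesAt x ≠ ⊤ := by
  rw [criticalBubbleBoundAt_iff_forall]
  have hid := ofReal_mul_sum_latticeKernel hx.le
  have hx0 : ENNReal.ofReal x ≠ 0 := (ENNReal.ofReal_pos.2 hx).ne'
  constructor
  · intro h hP
    have hS : ∑ e ∈ (zdGraph 2).neighborFinset 0, latticeKernel x 0 e ≠ ⊤ :=
      ENNReal.sum_ne_top.2 fun e he => h e ((SimpleGraph.mem_neighborFinset _ _ _).1 he)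
    have hfin : ENNReal.ofReal x * ∑ e ∈ (zdGraph 2).neighborFinset 0, latticeKernel x 0 e ≠ ⊤ :=
      ENNReal.mul_ne_top ENNReal.ofReal_ne_top hS
    rw [hid, hP, ENNReal.mul_top two_ne_zero] at hfin
    exact hfin (by simp)
  · intro hP e he
    have hfin : 4 * ENNReal.ofReal (x ^ 2) + 2 * polygonSeriesAt x ≠ ⊤ :=
      ENNReal.add_ne_top.2 ⟨ENNReal.mul_ne_top (by simp) ENNReal.ofReal_ne_top,
        ENNReal.mul_ne_top (by simp) hP⟩
    rw [← hid] at hfin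
    have hS : ∑ e ∈ (zdGraph 2).neighborFinset 0, latticeKernel x 0 e ≠ ⊤ := by
      intro htop
      rw [htop, ENNReal.mul_top hx0] at hfin
      exact hfin rfl
    exact ne_top_of_le_ne_top hS (Finset.single_le_sum (f := fun e => latticeKernel x 0 e)
      (fun _ _ => zero_le) ((SimpleGraph.mem_neighborFinset _ _ _).2 he))

/-- **`T_x = ∞` for every `x > x_c`** — the polygon generating function diverges above the
critical fugacity (`limsup q_N^{1/N} ≥ μ`, the non-trivial half of Madras–Slade Corollary 3.2.5),
obtained here from the SUPERCRITICAL side §4 (Duminil-Copin–Kozma–Yadin Prop. 3) instead of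
Kesten's bridges. [cite: MadrasSlade1993, Corollary 3.2.5] -/
theorem polygonSeriesAt_eq_top_of_criticalFugacity_lt {x : ℝ} (hx : criticalFugacity < x) :
    polygonSeriesAt x = ⊤ := by
  by_contra h
  exact not_criticalBubbleBoundAt_of_criticalFugacity_lt hx
    ((criticalBubbleBoundAt_iff_polygonSeriesAt_ne_top (criticalFugacity_pos_lt_one'.1.trans hx)).2 h)

/-- **`T_x < ∞` for every `0 < x < x_c`** (from the SUBCRITICAL side §5). [cite: BDGS2012, §1.5.3] -/
theorem polygonSeriesAt_ne_top_of_lt {x : ℝ} (hx0 : 0 < x) (hx : x < criticalFugacity) :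
    polygonSeriesAt x ≠ ⊤ :=
  (criticalBubbleBoundAt_iff_polygonSeriesAt_ne_top hx0).1 (criticalBubbleBoundAt_of_lt hx0 hx)

/-- **WHERE THE CRUX SITS**: the polygon mass function `x ↦ T_x = Σ_N N q_N x^N` is finite on
`(0, x_c)` and infinite on `(x_c, ∞)` — its radius of convergence is exactly `x_c` — and
`CriticalBubbleBound` is precisely the statement that it is finite AT the radius (a power series
with nonnegative coefficients evaluated on its circle of convergence: no soft argument decides
this; it is the sign of `θ - 2`). [cite: MadrasSlade1993, §1.4 and Corollary 3.2.5] -/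
theorem polygonSeries_radius :
    (∀ x : ℝ, 0 < x → x < criticalFugacity → polygonSeriesAt x ≠ ⊤) ∧
      (∀ x : ℝ, criticalFugacity < x → polygonSeriesAt x = ⊤) ∧
      (CriticalBubbleBound ↔ polygonSeriesAt criticalFugacity ≠ ⊤) :=
  ⟨fun _ hx0 hx => polygonSeriesAt_ne_top_of_lt hx0 hx,
    fun _ hx => polygonSeriesAt_eq_top_of_criticalFugacity_lt hx,
    criticalBubbleBound_iff_polygonSeries_ne_top⟩

end Radius

/-! ## §23 (gen 5) POINTWISE FINITENESS EVERYWHERE: a Simon–Lieb-type step inequality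
`K_x(0,b) ≤ K_x(0,a)·(x⁻¹ + K_x(0,e₀))` (`a ∼ b`), the unconditional bound
`K_x(0,b) ≤ (x⁻¹ + K_x(0,e₀))^{‖b‖₁}`, and `CriticalBubbleBound ⟺ ∀ x ∈ ℤ², G_{x_c}(0,x) < ∞`

Split a SAW `0 → b` at its visit of the neighbour `a` of `b` if there is one (a pair: SAW `0 → a`,
SAW `a → b`), otherwise append the edge `b → a` (a SAW `0 → a`, one step longer). So finiteness of
the ONE number `G_{x_c}(0,e₀)` (the crux, §10) propagates along lattice paths to every site:
the crux is verbatim Madras–Slade's open problem "`G_{z_c}(0,x)` finite" for EVERY `x`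
(`criticalBubbleBound_iff_forall_latticeKernel_ne_top`, barrier form
`criticalBubbleBound_iff_forall_twoPointENN_lt_top'`), finiteness at any single neighbour site is
already the crux (`criticalBubbleBound_iff_exists_unit_ne_top`), and the hierarchy of §3/§6/§15
closes up: `Σ_x G = ∞`, `Σ_x G² = ∞` (proved) ⊋ `sup_x G < ∞` (open, formally stronger) ⟹
`∀ x, G(0,x) < ∞` ⟺ `G(0,e₀) < ∞` = THE CRUX. Disproof side: a refutation may be mounted at ANY
fixed site and is no easier there. Quantitatively the crux alone gives only the exponentially
GROWING bound `G_{x_c}(0,b) ≤ (x_c⁻¹ + C)^{‖b‖₁}` (`bubble_le_pow_dist`), against the conjectured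
decay `|b|^{-5/24}`. Landed copies: `Theorems/CriticalBubbleBound/Negative/CriticalBubbleBoundPointwise.lean`
(step inequality, pointwise finiteness) and `…/CriticalBubbleBoundSubharmonic.lean` (last-step
decomposition). -/

section Pointwise

/-! ### Surgery: closing an avoiding walk, splitting a walk through a site -/

/-- SAWs `0 → b` of `ℤ²` that avoid the site `a`. -/
def Avoiding (a b : Site 2) : Set (LatticeSAW 0 b) := {p | a ∉ p.1.support}

/-- Appending the edge `b → a` to a SAW `0 → b` avoiding `a` gives a SAW `0 → a`. [folklore] -/
def closeAt {a b : Site 2} (h : (zdGraph 2).Adj b a) (p : Avoiding a b) : LatticeSAW 0 a :=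
  ⟨p.1.1.concat h, p.1.2.concat p.2 h⟩

/-- The closed walk is one step longer. [folklore] -/
@[simp] theorem length_closeAt {a b : Site 2} (h : (zdGraph 2).Adj b a) (p : Avoiding a b) :
    (closeAt h p).1.length = p.1.1.length + 1 :=
  SimpleGraph.Walk.length_concat _ _

/-- Closing is injective. [folklore] -/
theorem closeAt_injective {a b : Site 2} (h : (zdGraph 2).Adj b a) : Injective (closeAt h) := by
  rintro ⟨⟨p, hp⟩, hpa⟩ ⟨⟨q, hq⟩, hqa⟩ hpq
  have h1 : p.concat h = q.concat h := congrArg (fun r : LatticeSAW 0 a => r.1) hpq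
  obtain ⟨_, h2⟩ := SimpleGraph.Walk.concat_inj h1
  simp only [SimpleGraph.Walk.copy_rfl_rfl] at h2
  subst h2
  rfl

/-- Splitting a SAW `0 → b` at its (unique) visit of `a`: a SAW `0 → a` and a SAW `a → b`. [folklore] -/
def splitAt {a b : Site 2} (p : {p : LatticeSAW 0 b // a ∈ p.1.support}) :
    LatticeSAW 0 a × LatticeSAW a b :=
  (⟨p.1.1.takeUntil a p.2, p.1.2.takeUntil p.2⟩, ⟨p.1.1.dropUntil a p.2, p.1.2.dropUntil p.2⟩)

/-- Splitting is injective (the two pieces concatenate back to the walk). [folklore] -/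
theorem splitAt_injective {a b : Site 2} :
    Injective (splitAt : {p : LatticeSAW 0 b // a ∈ p.1.support} → LatticeSAW 0 a × LatticeSAW a b) := by
  rintro ⟨⟨p, hp⟩, hpa⟩ ⟨⟨q, hq⟩, hqa⟩ hpq
  simp only [splitAt, Prod.mk.injEq, Subtype.mk.injEq] at hpq
  obtain ⟨h1, h2⟩ := hpq
  have : p = q := by
    rw [← p.take_spec hpa, ← q.take_spec hqa, h1, h2]
  subst this
  rfl

/-- The lengths of the two pieces add up. [folklore] -/
theorem length_splitAt {a b : Site 2} (p : {p : LatticeSAW 0 b // a ∈ p.1.support}) :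
    (splitAt p).1.1.length + (splitAt p).2.1.length = p.1.1.length := by
  simp only [splitAt]
  rw [← SimpleGraph.Walk.length_append, SimpleGraph.Walk.take_spec]

/-! ### The one-step inequality -/

/-- **One-step (Simon–Lieb-type) inequality.** For `a ∼ b` and `x > 0`:
`K_x(0,b) ≤ K_x(0,a) · (x⁻¹ + K_x(a,b))`. The SAWs `0 → b` avoiding `a` inject into SAWs
`0 → a` (append the edge `b → a`; weight `x^{|γ|} = x⁻¹ · x^{|γ|+1}`), those through `a` inject
into pairs (SAW `0 → a`, SAW `a → b`) (weight multiplicative). [folklore] -/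
theorem latticeKernel_step {x : ℝ} (hx : 0 < x) {a b : Site 2} (h : (zdGraph 2).Adj a b) :
    latticeKernel x 0 b ≤ latticeKernel x 0 a * (ENNReal.ofReal x⁻¹ + latticeKernel x a b) := by
  classical
  set f : LatticeSAW 0 b → ℝ≥0∞ := fun p => ENNReal.ofReal (x ^ p.1.length) with hf
  have hsplit : latticeKernel x 0 b =
      (∑' p : Avoiding a b, f p) + ∑' p : ((Avoiding a b)ᶜ : Set (LatticeSAW 0 b)), f p := by
    rw [latticeKernel, tsum_subtype (Avoiding a b) f, tsum_subtype (Avoiding a b)ᶜ f, ← ENNReal.tsum_add]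
    refine tsum_congr fun p => ?_
    exact (congrFun (Set.indicator_self_add_compl (Avoiding a b) f) p).symm
  -- walks avoiding `a`
  have h1 : ∑' p : Avoiding a b, f p ≤ ENNReal.ofReal x⁻¹ * latticeKernel x 0 a := by
    have key : ∀ p : Avoiding a b, f p = ENNReal.ofReal x⁻¹ *
        (fun q : LatticeSAW 0 a => ENNReal.ofReal (x ^ q.1.length)) (closeAt h.symm p) := by
      intro p
      simp only [hf, length_closeAt]
      rw [← ENNReal.ofReal_mul (inv_nonneg.2 hx.le), pow_succ]
      congr 1
      have hx' := hx.ne'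
      field_simp
    calc ∑' p : Avoiding a b, f p
        = ∑' p : Avoiding a b, ENNReal.ofReal x⁻¹ *
            (fun q : LatticeSAW 0 a => ENNReal.ofReal (x ^ q.1.length)) (closeAt h.symm p) :=
          tsum_congr key
      _ = ENNReal.ofReal x⁻¹ * ∑' p : Avoiding a b,
            (fun q : LatticeSAW 0 a => ENNReal.ofReal (x ^ q.1.length)) (closeAt h.symm p) :=
          ENNReal.tsum_mul_left
      _ ≤ ENNReal.ofReal x⁻¹ * latticeKernel x 0 a := by
          rw [latticeKernel]
          exact mul_le_mul' le_rfl (ENNReal.tsum_comp_le_tsum_of_injective (closeAt_injective h.symm) _)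
  -- walks through `a`
  have h2 : ∑' p : ((Avoiding a b)ᶜ : Set (LatticeSAW 0 b)), f p ≤
      latticeKernel x 0 a * latticeKernel x a b := by
    have hmem : ∀ p : ((Avoiding a b)ᶜ : Set (LatticeSAW 0 b)), a ∈ p.1.1.support := fun p => by
      have hp := p.2
      simp only [Set.mem_compl_iff, Avoiding, Set.mem_setOf_eq, not_not] at hp
      exact hp
    let S : ((Avoiding a b)ᶜ : Set (LatticeSAW 0 b)) → LatticeSAW 0 a × LatticeSAW a b := fun p =>
      splitAt ⟨p.1, hmem p⟩
    have hS : Injective S := by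
      intro p q hpq
      have h' := splitAt_injective hpq
      have h'' : (p : LatticeSAW 0 b) = q :=
        congrArg (fun r : {p : LatticeSAW 0 b // a ∈ p.1.support} => r.1) h'
      exact Subtype.ext h''
    have key : ∀ p : ((Avoiding a b)ᶜ : Set (LatticeSAW 0 b)), f p =
        (fun qr : LatticeSAW 0 a × LatticeSAW a b =>
          ENNReal.ofReal (x ^ qr.1.1.length) * ENNReal.ofReal (x ^ qr.2.1.length)) (S p) := by
      intro p
      simp only [hf, S]
      rw [← ENNReal.ofReal_mul (pow_nonneg hx.le _), ← pow_add, length_splitAt]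
    calc ∑' p : ((Avoiding a b)ᶜ : Set (LatticeSAW 0 b)), f p
        = ∑' p : ((Avoiding a b)ᶜ : Set (LatticeSAW 0 b)),
            (fun qr : LatticeSAW 0 a × LatticeSAW a b =>
              ENNReal.ofReal (x ^ qr.1.1.length) * ENNReal.ofReal (x ^ qr.2.1.length)) (S p) :=
          tsum_congr key
      _ ≤ ∑' qr : LatticeSAW 0 a × LatticeSAW a b,
            ENNReal.ofReal (x ^ qr.1.1.length) * ENNReal.ofReal (x ^ qr.2.1.length) :=
          ENNReal.tsum_comp_le_tsum_of_injective hS _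
      _ = ∑' (q : LatticeSAW 0 a) (r : LatticeSAW a b),
            ENNReal.ofReal (x ^ q.1.length) * ENNReal.ofReal (x ^ r.1.length) :=
          ENNReal.tsum_prod (f := fun (q : LatticeSAW 0 a) (r : LatticeSAW a b) =>
            ENNReal.ofReal (x ^ q.1.length) * ENNReal.ofReal (x ^ r.1.length))
      _ = latticeKernel x 0 a * latticeKernel x a b := by
          rw [latticeKernel, latticeKernel, ← ENNReal.tsum_mul_right]
          refine tsum_congr fun q => ?_
          rw [ENNReal.tsum_mul_left]
  calc latticeKernel x 0 b = _ := hsplit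
    _ ≤ ENNReal.ofReal x⁻¹ * latticeKernel x 0 a + latticeKernel x 0 a * latticeKernel x a b :=
        add_le_add h1 h2
    _ = latticeKernel x 0 a * (ENNReal.ofReal x⁻¹ + latticeKernel x a b) := by ring

/-! ### Symmetry bookkeeping at a general fugacity -/

/-- `a ∼ b` in `ℤ²` iff `0 ∼ b - a`. [folklore] -/
theorem adj_zero_sub_of_adj {a b : Site 2} (h : (zdGraph 2).Adj a b) : (zdGraph 2).Adj 0 (b - a) := by
  have := (zdGraph_adj_shift_iff (-a) a b).2 h
  simpa [sub_eq_add_neg] using this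

/-- All four nearest-neighbour kernels coincide at every fugacity:
`K_x(0,e) = K_x(0,e₀)` for every unit vector `e` (dihedral symmetry). [folklore] -/
theorem latticeKernel_unit_eq (x : ℝ) {e : Site 2} (he : (zdGraph 2).Adj 0 e) :
    latticeKernel x 0 e = latticeKernel x 0 e₀ := by
  have hneg : ∀ w : Site 2, latticeKernel x 0 (-w) = latticeKernel x 0 w := fun w => by
    have h := latticeKernel_map x negIso 0 w
    simp only [negIso] at h
    exact h
  have hswap : ∀ w : Site 2, latticeKernel x 0 (swapSite w) = latticeKernel x 0 w := fun w => by
    have h := latticeKernel_map x swapIso 0 w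
    have h0 : swapIso 0 = 0 := by funext j; fin_cases j <;> rfl
    rw [h0] at h
    exact h
  have he₁ : swapSite e₀ = Pi.single 1 1 := by
    funext j; fin_cases j <;> simp [swapSite, e₀]
  have he₀ : (Pi.single 0 1 : Site 2) = e₀ := by
    funext j; fin_cases j <;> simp [e₀]
  obtain ⟨i, hi | hi⟩ := (zdGraph_adj_iff _ _).1 he
  · rw [zero_add] at hi; subst hi
    fin_cases i
    · simp [he₀]
    · rw [Fin.mk_one, ← he₁, hswap]
  · have : e = -Pi.single i 1 := eq_neg_of_add_eq_zero_left hi.symm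
    subst this
    rw [hneg]
    fin_cases i
    · simp [he₀]
    · rw [Fin.mk_one, ← he₁, hswap]

/-- The nearest-neighbour kernel between ANY two neighbours is the one number `K_x(0,e₀)`. [folklore] -/
theorem latticeKernel_adj_eq (x : ℝ) {a b : Site 2} (h : (zdGraph 2).Adj a b) :
    latticeKernel x a b = latticeKernel x 0 e₀ := by
  rw [latticeKernel_eq_zero_sub, latticeKernel_unit_eq x (adj_zero_sub_of_adj h)]

/-- The diagonal value: `K_x(u,u) = 1` (only the trivial walk is self-avoiding). [folklore] -/
theorem latticeKernel_self (x : ℝ) (u : Site 2) : latticeKernel x u u = 1 := by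
  have hall : ∀ p : LatticeSAW u u, p = ⟨SimpleGraph.Walk.nil, SimpleGraph.Walk.IsPath.nil⟩ := fun p =>
    Subtype.ext (SimpleGraph.Walk.eq_nil_iff_nil.2 (SimpleGraph.Walk.isPath_iff_nil.1 p.2))
  rw [latticeKernel, tsum_eq_single (⟨SimpleGraph.Walk.nil, SimpleGraph.Walk.IsPath.nil⟩ : LatticeSAW u u)
    (fun p hp => absurd (hall p) hp)]
  simp

/-- The one-step inequality in its one-number, translated form:
`K_x(c,b) ≤ K_x(c,a) · (x⁻¹ + K_x(0,e₀))` for `a ∼ b` and any base point `c`. [folklore] -/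
theorem latticeKernel_step' {x : ℝ} (hx : 0 < x) (c : Site 2) {a b : Site 2} (h : (zdGraph 2).Adj a b) :
    latticeKernel x c b ≤ latticeKernel x c a * (ENNReal.ofReal x⁻¹ + latticeKernel x 0 e₀) := by
  have h' : (zdGraph 2).Adj (a - c) (b - c) := by
    simpa [sub_eq_add_neg] using (zdGraph_adj_shift_iff (-c) a b).2 h
  rw [latticeKernel_eq_zero_sub x c b, latticeKernel_eq_zero_sub x c a, ← latticeKernel_adj_eq x h']
  exact latticeKernel_step hx h'

/-! ### Iteration along lattice paths: an unconditional exponential bound -/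

/-- **Unconditional bound.** For every `x > 0`, all sites `b, c` and every lattice path `q` from `b`
to `c`: `K_x(c,b) ≤ (x⁻¹ + K_x(0,e₀))^{|q|}`. (If `K_x(0,e₀) = ∞` the bound is void; if it is
finite, the whole two-point function is pointwise finite.) [folklore] -/
theorem latticeKernel_le_pow {x : ℝ} (hx : 0 < x) {b c : Site 2} (q : (zdGraph 2).Walk b c) :
    latticeKernel x c b ≤ (ENNReal.ofReal x⁻¹ + latticeKernel x 0 e₀) ^ q.length := by
  induction q with
  | nil => rw [SimpleGraph.Walk.length_nil, pow_zero, latticeKernel_self]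
  | cons hadj q ih =>
    rw [SimpleGraph.Walk.length_cons, pow_succ]
    exact (latticeKernel_step' hx _ hadj.symm).trans (mul_le_mul' ih le_rfl)

/-- The same bound with the graph distance `dist(b,0) = ‖b‖₁` of `ℤ²`. [folklore] -/
theorem latticeKernel_le_pow_dist {x : ℝ} (hx : 0 < x) (b : Site 2) :
    latticeKernel x 0 b ≤ (ENNReal.ofReal x⁻¹ + latticeKernel x 0 e₀) ^ (zdGraph 2).dist b 0 := by
  obtain ⟨q, hq⟩ := ((zdGraph_preconnected_holds (d := 2)) b 0).exists_walk_length_eq_dist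
  rw [← hq]
  exact latticeKernel_le_pow hx q

/-- Pointwise finiteness propagates from the nearest neighbour to every site, at every fugacity. [folklore] -/
theorem latticeKernel_ne_top_of_unit {x : ℝ} (hx : 0 < x) (h : latticeKernel x 0 e₀ ≠ ⊤) (b : Site 2) :
    latticeKernel x 0 b ≠ ⊤ :=
  ne_top_of_le_ne_top
    (ENNReal.pow_ne_top (ENNReal.add_ne_top.2 ⟨ENNReal.ofReal_ne_top, h⟩))
    (latticeKernel_le_pow_dist hx b)

/-! ### The crux ⟺ pointwise finiteness of the whole critical two-point function -/

/-- **`CriticalBubbleBound ⟺ ∀ x ∈ ℤ², G_{x_c}(0,x) < ∞`.** [cite: MadrasSlade1993, §1.4] -/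
theorem criticalBubbleBound_iff_forall_latticeKernel_ne_top :
    CriticalBubbleBound ↔ ∀ b : Site 2, latticeKernel criticalFugacity 0 b ≠ ⊤ := by
  rw [criticalBubbleBound_iff_bubble_e₀_ne_top]
  exact ⟨fun h b => latticeKernel_ne_top_of_unit criticalFugacity_pos_lt_one'.1 h b, fun h => h e₀⟩

/-- … equivalently for ALL pairs of sites (translation invariance). [folklore] -/
theorem criticalBubbleBound_iff_forall_pairs_ne_top :
    CriticalBubbleBound ↔ ∀ u v : Site 2, latticeKernel criticalFugacity u v ≠ ⊤ := by
  rw [criticalBubbleBound_iff_forall_latticeKernel_ne_top]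
  refine ⟨fun h u v => ?_, fun h b => h 0 b⟩
  rw [latticeKernel_eq_zero_sub]; exact h _

/-- … and finiteness at ONE neighbour site already suffices (`∃`-form over the unit vectors;
all four nearest-neighbour kernels coincide, `latticeKernel_unit_eq`). [folklore] -/
theorem criticalBubbleBound_iff_exists_unit_ne_top :
    CriticalBubbleBound ↔ ∃ e : Site 2, (zdGraph 2).Adj 0 e ∧ latticeKernel criticalFugacity 0 e ≠ ⊤ := by
  constructor
  · intro h
    exact ⟨e₀, adj_zero_e₀, criticalBubbleBound_iff_bubble_e₀_ne_top.1 h⟩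
  · rintro ⟨e, he, h⟩
    rw [latticeKernel_unit_eq criticalFugacity he] at h
    exact criticalBubbleBound_iff_bubble_e₀_ne_top.2 h

/-- **Barrier-catalogue form**: the crux is verbatim "`G_{z_c}(x) < ∞` for every `x ∈ ℤ²`"
(Madras–Slade's open problem for `d = 2`, stated for all `x`). [cite: MadrasSlade1993, §1.4] -/
theorem criticalBubbleBound_iff_forall_twoPointENN_lt_top' :
    CriticalBubbleBound ↔ ∀ x : Site 2, twoPointENN 2 (Zd.criticalPoint 2) x < ⊤ := by
  rw [criticalBubbleBound_iff_forall_latticeKernel_ne_top]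
  refine forall_congr' fun b => ?_
  rw [← bubble_eq_twoPointENN, bubble, lt_top_iff_ne_top]

/-- **Quantitative form at `x_c`.** `G_{x_c}(0,b) ≤ (x_c⁻¹ + G_{x_c}(0,e₀))^{‖b‖₁}` for every
`b ∈ ℤ²` — so any admissible crux constant `C` also bounds the whole critical two-point function,
by `(x_c⁻¹ + C)^{‖b‖₁}` (a bound growing exponentially in `‖b‖₁`, against the conjectured DECAY
`|b|^{-5/24}`; nothing better follows from the crux alone by this surgery). [folklore] -/
theorem bubble_le_pow_dist (b : Site 2) :
    latticeKernel criticalFugacity 0 b ≤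
      (ENNReal.ofReal criticalFugacity⁻¹ + bubble e₀) ^ (zdGraph 2).dist b 0 :=
  latticeKernel_le_pow_dist criticalFugacity_pos_lt_one'.1 b


/-- **Disproof side.** `¬ CriticalBubbleBound ⟺ G_{x_c}(0,b) = ∞ for SOME site `b`
`⟺ G_{x_c}(0,e) = ∞` for EVERY unit vector `e`: a refutation may be mounted at any fixed site,
and it always lands on the nearest-neighbour number. [folklore] -/
theorem not_criticalBubbleBound_iff_exists_latticeKernel_eq_top :
    ¬ CriticalBubbleBound ↔ ∃ b : Site 2, latticeKernel criticalFugacity 0 b = ⊤ := by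
  rw [criticalBubbleBound_iff_forall_latticeKernel_ne_top]
  push Not
  rfl

theorem not_criticalBubbleBound_iff_forall_unit_eq_top :
    ¬ CriticalBubbleBound ↔ ∀ e : Site 2, (zdGraph 2).Adj 0 e → latticeKernel criticalFugacity 0 e = ⊤ := by
  rw [criticalBubbleBound_iff_exists_unit_ne_top]
  push Not
  rfl


/-! ### Last-step decomposition: discrete subharmonicity of the kernel -/

/-- SAWs `0 → b` whose penultimate vertex is `b'`. -/
def LastFrom (b' b : Site 2) : Set (LatticeSAW 0 b) := {p | p.1.penultimate = b'}

/-- Dropping the last edge of a SAW `0 → b` with penultimate vertex `b'`: a SAW `0 → b'`. [folklore] -/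
def dropLastTo {b' b : Site 2} (p : LastFrom b' b) : LatticeSAW 0 b' :=
  ⟨p.1.1.dropLast.copy rfl p.2, by simpa using p.1.2.dropLast⟩

theorem length_dropLastTo {b' b : Site 2} (p : LastFrom b' b) :
    (dropLastTo p).1.length = p.1.1.length - 1 := by
  simp [dropLastTo, SimpleGraph.Walk.length_dropLast]

theorem dropLastTo_injective {b' b : Site 2} (hb : b ≠ 0) : Injective (dropLastTo (b' := b') (b := b)) := by
  rintro ⟨⟨p, hp⟩, hpb⟩ ⟨⟨q, hq⟩, hqb⟩ hpq
  have hs : (p.dropLast.copy rfl hpb).support = (q.dropLast.copy rfl hqb).support :=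
    congrArg (fun r : LatticeSAW 0 b' => r.1.support) hpq
  simp only [SimpleGraph.Walk.support_copy] at hs
  have hpn : ¬ p.Nil := fun h => hb h.eq.symm
  have hqn : ¬ q.Nil := fun h => hb h.eq.symm
  have hp' := SimpleGraph.Walk.concat_dropLast (SimpleGraph.Walk.adj_penultimate hpn)
  have hq' := SimpleGraph.Walk.concat_dropLast (SimpleGraph.Walk.adj_penultimate hqn)
  have : p.support = q.support := by
    rw [← hp', ← hq', SimpleGraph.Walk.support_concat, SimpleGraph.Walk.support_concat, hs]
  have hpq' : p = q := SimpleGraph.Walk.support_injective this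
  subst hpq'
  rfl

/-- **Discrete subharmonicity.** For `b ≠ 0` and `x ≥ 0`:
`K_x(0,b) ≤ x · Σ_{b' ∼ b} K_x(0,b')` (drop the last step). [folklore] -/
theorem latticeKernel_subharmonic {x : ℝ} (hx : 0 ≤ x) {b : Site 2} (hb : b ≠ 0) :
    latticeKernel x 0 b ≤ ENNReal.ofReal x * ∑ b' ∈ (zdGraph 2).neighborFinset b, latticeKernel x 0 b' := by
  classical
  set f : LatticeSAW 0 b → ℝ≥0∞ := fun p => ENNReal.ofReal (x ^ p.1.length) with hf
  -- every SAW `0 → b` has its penultimate vertex among the neighbours of `b`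
  have hpt : ∀ p : LatticeSAW 0 b, f p ≤
      ∑ b' ∈ (zdGraph 2).neighborFinset b, (LastFrom b' b).indicator f p := by
    intro p
    have hpn : ¬ p.1.Nil := fun h => hb h.eq.symm
    have hmem : p.1.penultimate ∈ (zdGraph 2).neighborFinset b :=
      (SimpleGraph.mem_neighborFinset _ _ _).2 (SimpleGraph.Walk.adj_penultimate hpn).symm
    refine le_trans ?_ (Finset.single_le_sum (f := fun b' => (LastFrom b' b).indicator f p)
      (fun _ _ => zero_le) hmem)
    rw [Set.indicator_of_mem (show p ∈ LastFrom p.1.penultimate b from rfl)]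
  -- each class injects into the SAWs `0 → b'`, losing one step
  have hcls : ∀ b' : Site 2, ∑' p : LatticeSAW 0 b, (LastFrom b' b).indicator f p ≤
      ENNReal.ofReal x * latticeKernel x 0 b' := by
    intro b'
    rw [← tsum_subtype (LastFrom b' b) f]
    have key : ∀ p : LastFrom b' b, f p = ENNReal.ofReal x *
        (fun q : LatticeSAW 0 b' => ENNReal.ofReal (x ^ q.1.length)) (dropLastTo p) := by
      intro p
      have hpn : ¬ p.1.1.Nil := fun h => hb h.eq.symm
      have hlen : 0 < p.1.1.length := SimpleGraph.Walk.not_nil_iff_lt_length.1 hpn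
      simp only [hf, length_dropLastTo]
      rw [← ENNReal.ofReal_mul hx, ← pow_succ', Nat.sub_add_cancel hlen]
    calc ∑' p : LastFrom b' b, f p
        = ∑' p : LastFrom b' b, ENNReal.ofReal x *
            (fun q : LatticeSAW 0 b' => ENNReal.ofReal (x ^ q.1.length)) (dropLastTo p) := tsum_congr key
      _ = ENNReal.ofReal x * ∑' p : LastFrom b' b,
            (fun q : LatticeSAW 0 b' => ENNReal.ofReal (x ^ q.1.length)) (dropLastTo p) := ENNReal.tsum_mul_left
      _ ≤ ENNReal.ofReal x * latticeKernel x 0 b' := by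
          rw [latticeKernel]
          exact mul_le_mul' le_rfl (ENNReal.tsum_comp_le_tsum_of_injective (dropLastTo_injective hb) _)
  calc latticeKernel x 0 b = ∑' p, f p := rfl
    _ ≤ ∑' p, ∑ b' ∈ (zdGraph 2).neighborFinset b, (LastFrom b' b).indicator f p := ENNReal.tsum_le_tsum hpt
    _ = ∑' p, ∑' b' : ((zdGraph 2).neighborFinset b : Finset (Site 2)), (LastFrom b' b).indicator f p := by
        refine tsum_congr fun p => ?_
        rw [Finset.tsum_subtype ((zdGraph 2).neighborFinset b) (fun b' => (LastFrom b' b).indicator f p)]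
    _ = ∑' b' : ((zdGraph 2).neighborFinset b : Finset (Site 2)), ∑' p, (LastFrom b' b).indicator f p :=
        ENNReal.tsum_comm
    _ ≤ ∑' b' : ((zdGraph 2).neighborFinset b : Finset (Site 2)), ENNReal.ofReal x * latticeKernel x 0 b' :=
        ENNReal.tsum_le_tsum fun b' => hcls b'
    _ = ∑ b' ∈ (zdGraph 2).neighborFinset b, ENNReal.ofReal x * latticeKernel x 0 b' :=
        Finset.tsum_subtype ((zdGraph 2).neighborFinset b) (fun b' => ENNReal.ofReal x * latticeKernel x 0 b')
    _ = ENNReal.ofReal x * ∑ b' ∈ (zdGraph 2).neighborFinset b, latticeKernel x 0 b' := by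
        rw [Finset.mul_sum]

/-- **No isolated infinities.** If `K_x(0,b) = ∞` at some `b ≠ 0` then `K_x(0,b') = ∞` at a
neighbour `b'` of `b`. [folklore] -/
theorem exists_adj_latticeKernel_eq_top {x : ℝ} (hx : 0 ≤ x) {b : Site 2} (hb : b ≠ 0)
    (h : latticeKernel x 0 b = ⊤) : ∃ b' : Site 2, (zdGraph 2).Adj b b' ∧ latticeKernel x 0 b' = ⊤ := by
  by_contra hne
  push Not at hne
  have hfin : ∑ b' ∈ (zdGraph 2).neighborFinset b, latticeKernel x 0 b' ≠ ⊤ :=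
    ENNReal.sum_ne_top.2 fun b' hb' => hne b' ((SimpleGraph.mem_neighborFinset _ _ _).1 hb')
  have := latticeKernel_subharmonic hx hb
  rw [h, top_le_iff] at this
  exact ENNReal.mul_ne_top ENNReal.ofReal_ne_top hfin this

end Pointwise

/-! ## §24 (gen 5) `-- Targets`: the picked line `docking-census-joining` — the three analytic
hypotheses of S4 `stub_ledgerBootstrap` are LOAD-BEARING (drefute's paper mutations, kernel-checked)

The lead picked `Lines/docking-census-joining.lean` (PICKED.md): stubs S1 `stub_dockingInjection`
(exact combinatorics, TRUE — drefute verified the flip map on all `n ≤ 15`), S2 `stub_dockingEntropy`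
(`DockingEntropy (5/8)`, OPEN, constructive, margin 3/16 to the Coulomb-gas `κ' = 13/16`), S3
`stub_pinchRarity` (`PinchRarity (1/2)`, OPEN, HARDEST, restrictive, margin 3/16 to `π' = 11/16`;
no lever beyond Hammond's `π = 0` for GLOBAL joins is in print), S4 `stub_ledgerBootstrap` (pure real
analysis, TRUE). S2/S3 are `∃ c ∃ i₀ ∀ i ≥ i₀` / `∃ C b ∀ i` statements about `ℤ²` at `x_c` with
conjectural slack on the right side: NOT refutable by finite models, and a numerical test in the
stubs' own normalisation is drefute's kit job j008737 (fixed-endpoint pivot MC, `N ≤ 2897`; still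
QUEUED at this boundary — its summary attaches to the item when it runs; S3 is in danger only if the
measured slope of `log E[#graded pinches]` is `> -1/2`, S2 only if the docking slope is `< -3/8`).
What IS checkable now is S4's hypothesis set: `LedgerBootstrap side apriori floor` is the stub with
its side condition on `κ`, its a-priori bound and its floor as parameters
(`ledgerBootstrap_stub_iff : LedgerBootstrap (0 ≤ ·) HWApriori (-3/2) ↔ <stub verbatim>` by `Iff.rfl`), and
* `not_ledgerBootstrap_without_kappa_nonneg` — FALSE without `0 ≤ κ` (`κ = -2, π = 5`, spike
  sequence with `R_i = 2^{-i/2}`, `D = U = 2^{-4i}`, `s = -3/2`);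
* `not_ledgerBootstrap_without_apriori` — FALSE without `t_n ≤ e^{K√n}` (`κ = 0, π = 1`,
  `R_i = 2^{2^i}`, `D_i = U_i = 2^{-i}R_i² = 2^{-i}R_{i+1}`, `s = 1`): the sub-exponential
  Hammersley–Welsh input (§16 `hw_term_upper_bound`) is used essentially — the same construction
  with `R_i = a^{2^i}` defeats every merely exponential a-priori bound `t_n ≤ aⁿ` (`a > 1`), in
  particular the trivial `c_n ≤ 3ⁿ` (`t_n ≤ (3x_c)ⁿ ≈ 1.14ⁿ`);
* `not_ledgerBootstrap_floor_lowered` — the floor `-3/2 ≤ s` is SHARP (FALSE with floor `-3/2 - ε`,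
  any `ε > 0`: `κ = 0, π = 10`, `R_i = 2^{-3i/2}`, `D = U = 2^{-4i}`, rarity through the tail alone).
So any landing of S4 must keep all three; the composition `CriticalBubbleBound_of` uses
`(κ,π,s) = (5/8,1/2,-1/16)`, inside the true range. CALIBRATION of S2+S3 against §25: through S1
and S4, `DockingEntropy κ ∧ PinchRarity π` gives `R_i ≲ 2^{si}` for every `s > 1-(κ+π)`, i.e.
`Σ_N N^{κ+π-1-ε} · N q_N x_c^N < ∞` — with the conjectured `θ = 5/2` this is consistent iff
`κ + π ≤ 3/2` (the ledger identity `θ - 1 = κ' + π'` saturates at the Coulomb-gas values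
`13/16 + 11/16`); the filed `5/8 + 1/2 = 9/8` is safely inside, but any future strengthening of the
two stubs with `κ + π > 3/2` would prove `M_{3/2+} < ∞`, conjecturally FALSE — the stubs cannot both
have much more slack than filed. Landed copy:
`Theorems/CriticalBubbleBound/Negative/CriticalBubbleBoundLedgerBootstrapMutations.lean`. -/

section Targets

/-- The Hammersley–Welsh-type a-priori bound of the stub: `t_n ≤ e^{K √n}`. -/
def HWApriori (t : ℕ → ℝ) : Prop := ∃ K : ℝ, ∀ n : ℕ, t n ≤ Real.exp (K * Real.sqrt n)

/-- The ledger bootstrap with the side condition on `κ`, the a-priori bound on `t` and the floor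
for `s` as parameters (block sums written inline, exactly as in the stub). -/
def LedgerBootstrap (side : ℝ → Prop) (apriori : (ℕ → ℝ) → Prop) (floor : ℝ) : Prop :=
  ∀ (κ π : ℝ), side κ →
  ∀ (t D U : ℕ → ℝ), (∀ n : ℕ, 0 ≤ t n) → apriori t →
    (∃ K₁ : ℝ, 0 < K₁ ∧ ∀ i : ℕ, D i ≤ K₁ * U i) →
    (∃ c : ℝ, 0 < c ∧ ∃ i₀ : ℕ, ∀ i : ℕ, i₀ ≤ i →
        c * (2 : ℝ) ^ ((κ - 1) * (i : ℝ)) * (∑ n ∈ Finset.Ico (2 ^ i) (2 ^ (i + 1)), t n) ^ 2 ≤ D i) →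
    (∃ C b : ℝ, ∀ i : ℕ,
        U i ≤ C * ((i : ℝ) + 1) ^ b * (2 : ℝ) ^ (-π * (i : ℝ)) *
            (∑ n ∈ Finset.Ico (2 ^ (i + 1)) (2 ^ (i + 1 + 1)), t n)
          + C * (2 : ℝ) ^ (-(4 : ℝ) * (i : ℝ))) →
    ∀ s : ℝ, 1 - (κ + π) < s → floor ≤ s →
      ∃ C' : ℝ, ∀ i : ℕ, (∑ n ∈ Finset.Ico (2 ^ i) (2 ^ (i + 1)), t n) ≤ C' * (2 : ℝ) ^ (s * (i : ℝ))

/-- READ-BACK: with side condition `0 ≤ κ`, the Hammersley–Welsh a-priori bound and floor `-3/2`,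
`LedgerBootstrap` is the statement of `stub_ledgerBootstrap` verbatim. [folklore] -/
theorem ledgerBootstrap_stub_iff :
    LedgerBootstrap (fun κ => 0 ≤ κ) HWApriori (-(3 : ℝ) / 2) ↔
    ∀ (κ π : ℝ), 0 ≤ κ →
    ∀ (t D U : ℕ → ℝ), (∀ n : ℕ, 0 ≤ t n) →
      (∃ K : ℝ, ∀ n : ℕ, t n ≤ Real.exp (K * Real.sqrt n)) →
      (∃ K₁ : ℝ, 0 < K₁ ∧ ∀ i : ℕ, D i ≤ K₁ * U i) →
      (∃ c : ℝ, 0 < c ∧ ∃ i₀ : ℕ, ∀ i : ℕ, i₀ ≤ i →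
          c * (2 : ℝ) ^ ((κ - 1) * (i : ℝ)) * (∑ n ∈ Finset.Ico (2 ^ i) (2 ^ (i + 1)), t n) ^ 2 ≤ D i) →
      (∃ C b : ℝ, ∀ i : ℕ,
          U i ≤ C * ((i : ℝ) + 1) ^ b * (2 : ℝ) ^ (-π * (i : ℝ)) *
              (∑ n ∈ Finset.Ico (2 ^ (i + 1)) (2 ^ (i + 1 + 1)), t n)
            + C * (2 : ℝ) ^ (-(4 : ℝ) * (i : ℝ))) →
      ∀ s : ℝ, 1 - (κ + π) < s → -(3 : ℝ) / 2 ≤ s →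
        ∃ C' : ℝ, ∀ i : ℕ, (∑ n ∈ Finset.Ico (2 ^ i) (2 ^ (i + 1)), t n) ≤ C' * (2 : ℝ) ^ (s * (i : ℝ)) :=
  Iff.rfl

/-! ### Spike sequences: one term per dyadic block -/

/-- The sequence carrying the value `g i` at `n = 2^i` and `0` elsewhere. -/
def spike (g : ℕ → ℝ) (n : ℕ) : ℝ := if n = 2 ^ Nat.log 2 n then g (Nat.log 2 n) else 0

theorem spike_pow (g : ℕ → ℝ) (i : ℕ) : spike g (2 ^ i) = g i := by
  simp [spike, Nat.log_pow Nat.one_lt_two]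

theorem spike_nonneg {g : ℕ → ℝ} (hg : ∀ i, 0 ≤ g i) (n : ℕ) : 0 ≤ spike g n := by
  unfold spike; split_ifs <;> simp [hg]

theorem spike_le {g : ℕ → ℝ} {M : ℝ} (hM : 0 ≤ M) (hg : ∀ i, g i ≤ M) (n : ℕ) : spike g n ≤ M := by
  unfold spike; split_ifs <;> simp [hg, hM]

/-- The dyadic block sum of a spike sequence is its spike value. [folklore] -/
theorem sum_block_spike (g : ℕ → ℝ) (i : ℕ) :
    ∑ n ∈ Finset.Ico (2 ^ i) (2 ^ (i + 1)), spike g n = g i := by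
  rw [Finset.sum_eq_single_of_mem (2 ^ i) (by simp [Nat.pow_lt_pow_right]) ?_, spike_pow]
  intro n hn hne
  rw [Finset.mem_Ico] at hn
  have hlog : Nat.log 2 n = i := Nat.log_eq_of_pow_le_of_lt_pow hn.1 hn.2
  simp [spike, hlog, hne]

/-- A spike sequence bounded by `1` satisfies the a-priori bound with `K = 0`. [folklore] -/
theorem hwApriori_spike {g : ℕ → ℝ} (hg : ∀ i, g i ≤ 1) : HWApriori (spike g) :=
  ⟨0, fun n => by simpa using spike_le zero_le_one hg n⟩

/-! ### Exponent algebra and the unboundedness of `2^{r i}` -/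

theorem two_rpow_mul_sq (a b : ℝ) (i : ℕ) :
    (2 : ℝ) ^ (a * i) * ((2 : ℝ) ^ (b * i)) ^ 2 = 2 ^ ((a + 2 * b) * i) := by
  rw [← Real.rpow_natCast _ 2, ← Real.rpow_mul two_pos.le, ← Real.rpow_add two_pos]
  congr 1; push_cast; ring

theorem two_rpow_sub_mul (a r : ℝ) (i : ℕ) :
    (2 : ℝ) ^ ((a - r) * i) = 2 ^ (a * i) * (2 ^ (r * i))⁻¹ := by
  rw [← Real.rpow_neg two_pos.le, ← Real.rpow_add two_pos]
  congr 1; ring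

theorem two_rpow_nonpos_le_one {a : ℝ} (ha : a ≤ 0) (i : ℕ) : (2 : ℝ) ^ (a * i) ≤ 1 :=
  Real.rpow_le_one_of_one_le_of_nonpos one_le_two (mul_nonpos_of_nonpos_of_nonneg ha (Nat.cast_nonneg i))

/-- `2^{r i}` is unbounded in `i` for `r > 0`. [folklore] -/
theorem exists_lt_two_rpow {r : ℝ} (hr : 0 < r) (C : ℝ) : ∃ i : ℕ, C < (2 : ℝ) ^ (r * i) := by
  obtain ⟨n, hn⟩ := exists_nat_gt C
  refine ⟨n * ⌈r⁻¹⌉₊, hn.trans_le ?_⟩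
  have h2n : (n : ℝ) ≤ (2 : ℝ) ^ (n : ℝ) := by
    rw [Real.rpow_natCast]; exact_mod_cast (Nat.lt_two_pow_self).le
  refine h2n.trans (Real.rpow_le_rpow_of_exponent_le one_le_two ?_)
  have hk : 1 ≤ r * ⌈r⁻¹⌉₊ := by
    calc (1 : ℝ) = r * r⁻¹ := (mul_inv_cancel₀ hr.ne').symm
      _ ≤ r * ⌈r⁻¹⌉₊ := mul_le_mul_of_nonneg_left (Nat.le_ceil _) hr.le
  calc (n : ℝ) = n * 1 := (mul_one _).symm
    _ ≤ n * (r * ⌈r⁻¹⌉₊) := mul_le_mul_of_nonneg_left hk (Nat.cast_nonneg n)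
    _ = r * ((n * ⌈r⁻¹⌉₊ : ℕ) : ℝ) := by push_cast; ring

/-- The common endgame of the three mutations: `2^{a i} ≤ C' 2^{(a-r) i}` for all `i` is absurd
when `r > 0`. [folklore] -/
theorem false_of_rpow_le {a r C' : ℝ} (hr : 0 < r)
    (h : ∀ i : ℕ, (2 : ℝ) ^ (a * i) ≤ C' * (2 : ℝ) ^ ((a - r) * i)) : False := by
  have hb : ∀ i : ℕ, (2 : ℝ) ^ (r * i) ≤ C' := by
    intro i
    have hi := h i
    rw [two_rpow_sub_mul] at hi
    have hP := Real.rpow_pos_of_pos two_pos (a * i)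
    have hQ := Real.rpow_pos_of_pos two_pos (r * i)
    -- `2^{a i} ≤ C' 2^{a i} / 2^{r i}` ⟹ `2^{r i} ≤ C'`
    have : (2 : ℝ) ^ (a * i) * (2 : ℝ) ^ (r * i) ≤ (2 : ℝ) ^ (a * i) * C' := by
      calc (2 : ℝ) ^ (a * i) * (2 : ℝ) ^ (r * i)
          ≤ C' * ((2 : ℝ) ^ (a * i) * ((2 : ℝ) ^ (r * i))⁻¹) * (2 : ℝ) ^ (r * i) :=
            mul_le_mul_of_nonneg_right hi hQ.le
        _ = (2 : ℝ) ^ (a * i) * C' := by field_simp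
    exact le_of_mul_le_mul_left this hP
  obtain ⟨i, hi⟩ := exists_lt_two_rpow hr C'
  exact (lt_irrefl _) ((hb i).trans_lt hi)

/-! ### Mutation 1: the side condition `0 ≤ κ` is load-bearing -/

/-- **WITHOUT `0 ≤ κ` the ledger bootstrap is FALSE** (`κ = -2, π = 5`, `R_i = 2^{-i/2}`,
`D = U = 2^{-4i}`, `s = -3/2`). [folklore] -/
theorem not_ledgerBootstrap_without_kappa_nonneg :
    ¬ LedgerBootstrap (fun _ => True) HWApriori (-(3 : ℝ) / 2) := by
  intro H
  set g : ℕ → ℝ := fun i => (2 : ℝ) ^ ((-(1 : ℝ) / 2) * i) with hg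
  set D : ℕ → ℝ := fun i => (2 : ℝ) ^ ((-(4 : ℝ)) * i) with hD
  have hg1 : ∀ i, g i ≤ 1 := fun i => two_rpow_nonpos_le_one (by norm_num) i
  have hR : ∀ i, ∑ n ∈ Finset.Ico (2 ^ i) (2 ^ (i + 1)), spike g n = g i := sum_block_spike g
  obtain ⟨C', hC'⟩ := H (-2) 5 trivial (spike g) D D (spike_nonneg fun i => (Real.rpow_pos_of_pos two_pos _).le)
    (hwApriori_spike hg1) ⟨1, one_pos, fun i => by rw [one_mul]⟩
    ⟨1, one_pos, 0, fun i _ => by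
      rw [hR, one_mul, hg, hD, two_rpow_mul_sq]; norm_num⟩
    ⟨1, 0, fun i => by
      rw [hR]
      have h0 : 0 ≤ 1 * ((i : ℝ) + 1) ^ (0 : ℝ) * (2 : ℝ) ^ (-(5 : ℝ) * i) * g (i + 1) := by
        simp only [Real.rpow_zero, mul_one, one_mul]; exact mul_nonneg (Real.rpow_pos_of_pos two_pos _).le (Real.rpow_pos_of_pos two_pos _).le
      linarith⟩
    (-(3 : ℝ) / 2) (by norm_num) le_rfl
  refine false_of_rpow_le (a := -(1 : ℝ) / 2) (r := 1) (C' := C') one_pos fun i => ?_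
  have := hC' i
  rw [hR, hg] at this
  convert this using 3; norm_num

/-! ### Mutation 2: the a-priori bound is load-bearing -/

/-- **WITHOUT the a-priori bound `t_n ≤ e^{K√n}` the ledger bootstrap is FALSE** (`κ = 0, π = 1`,
`R_i = 2^{2^i}`, `D_i = U_i = 2^{-i} R_i² = 2^{-i} R_{i+1}`, `s = 1`). [folklore] -/
theorem not_ledgerBootstrap_without_apriori :
    ¬ LedgerBootstrap (fun κ => 0 ≤ κ) (fun _ => True) (-(3 : ℝ) / 2) := by
  intro H
  set g : ℕ → ℝ := fun i => (2 : ℝ) ^ (2 ^ i) with hg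
  set D : ℕ → ℝ := fun i => 1 * (2 : ℝ) ^ (((0 : ℝ) - 1) * i) * (g i) ^ 2 with hD
  have hgsq : ∀ i, (g i) ^ 2 = g (i + 1) := fun i => by
    rw [hg]; simp only; rw [← pow_mul, ← pow_succ]
  have hR : ∀ i, ∑ n ∈ Finset.Ico (2 ^ i) (2 ^ (i + 1)), spike g n = g i := sum_block_spike g
  obtain ⟨C', hC'⟩ := H 0 1 le_rfl (spike g) D D (spike_nonneg fun i => by positivity) trivial
    ⟨1, one_pos, fun i => by rw [one_mul]⟩
    ⟨1, one_pos, 0, fun i _ => by rw [hR]⟩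
    ⟨1, 0, fun i => by
      rw [hR, hD]; simp only
      rw [hgsq, Real.rpow_zero]
      have : 0 ≤ (1 : ℝ) * (2 : ℝ) ^ (-(4 : ℝ) * i) := by positivity
      have e : ((0 : ℝ) - 1) * i = -(1 : ℝ) * i := by ring
      rw [e]; linarith⟩
    1 (by norm_num) (by norm_num)
  -- `2^{2^i} ≤ C' 2^i` for all `i` is absurd
  have hb : ∀ i : ℕ, (2 : ℝ) ^ i ≤ C' := by
    intro i
    have hi := hC' i
    rw [hR, hg, one_mul, Real.rpow_natCast] at hi
    have h2i : 2 * i ≤ 2 ^ i := by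
      rcases i with _ | j
      · simp
      · rw [pow_succ']; exact Nat.mul_le_mul_left 2 (Nat.succ_le_of_lt Nat.lt_two_pow_self)
    have h4 : (2 : ℝ) ^ i * (2 : ℝ) ^ i ≤ (2 : ℝ) ^ (2 ^ i) := by
      rw [← pow_add, ← two_mul]; exact pow_le_pow_right₀ one_le_two h2i
    exact le_of_mul_le_mul_right (h4.trans hi) (by positivity)
  obtain ⟨n, hn⟩ := exists_nat_gt C'
  have : (n : ℝ) < (2 : ℝ) ^ n := by exact_mod_cast Nat.lt_two_pow_self
  exact (lt_irrefl _) ((hn.trans this).trans_le (hb n))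

/-! ### Mutation 3: the floor `-3/2 ≤ s` is sharp -/

/-- **The floor `-3/2` cannot be lowered**: with floor `-3/2 - ε` (`ε > 0`) the ledger bootstrap is
FALSE (`κ = 0, π = 10`, `R_i = 2^{-3i/2}`, `D = U = 2^{-4i}`, `s = -3/2 - min(ε,1)/2`). [folklore] -/
theorem not_ledgerBootstrap_floor_lowered {ε : ℝ} (hε : 0 < ε) :
    ¬ LedgerBootstrap (fun κ => 0 ≤ κ) HWApriori (-(3 : ℝ) / 2 - ε) := by
  intro H
  set δ : ℝ := min ε 1 / 2 with hδ
  have hδpos : 0 < δ := by rw [hδ]; positivity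
  have hδε : δ ≤ ε := by
    rw [hδ]; linarith [min_le_left ε 1, le_min hε.le zero_le_one]
  have hδ1 : δ ≤ 1 / 2 := by rw [hδ]; linarith [min_le_right ε 1]
  set g : ℕ → ℝ := fun i => (2 : ℝ) ^ ((-(3 : ℝ) / 2) * i) with hg
  set D : ℕ → ℝ := fun i => 1 * (2 : ℝ) ^ (((0 : ℝ) - 1) * i) * (g i) ^ 2 with hD
  have hg1 : ∀ i, g i ≤ 1 := fun i => two_rpow_nonpos_le_one (by norm_num) i
  have hD4 : ∀ i, D i = (2 : ℝ) ^ (-(4 : ℝ) * i) := fun i => by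
    rw [hD, hg]; simp only; rw [one_mul, two_rpow_mul_sq]; norm_num
  have hR : ∀ i, ∑ n ∈ Finset.Ico (2 ^ i) (2 ^ (i + 1)), spike g n = g i := sum_block_spike g
  obtain ⟨C', hC'⟩ := H 0 10 le_rfl (spike g) D D (spike_nonneg fun i => (Real.rpow_pos_of_pos two_pos _).le)
    (hwApriori_spike hg1) ⟨1, one_pos, fun i => by rw [one_mul]⟩
    ⟨1, one_pos, 0, fun i _ => by rw [hR]⟩
    ⟨1, 0, fun i => by
      rw [hR, hD4]
      have h0 : 0 ≤ 1 * ((i : ℝ) + 1) ^ (0 : ℝ) * (2 : ℝ) ^ (-(10 : ℝ) * i) * g (i + 1) := by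
        simp only [Real.rpow_zero, mul_one, one_mul]; exact mul_nonneg (Real.rpow_pos_of_pos two_pos _).le (Real.rpow_pos_of_pos two_pos _).le
      linarith⟩
    (-(3 : ℝ) / 2 - δ) (by linarith) (by linarith)
  refine false_of_rpow_le (a := -(3 : ℝ) / 2) (r := δ) (C' := C') hδpos fun i => ?_
  have := hC' i
  rwa [hR, hg] at this

/-- Summary: the three analytic inputs of `stub_ledgerBootstrap` are each load-bearing. [folklore] -/
theorem ledgerBootstrap_loadBearing :
    (¬ LedgerBootstrap (fun _ => True) HWApriori (-(3 : ℝ) / 2)) ∧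
    (¬ LedgerBootstrap (fun κ => 0 ≤ κ) (fun _ => True) (-(3 : ℝ) / 2)) ∧
    (∀ ε : ℝ, 0 < ε → ¬ LedgerBootstrap (fun κ => 0 ≤ κ) HWApriori (-(3 : ℝ) / 2 - ε)) :=
  ⟨not_ledgerBootstrap_without_kappa_nonneg, not_ledgerBootstrap_without_apriori,
    fun _ hε => not_ledgerBootstrap_floor_lowered hε⟩


end Targets

/-! ## §25 (gen 5) The MOMENT LADDER `M_k := Σ_N N^k q_N x_c^N`: the crux is the rung `k = 1`,
conjecturally the LAST finite one

`M_0 = 𝒫` (unrooted mass, §21, "θ > 1"), `M_1 = T` (rooted mass = the crux, §18, "θ > 2"),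
`M_2` = `Σ_N N² q_N x_c^N` ("θ > 3"; up to the identity `2N q_N = Σ_{e∼0} c_{N-1}(0,e)` this is
`Σ_n n c_n(0,e) x_c^n = x_c (d/dx) K_x(0,e)|_{x_c⁻}`, the MEAN PERIMETER of the critical rooted
polygon / the derivative of the nearest-neighbour kernel). The ladder is monotone
(`momentSeries_mono`), so `M_k < ∞` for any `k ≥ 1` implies the crux
(`criticalBubbleBound_of_momentSeries_ne_top`) and the crux implies `M_0 < ∞`. CALIBRATION (for
provers): with the conjectured `q_N x_c^N ≍ N^{-5/2}` the rungs `k = 0, 1` are finite and EVERY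
rung `k ≥ 2` is infinite (`Σ N^{k-5/2}`), so `CriticalBubbleBound` is conjecturally the last
finite moment: a proof must not pass through any estimate that would also bound `M_2` — in the
language of §9d, `ClosingBound ε` (`c_n(0,e) x_c^n ≤ K (n+1)^{-1-ε}`) is conjecturally TRUE iff
`ε ≤ 1/2`, and the crux needs any `ε > 0`; a method with no free parameter landing at `ε > 1/2`
proves a (conjecturally) false statement. Nothing on this ladder is refutable today: `M_2 = ∞`
would need `q_N ≥ c μ^N N^{-3}` along a set of positive logarithmic density, and the only proved
lower bounds on polygon numbers are stretched-exponential (§16). -/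

section Moments

open Literature.Barriers.CriticalPhenomena (isotropicPolygonCount)
open Summit.CriticalPhenomena.SAWScalingLimit.Theorems.CriticalBubbleBound.Negative
  (unrootedPolygonSeries isotropicPolygonCount_zero)

/-- The `k`-th moment of the critical polygon mass, `M_k = Σ_N N^k q_N x_c^N ∈ [0,∞]`. -/
def momentSeries (k : ℕ) : ℝ≥0∞ :=
  ∑' N : ℕ, ((N ^ k * isotropicPolygonCount N : ℕ) : ℝ≥0∞) * ENNReal.ofReal (criticalFugacity ^ N)

/-- `M_0 = 𝒫`, the unrooted polygon mass of §21. [folklore] -/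
theorem momentSeries_zero : momentSeries 0 = unrootedPolygonSeries := by
  unfold momentSeries unrootedPolygonSeries
  simp

/-- `M_1 = T`, the rooted polygon mass of §18 (the crux's normal form). [folklore] -/
theorem momentSeries_one : momentSeries 1 = polygonSeries := by
  unfold momentSeries polygonSeries
  simp

/-- The ladder is monotone in `k` (terms with `N = 0` vanish, `q_0 = 0`). [folklore] -/
theorem momentSeries_mono {k k' : ℕ} (h : k ≤ k') : momentSeries k ≤ momentSeries k' := by
  refine ENNReal.tsum_le_tsum fun N => ?_
  rcases Nat.eq_zero_or_pos N with rfl | hN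
  · simp [isotropicPolygonCount_zero]
  · have h1 : 1 ≤ N := hN
    gcongr

/-- The crux is the rung `k = 1`. [cite: MadrasSlade1993, §1.4] -/
theorem criticalBubbleBound_iff_momentSeries_one_ne_top : CriticalBubbleBound ↔ momentSeries 1 ≠ ⊤ := by
  rw [momentSeries_one]; exact criticalBubbleBound_iff_polygonSeries_ne_top

/-- Any finite rung `k ≥ 1` gives the crux (for `k ≥ 2` the hypothesis is conjecturally FALSE:
`θ = 5/2 < k + 1`). [folklore] -/
theorem criticalBubbleBound_of_momentSeries_ne_top {k : ℕ} (hk : 1 ≤ k) (h : momentSeries k ≠ ⊤) :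
    CriticalBubbleBound :=
  criticalBubbleBound_iff_momentSeries_one_ne_top.2 (ne_top_of_le_ne_top h (momentSeries_mono hk))

/-- The crux gives the rung `k = 0` (`𝒫 < ∞`, "θ > 1"; cf. §21, where `𝒫 ≤ x_c · A` is also
derived from the HALF-PLANE bubble alone). [folklore] -/
theorem momentSeries_zero_ne_top_of_criticalBubbleBound (h : CriticalBubbleBound) : momentSeries 0 ≠ ⊤ :=
  ne_top_of_le_ne_top (criticalBubbleBound_iff_momentSeries_one_ne_top.1 h) (momentSeries_mono zero_le_one)

/-- The moment ladder around the crux: `M_0 ≤ M_1 ≤ M_2 ≤ …`, crux `⟺ M_1 < ∞`. [folklore] -/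
theorem moment_ladder :
    momentSeries 0 ≤ momentSeries 1 ∧ momentSeries 1 ≤ momentSeries 2 ∧
      (CriticalBubbleBound ↔ momentSeries 1 ≠ ⊤) ∧ (momentSeries 2 ≠ ⊤ → CriticalBubbleBound) :=
  ⟨momentSeries_mono zero_le_one, momentSeries_mono one_le_two,
    criticalBubbleBound_iff_momentSeries_one_ne_top,
    criticalBubbleBound_of_momentSeries_ne_top one_le_two⟩

end Moments

/-! ## §26 (gen 5, prose) MODEL LEDGER — where the analogue of the crux is decided, and why none
of it transfers

| model (nearest-neighbour kernel at the model's own critical fugacity) | analogue of the crux | where |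
|---|---|---|
| `ℤ¹` SAW | TRUE (no polygons: `c_n(0,±1) = [n=1]`) | §19 `criticalBubbleBoundDim_one` |
| ladder `ℤ × {0,1}` SAW, more generally slits `ℤ × {0,…,L}` | TRUE, with exponential room | below (hand count) |
| `ℤ²` nearest-neighbour words (memoryless), fugacity `1/4` | FALSE (`Σ 1/n`) | §14 |
| `ℤ²` memoryless, HALF-PLANE arch kernel | TRUE (`Σ 1/n²`) | §17 |
| hexagonal lattice SAW, half-plane arch function | TRUE (`≤ 1/cos(3π/8)`, parafermion) | §20 |
| hexagonal lattice SAW, bulk kernel | OPEN | — |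
| `ℤ^d` SAW, `d ≥ 5` | TRUE (bubble condition, lace expansion) | §19 |
| `ℤ^d` SAW, `d = 2, 3, 4` | OPEN — `d = 2` is the crux | §19 |

LADDER (hand count, elementary): on `ℤ × {0,1}` a SAW from `(0,0)` to the rung neighbour `(0,1)`
of length `> 1` starts `E` (or `W`), must run along the bottom row to some column `m ≥ 1`, take the
rung, and return along the top row: once it leaves the bottom row at column `j` both sites of column
`j` are used, column `j` separates the strip, and the target lies on the other side unless the walk
turns back at once. So `c_n^{ladder}((0,0),(0,1)) = 2` for every odd `n ≥ 3` (`= 1` for `n = 1`),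
while all `n`-step ladder SAWs number at least `F_n` (Fibonacci: monotone words in `E` and
`rung+E`), so `μ_ladder ≥ (1+√5)/2 > 1` and the ladder's nearest-neighbour kernel
`Σ_n c_n^{ladder}(0,e₁) xⁿ` converges for EVERY `x < 1`, in particular at and beyond the ladder's
critical fugacity `1/μ_ladder`: its radius (`1`) strictly exceeds the susceptibility's radius. The
same splitting of radii holds in EVERY 2D slit `ℤ × {0,…,L}`: the growth constant of self-avoiding
polygons in a slit of finite width is STRICTLY LESS than that of SAWs in the same slit
(Soteros–Whittington, J. Phys. A 21 (1988) L857–L861, by a pattern that "fills" the slit — it occurs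
on walks, never on polygons; re-derived with transfer matrices by Alm–Janson 1990, who also show
`c_n^{(L)} = α μ_Lⁿ + o(μ_Lⁿ)`; READ this session in Guttmann (ed.), *Polygons, Polyominoes and
Polycubes*, LNP 775, §2.9.2 and Ch. 10 — `lit read book:editornd-polygons-polyominoes-polycubes`),
so the slit analogue of the crux is TRUE with exponential room for every finite `L`. The same source
records that this is a strictly two-dimensional phenomenon: for SAWs between two parallel planes of
`ℤ³` (slabs) polygons and walks have the SAME connective constant (Hammersley–Whittington 1985), so
the slab analogue is again a boundary case like the bulk.
ON `ℤ²` THE TWO RADII COINCIDE (Hammersley: `μ_SAP = μ_SAW`; typed §22 `polygonSeries_radius`: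
the rooted polygon series has radius exactly `x_c`), and the crux is the statement AT the common
radius — the sign of the polynomial correction `θ - 2`. Consequences for both sides:
(i) strip/transfer-matrix exhaustion `L → ∞` proves the crux only with an `L`-UNIFORM bound at
`x_c` (the finite-`L` statements are true for the wrong, exponential, reason and degenerate as
`μ_SAW(L) ↑ μ`); (ii) a soft low-dimensional DISPROOF mechanism must fail on every slit and on
`ℤ¹`, a soft high-dimensional PROOF mechanism must fail for the memoryless kernel (§14) — the crux
is sandwiched between true analogues on both sides and a false one in the middle, and only the
polygon exponent of planar SAW itself decides it. -/

end Summit.CriticalPhenomena.SAWScalingLimit.Cruxes.CriticalBubbleBound.Disproof
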